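import Literature.Computability.AlgebraicComplexity.PaddingBlindness
import Literature.Computability.AlgebraicComplexity.HwvIdealRankBound
import Literature.Computability.AlgebraicComplexity.MultiplicityObstructionsProofs
import Literature.Computability.AlgebraicComplexity.GCTObstructions
import Literature.NumberTheory.DiophantineGeometry.GLHighestWeightExistsUniqueProofs
import Literature.RepresentationTheory.GeneralLinear.OrbitLatticeCoinvariants
import Mathlib.Algebra.MvPolynomial.Funext
import Mathlib.Algebra.Polynomial.Roots
import Mathlib.LinearAlgebra.Matrix.Swap
import Mathlib.RepresentationTheory.Semisimple
import HarnessLib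

/-!
# The capability bound: how many more highest-weight equations can the orbit closure of a padded form
`x_t^e · ι h` have than that of `x_t^e · ι h'`, type by type (cell `pub-gct-max`, THEOREM V23-bis,
containment form and Pieri form)

Item 'lit1-v23bis-A' of the cell `pub-gct-max` (LIT-1 gens 22–23; statements accepted as typed by LEAD
D1757, THEORY-1 CHECK l.3161 PASS).  Desk documents `HOME/pub-gct-max-lit-1/CAPBOUND-PARTA.md` (print map,
GAP REPORT), `CAPBOUND-PARTB.md` (proof map of §0–§2) and `CAPBOUND-G1.md` (proof map of §6–§7: the
vanishing half of Pieri's rule for highest-weight vectors from root strings).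

**Setting** (as `PaddingBlindness.lean`, but the placement is BOREL-COMPATIBLE: `ι : σ → τ` strictly
monotone onto an upper set, as in `OrbitClosureInheritance.lean`, because highest-weight equations of
few-row type are transferred along `ι`; the padding letter `t ∉ range ι`).  `h, h'` forms of degree
`m ≠ 0` in `k[x_σ]`, padded forms `x_t^e · ι h` of degree `m + e`, a weight `χ` of `GL_τ` of degree `d`
(`|χ| = -(m+e) d`).  The **few-row predecessors of `χ` at distance `s = d·e`** are the weights `π` of
`GL_σ` with `π̂ := (π extended by zero along ι) = χ + α` for some `α : τ →₀ ℕ`, `|α| = s` — in partition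
terms (`χ = λ*`, `π = μ*`): `μ ⊂ λ` (containment of diagrams, `|λ/μ| = d e`).  The **deficit** of `h` at `π`
is `a_π - mult_π k[Δ_m(h)]` = the number of independent highest-weight EQUATIONS of `Δ_m(h)` of weight `π`.

**Theorems.**
* (C1′) `finrank_hwv_inf_pad_le_add_sum_hwDeficit`, (C1) `orbitMultiplicity_pad_le_add_sum_hwDeficit`:
  `mult_χ k[Δ(x_t^e ι h')] ≤ mult_χ k[Δ(x_t^e ι h)] + Σ_{π few-row predecessor of χ} deficit_π(h)`;
  (C2) `orbitMultiplicity_pad_le_of_forall_padPred(_of_mem_orbitClosure)`: the INCAPABLE criterion —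
  refines `PaddingBlindness.lean` (A1)/(A2).
* (C3) `orbitMultiplicity_pad_le_detFormLex_add_capDeficitSumContained` (+ `paddedPerFormLex`, `_of_lowerBounds`
  = the cell's `ε_cert` shape with NAMED lo-inputs, `_of_forall_contained` = INCAPABLE): the cell instance on
  the `m × m` matrix letters, `mult_{λ*}(x₀₀^{m-n} h') ≤ mult_{λ*}(det_m) + Σ_{μ ⊢ n d, ℓ(μ) ≤ n², μ ⊂ λ}
  (a_{μ*} - mult_{μ*} k[Δ(det_n)])`, UNCONDITIONAL.
* The PIERI-sharp forms (index set = horizontal strips; THEOREM V23-bis exactly), §7: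
  (C1′-Pieri) `finrank_hwv_inf_pad_le_add_sum_hwDeficit_pieri`, (C1-Pieri)
  `orbitMultiplicity_pad_le_add_sum_hwDeficit_pieri`, (C2-Pieri) `orbitMultiplicity_pad_le_of_forall_padPieri`
  (+ `_of_mem_orbitClosure`): the deficit sum runs over the PIERI predecessors `padPieriWeights` only
  (`π̂ = χ + α` a horizontal strip over `χ`: `IsHorizStripOver`); (C4)
  `orbitMultiplicity_pad_le_detFormLex_add_capDeficitSumPieri` (+ `paddedPerFormLex`, `_of_lowerBounds_pieri`,
  `_of_forall_horizStrip` = INCAPABLE, Pieri form): `mult_{λ*}(x₀₀^{m-n} h') ≤ mult_{λ*}(det_m) +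
  Σ_{λ/μ horizontal strip, ℓ(μ) ≤ n²} (a_{μ*} - mult_{μ*} k[Δ(det_n)])`, UNCONDITIONAL.  Only the VANISHING
  half of Pieri's formula is needed (no `S_ψ ⊂ S_χ ⊗ Sym^s` unless `ψ/χ` is a horizontal strip), and it is
  proved here for highest-weight vectors from the root-string bound of §6; the multiplicity-one half is not
  used.

**Proof** (KL14 §2 polarisation + an elementary leading-term count + root strings; no character theory):
(I) `padPolarize F ∈ (k[Sym^m k^τ])[c]` is the family `c ↦ F(ℓ_c^e · –)` as ONE polynomial in `c`; its
`c`-coefficients `G_α` lie in `I(GL_τ · ι h)` iff `F ∈ I(GL_τ · x_t^e ι h)` (`PaddingBlindness.mem_orbitVanishingIdeal_pad_iff`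
+ `forall_aeval_pad_eq_zero_iff_forall_coeff_padPolarize_mem`); COVARIANCE `b · G(c) = χ(b) G(b c)` for upper
triangular `b` (`map_coordSubst_padPolarize`), whence — comparing `c^α`-coefficients and using that `(b c)^{α'}`
has `c^{α'}`-coefficient `∏ b_xx^{α'_x}` and otherwise only monomials of smaller HEIGHT `Σ_x α_x #{y > x}`
(`htLead_matMonomial`) — a coefficient `G_α` all of whose higher-height colleagues lie in a subspace `W` is a
highest-weight vector of weight `χ + α` MODULO `W` (`coordSubst_coeff_padPolarize_sub_smul_mem`).
(II) `HeightFiltration.finrank_le_sum`: filtering a space of coefficient families by the top height present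
bounds its dimension by the sum of the dimensions of the spaces the leading coefficients live in.
(III) With `W = I_Sub = ⨅_q I(GL_τ · ι q)` (`subVanishingIdeal`; contained in `I(GL_τ · ι h')` for every `h'`):
highest-weight vectors modulo `W` lift (`exists_mem_highestWeightSpace_sub_mem`, complete reducibility of
`k[Sym^m]`, Bläser–Ikenmeyer Cor. 12.6), weights not vanishing off `range ι` contribute nothing
(`highestWeightSpace_le_subVanishingIdeal`, BLMW Prop. 6.3.2), few-row weights `π̂` contribute at most
`dim(HWV_π ∩ I(GL_σ · h)) = deficit_π(h)` (`highestWeightSpace_inf_orbitVanishingIdeal_extend_eq_map`).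
(IV) `finrank_hwv_inf_le_add_sum_of_pad` assembles (C1′); rank–nullity gives (C1); the matrix instance uses the
Borel-compatible placement `borelPlace` (last `n²` letters), placement-independence of padded forms
(`orbitMultiplicity_pad_rename_eq_rename`), `pad_detFormLex_mem_orbitClosure_detFormLex`, and BLMW (5.2.2)
(a weight of `GL_{n²}` with nonzero deficit is a dual partition weight) for the partition-indexed sum.
(V) §6 ROOT STRINGS (group form of Goodman–Wallach Lemma 3.2.2 with Prop. 3.2.7, any infinite field): the
torus weights of `span (U⁻ · v)` lie in `ψ - Q₊` (`exists_lowWeight_eq_of_mem_lowerSpan`, independence of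
characters), the transposition matrix of `(x y)` permutes weight spaces (`swap_apply_mem_weightSpace`), hence
a nonzero weight vector of weight `ψ - J(ε_x - ε_y)`, `x < y`, in the cyclic module of a highest-weight vector
of weight `ψ` has `J ≤ ψ_x - ψ_y` (`natCast_le_sub_of_mem_span_orbit`; with an equivariant projection,
`natCast_le_sub_of_family`).  §7 PIERI VANISHING (`coeff_padPolarize_mem_of_not_isHorizStripOver`): the root
subgroup `u_{xy}(t)` acts on the coefficient family by the STRING IDENTITY `u_{xy}(t) · G_γ =
Σ_{i ≤ γ_y} C(γ_x + i, i) t^i G_{γ + i e_x - i e_y}` (`coordSubst_transvectionGL_coeff_padPolarize`); if the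
leading class `G_α` (weight `ψ = χ + α` modulo `W`) were nonzero while interlacing fails at `x < y`
(`χ_x < ψ_y`), the string from `γ = α - α_x e_x + α_x e_y` would have length `J = α_x > ψ_x - ψ_y` —
contradiction; so only horizontal strips `χ + α` over `χ` carry leading classes, and the count (II) runs over
`padPieriWeights` (`finrank_hwv_inf_le_add_sum_of_pad_pieri`); Step D, Pieri form, translates
`IsHorizStripOver λ* μ̂*` into `partHorizStrip (m²) μ λ` (`sum_padPieriWeights_hwDeficit_le_capDeficitSumPieri`).

Honest framing (cell `pub-gct-max`): an elementary representation-theoretic bound assembled from printed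
parts (the assembled statement is the cell's THEOREM V23-bis, refereed R-V23BIS, in containment form and in
the Pieri form as refereed);
multiplicity data and certified rank bounds at small parameters; occurrence obstructions are ruled out in
print (BIP'16) — multiplicity obstructions are the open door; nothing here is a claim on VP vs VNP or P vs
NP.  No named facts (net debt 0); the definitions are plumbing (D-items of the gap report) and proof devices.

## References (print anchors; the assembled statement is the cell's, not print)
* [KadishLandsberg2014] §2, Prop. 1.12; [Landsberg2017] Prop. 8.4.1.1, §8.4.2 (Prop. 8.4.2.1/8.4.2.2), Thm. 8.1.3.1;
  [BurgisserEtAl2011] Prop. 6.3.2, §4.4, (5.2.2), §6.3; [FultonHarrisGTM129] (6.8)–(6.9) (Pieri), §14.1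
  (strings of weights); [DorflerIkenmeyerPanova2020] §5; [BlaeserIkenmeyer2025] Cor. 12.6 with Prop. 12.7;
  [GoodmanWallachGTM255] Lemma 3.2.2 (weights of `U(𝔫⁻) v₀` lie in `λ - Q₊`; PDF p. 241), Prop. 3.2.7 (2)–(3)
  (`W` permutes weight spaces; p. 248), Lemma 3.2.9 / Cor. 3.2.12 (root strings; pp. 249–251).
-/

noncomputable section

open MvPolynomial

namespace Literature.Computability.AlgebraicComplexity

open _root_.Literature.NumberTheory.DiophantineGeometry

section DItems

variable {k : Type*} [Field k] {σ τ : Type*} [Fintype σ] [LinearOrder σ] [Fintype τ]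
  [LinearOrder τ] {ι : σ → τ}

/-! ### §0 Few-row predecessors and deficits (D-items) -/

open Classical in
/-- **Few-row predecessors of a weight `χ` of `GL_τ` at distance `s`** (D1): the weights `π` of `GL_σ`
such that `π` extended by zero along `ι` equals `χ + α` for some `α : τ →₀ ℕ` with `|α| = s` — the
weights `χ + α` that vanish off `range ι`, restricted to `σ`.  For dual partition weights `χ = λ*`,
`π = μ*` this is containment `μ ⊂ λ` with `|λ| - |μ| = s`. [cite: KadishLandsberg2014, §2] -/
def padPredWeights (ι : σ → τ) (χ : Weight τ) (s : ℕ) : Finset (Weight σ) :=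
  (((Finset.univ : Finset τ).finsuppAntidiag s).filter
      (fun α : τ →₀ ℕ => ∀ x, x ∉ Set.range ι → χ x + (α x : ℤ) = 0)).image
    (fun α => fun j => χ (ι j) + (α (ι j) : ℤ))

/-- **The deficit of `h` at the weight `π`** (D2): `a_π - mult_π k[Δ_m(h)]`, the number of independent
highest-weight equations of weight `π` of `Δ_m(h)` (rank–nullity, `orbitMultiplicity_add_finrank_inf_eq_plethysmCoeff`;
`mult ≤ a` in characteristic zero, so the truncated subtraction is exact).  Cell: `δ₃(π; d) = a_π(d[3]) -
K_det₃(π; d)`. [cite: DorflerIkenmeyerPanova2020, §5] -/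
def hwDeficit (k : Type*) [Field k] (h : MvPolynomial σ k) (m : ℕ) (π : Weight σ) : ℕ :=
  plethysmCoeff k σ m π - orbitMultiplicity k h m π

/-- The deficit is the number of independent highest-weight equations (rank–nullity, `m ≠ 0`,
characteristic zero). [cite: DorflerIkenmeyerPanova2020, §5] -/
theorem hwDeficit_eq_finrank [CharZero k] (h : MvPolynomial σ k) {m : ℕ} (hm : m ≠ 0) (π : Weight σ) :
    hwDeficit k h m π = Module.finrank k ↥(highestWeightSpace (coordRep σ k m) π ⊓
      (orbitVanishingIdeal h m).restrictScalars k) := by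
  have := orbitMultiplicity_add_finrank_inf_eq_plethysmCoeff h hm π
  unfold hwDeficit
  omega

end DItems

end Literature.Computability.AlgebraicComplexity

/-!
## (II) The height filtration count

Abstract linear algebra behind the "leading coefficient of a semi-invariant family" argument:
if `S` is a finite-dimensional space of families `s : A → Q` indexed by a finite type `A` graded by
a height `φ : A → ℕ`, and the TOP nonzero coefficients of every member of `S` are constrained to lie
in prescribed finite-dimensional subspaces `H a ≤ Q` (precisely: whenever `s ∈ S` vanishes at all
indices of height `> φ a`, its coefficient `s a` lies in `H a`), then
`finrank S ≤ ∑ a, finrank (H a)` (filter `S` by the largest height carrying a nonzero coefficient).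
This is the pattern of `TensorWordModel.finrank_highestWeightSpace_succ_le`, made index-generic.
-/

namespace Literature.Computability.AlgebraicComplexity

namespace HeightFiltration

variable {k : Type*} [Field k] {A : Type*} {Q : Type*} [AddCommGroup Q] [Module k Q]

variable (S : Submodule k (A → Q)) (φ : A → ℕ)

/-- The `n`-th piece of the height filtration of `S`: members of `S` vanishing at every index of
height `≥ n`. [folklore] -/
private def piece (n : ℕ) : Submodule k (A → Q) where
  carrier := {s | s ∈ S ∧ ∀ a, n ≤ φ a → s a = 0}
  add_mem' {s t} hs ht := ⟨S.add_mem hs.1 ht.1, fun a ha => by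
    rw [Pi.add_apply, hs.2 a ha, ht.2 a ha, add_zero]⟩
  zero_mem' := ⟨S.zero_mem, fun _ _ => rfl⟩
  smul_mem' c {s} hs := ⟨S.smul_mem c hs.1, fun a ha => by
    rw [Pi.smul_apply, hs.2 a ha, smul_zero]⟩

variable {S φ}

/-- Membership in the `n`-th piece of the height filtration: `s ∈ S` vanishing at all `a` of height `≥ n`. [folklore] -/
private theorem mem_piece_iff {n : ℕ} {s : A → Q} :
    s ∈ piece S φ n ↔ s ∈ S ∧ ∀ a, n ≤ φ a → s a = 0 :=
  Iff.rfl

/-- Each piece of the height filtration lies in `S`. [folklore] -/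
private theorem piece_le (n : ℕ) : piece S φ n ≤ S := fun _ hs => hs.1

/-- The filtration starts at `0`. [folklore] -/
private theorem piece_zero : piece S φ 0 = ⊥ := by
  rw [Submodule.eq_bot_iff]
  intro s hs
  funext a
  exact hs.2 a (Nat.zero_le _)

/-- The filtration ends at `S` (any `n` above all heights). [folklore] -/
private theorem piece_eq_of_lt {n : ℕ} (hn : ∀ a, φ a < n) : piece S φ n = S := by
  refine le_antisymm (piece_le n) fun s hs => ⟨hs, fun a ha => ?_⟩
  exact absurd (hn a) (not_lt.mpr ha)

/-- One step of the filtration costs at most `∑_{φ a = n} finrank (H a)`: the map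
`s ↦ (s a)_{φ a = n}` sends the `(n+1)`-st piece into `Π_{φ a = n} H a` with kernel the `n`-th
piece. [folklore] -/
private theorem finrank_piece_succ_le [Fintype A] [Module.Finite k S] (H : A → Submodule k Q)
    [∀ a, Module.Finite k (H a)]
    (lead : ∀ s ∈ S, ∀ a, (∀ a', φ a < φ a' → s a' = 0) → s a ∈ H a) (n : ℕ) :
    Module.finrank k (piece S φ (n + 1)) ≤
      Module.finrank k (piece S φ n) +
        ∑ a ∈ Finset.univ.filter (fun a => φ a = n), Module.finrank k (H a) := by
  classical
  haveI : Module.Finite k (piece S φ (n + 1)) :=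
    Module.Finite.of_injective (Submodule.inclusion (piece_le (n + 1)))
      (Submodule.inclusion_injective _)
  haveI : Module.Finite k (piece S φ n) :=
    Module.Finite.of_injective (Submodule.inclusion (piece_le n))
      (Submodule.inclusion_injective _)
  -- the leading-coefficient map on the `(n+1)`-st piece
  let Φ : piece S φ (n + 1) →ₗ[k] (∀ a : {a // φ a = n}, H a.1) :=
    { toFun := fun s a => ⟨(s : A → Q) a.1,
        lead s s.2.1 a.1 fun a' ha' => s.2.2 a' (by rw [a.2] at ha'; exact ha')⟩
      map_add' := fun _ _ => funext fun _ => Subtype.ext rfl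
      map_smul' := fun _ _ => funext fun _ => Subtype.ext rfl }
  have hker : (LinearMap.ker Φ).map (piece S φ (n + 1)).subtype ≤ piece S φ n := by
    rintro _ ⟨s, hs, rfl⟩
    refine ⟨s.2.1, fun a ha => ?_⟩
    rcases ha.eq_or_lt with h | h
    · have := congrArg (fun f => ((f ⟨a, h.symm⟩ : H a) : Q)) (LinearMap.mem_ker.mp hs)
      exact this
    · exact s.2.2 a (Nat.succ_le_of_lt h)
  have h1 := LinearMap.finrank_range_add_finrank_ker Φ
  have h2 : Module.finrank k (LinearMap.range Φ) ≤
      Module.finrank k (∀ a : {a // φ a = n}, H a.1) :=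
    Submodule.finrank_le _
  have h3 : Module.finrank k (LinearMap.ker Φ) ≤ Module.finrank k (piece S φ n) := by
    rw [← Submodule.finrank_map_subtype_eq]
    exact Submodule.finrank_mono hker
  have h4 : Module.finrank k (∀ a : {a // φ a = n}, H a.1) =
      ∑ a ∈ Finset.univ.filter (fun a => φ a = n), Module.finrank k (H a) := by
    rw [Module.finrank_pi_fintype, Finset.sum_subtype (Finset.univ.filter fun a => φ a = n)
      (p := fun a => φ a = n) (fun a => by simp)]
  omega

/-- **The height filtration count.** `finrank S ≤ ∑ a, finrank (H a)`. [folklore] -/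
private theorem finrank_le_sum [Fintype A] [Module.Finite k S] (H : A → Submodule k Q)
    [∀ a, Module.Finite k (H a)]
    (lead : ∀ s ∈ S, ∀ a, (∀ a', φ a < φ a' → s a' = 0) → s a ∈ H a) :
    Module.finrank k S ≤ ∑ a, Module.finrank k (H a) := by
  classical
  have key : ∀ n : ℕ, Module.finrank k (piece S φ n) ≤
      ∑ a ∈ Finset.univ.filter (fun a => φ a < n), Module.finrank k (H a) := by
    intro n
    induction n with
    | zero =>
      rw [piece_zero, finrank_bot]
      exact Nat.zero_le _
    | succ n ih =>
      have step := finrank_piece_succ_le (S := S) (φ := φ) H lead n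
      have hsplit : Finset.univ.filter (fun a => φ a < n + 1) =
          Finset.univ.filter (fun a => φ a < n) ∪ Finset.univ.filter (fun a => φ a = n) := by
        ext a
        simp only [Finset.mem_filter, Finset.mem_univ, true_and, Finset.mem_union]
        omega
      have hdisj : Disjoint (Finset.univ.filter (fun a => φ a < n))
          (Finset.univ.filter (fun a => φ a = n)) := by
        rw [Finset.disjoint_filter]
        intro a _ h
        omega
      rw [hsplit, Finset.sum_union hdisj]
      omega
  -- take `n` above all heights
  obtain ⟨n, hn⟩ : ∃ n : ℕ, ∀ a, φ a < n :=
    ⟨(Finset.univ.sup φ) + 1, fun a => Nat.lt_succ_of_le (Finset.le_sup (Finset.mem_univ a))⟩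
  have := key n
  rw [piece_eq_of_lt hn] at this
  exact this.trans (Finset.sum_le_sum_of_subset_of_nonneg (Finset.filter_subset _ _)
    fun _ _ _ => Nat.zero_le _)

end HeightFiltration

end Literature.Computability.AlgebraicComplexity

/-!
## (III) Highest-weight lifting modulo a stable subspace, and the ideal `I_Sub` of the subspace variety

* `exists_mem_highestWeightSpace_sub_mem` — in a completely reducible representation of `GL σ k`,
  a vector that is a `B`-semi-invariant of weight `ψ` modulo a stable subspace `W` is congruent
  modulo `W` to a genuine highest-weight vector of weight `ψ` (complement of `W` + the argument of
  `map_highestWeightSpace_eq_of_surjective`).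
* `subVanishingIdeal ι m = ⨅_q I(GL_τ · ι q)` — the coordinate polynomials on `Sym^m k^τ`
  vanishing on every translate of every form in the letters `range ι` (the ideal of the subspace
  variety `Sub_{|σ|}(Sym^m k^τ)`, Landsberg 2017 §8.4.1), with: `GL`-stability, containment in each
  `I(GL_τ · ι q)`, (G5a) every highest-weight vector of `k[Sym^m k^τ]` whose weight does not
  vanish off `range ι` lies in it.
-/

open MvPolynomial

namespace Literature.Computability.AlgebraicComplexity

open _root_.Literature.NumberTheory.DiophantineGeometry
open _root_.Literature.Barriers.ValiantsHypothesis (degIdxMap degIdxMap_val degIdxMap_injective)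

/-! ### G2: lifting highest-weight vectors modulo a stable subspace -/

section Lifting

variable {σ k V : Type*} [Fintype σ] [LinearOrder σ] [Field k] [AddCommGroup V] [Module k V]
  {ρ : Representation k (GL σ k) V}

/-- **Highest-weight vectors lift modulo a stable subspace of a completely reducible
representation.** If `W` is a stable subspace of the completely reducible `ρ` and `v` satisfies
`ρ b v ≡ ψ(b) v (mod W)` for every upper triangular `b`, then `v ≡ z (mod W)` for a highest-weight
vector `z` of weight `ψ`: project `v` to a stable complement of `W`. (The mechanism of
Bläser–Ikenmeyer Cor. 12.6 / Prop. 12.7, as in `map_highestWeightSpace_eq_of_surjective`.)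
[cite: BlaeserIkenmeyer2025, Cor. 12.6 with Prop. 12.7] -/
theorem exists_mem_highestWeightSpace_sub_mem (hρ : ρ.IsSemisimpleRepresentation)
    (W : Subrepresentation ρ) {ψ : Weight σ} {v : V}
    (hv : ∀ g : GL σ k, IsUpperTriangular g → ρ g v - weightChar ψ g • v ∈ W.toSubmodule) :
    ∃ z ∈ highestWeightSpace ρ ψ, v - z ∈ W.toSubmodule := by
  obtain ⟨C, hC⟩ := hρ.exists_isCompl W
  have hC' : IsCompl W.toSubmodule C.toSubmodule :=
    ⟨by rw [disjoint_iff]; exact congrArg Subrepresentation.toSubmodule hC.1.eq_bot,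
     by rw [codisjoint_iff]; exact congrArg Subrepresentation.toSubmodule hC.2.eq_top⟩
  obtain ⟨w, hw, z, hz, rfl⟩ :=
    Submodule.mem_sup.mp (hC'.sup_eq_top.symm ▸ Submodule.mem_top (x := v))
  refine ⟨z, fun g hg => ?_, by rw [add_sub_cancel_right]; exact hw⟩
  have h1 : ρ g z - weightChar ψ g • z ∈ C.toSubmodule :=
    C.toSubmodule.sub_mem (C.apply_mem_toSubmodule g hz) (C.toSubmodule.smul_mem _ hz)
  have h2 : ρ g z - weightChar ψ g • z ∈ W.toSubmodule := by
    have h := hv g hg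
    have hw' : ρ g w - weightChar ψ g • w ∈ W.toSubmodule :=
      W.toSubmodule.sub_mem (W.apply_mem_toSubmodule g hw) (W.toSubmodule.smul_mem _ hw)
    have h' := W.toSubmodule.sub_mem h hw'
    have hcalc : ρ g (w + z) - weightChar ψ g • (w + z) - (ρ g w - weightChar ψ g • w) =
        ρ g z - weightChar ψ g • z := by
      rw [map_add, smul_add]; abel
    rwa [hcalc] at h'
  have h3 : ρ g z - weightChar ψ g • z = 0 := by
    have hd := hC'.1
    rw [disjoint_iff] at hd
    have hmem : ρ g z - weightChar ψ g • z ∈ W.toSubmodule ⊓ C.toSubmodule := ⟨h2, h1⟩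
    rw [hd] at hmem
    exact hmem
  exact sub_eq_zero.mp h3

end Lifting

/-! ### G5: the ideal of the subspace variety -/

section SubIdeal

variable {k : Type*} [Field k] {σ τ : Type*} [Fintype σ] [LinearOrder σ] [Fintype τ]
  [LinearOrder τ] {ι : σ → τ} {m : ℕ}

variable (k ι m) in
/-- The ideal `I_Sub = ⨅_q I(GL_τ · ι q)` of coordinate polynomials on `Sym^m k^τ` vanishing on
every `GL_τ`-translate of every form in the letters `range ι`, i.e. on the subspace variety
`Sub_{|σ|}(Sym^m k^τ)` (Landsberg 2017 §8.4.1; Kadish–Landsberg 2014 §2).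
[cite: Landsberg2017, §8.4.1] -/
noncomputable def subVanishingIdeal : Ideal (MvPolynomial (DegIdx τ m) k) :=
  ⨅ q : MvPolynomial σ k, orbitVanishingIdeal (rename ι q) m

omit [Fintype σ] [LinearOrder σ] in
/-- `I_Sub ≤ I(GL_τ · ι q)` for every `q`. [cite: Landsberg2017, §8.4.1] -/
theorem subVanishingIdeal_le (q : MvPolynomial σ k) :
    subVanishingIdeal k ι m ≤ orbitVanishingIdeal (rename ι q) m :=
  iInf_le _ q

omit [Fintype σ] [LinearOrder σ] in
/-- Membership in `I_Sub`: vanishing at `g · ι q` for all `g ∈ GL_τ` and all `q`.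
[cite: Landsberg2017, §8.4.1] -/
theorem mem_subVanishingIdeal_iff {G : MvPolynomial (DegIdx τ m) k} :
    G ∈ subVanishingIdeal k ι m ↔
      ∀ (q : MvPolynomial σ k) (g : GL τ k),
        aeval (formCoeff m (linSubstRep τ k g (rename ι q))) G = 0 := by
  simp only [subVanishingIdeal, Ideal.mem_iInf, mem_orbitVanishingIdeal_iff]

omit [Fintype σ] [LinearOrder σ] in
/-- `I_Sub` is `GL_τ`-stable. [cite: Landsberg2017, §8.4.1] -/
theorem coordSubst_mem_subVanishingIdeal (g : GL τ k) {G : MvPolynomial (DegIdx τ m) k}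
    (hG : G ∈ subVanishingIdeal k ι m) : coordSubst m g G ∈ subVanishingIdeal k ι m := by
  simp only [subVanishingIdeal, Ideal.mem_iInf] at hG ⊢
  exact fun q => orbitVanishingIdeal_le_comap_coordSubst _ m g (hG q)

variable (k ι m) in
/-- `I_Sub` as a subrepresentation of `coordRep τ k m`. [cite: Landsberg2017, §8.4.1] -/
noncomputable def subVanishingSubrep : Subrepresentation (coordRep τ k m) :=
  ⟨(subVanishingIdeal k ι m).restrictScalars k, fun g _ hG => coordSubst_mem_subVanishingIdeal g hG⟩

omit [Fintype σ] [LinearOrder σ] in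
/-- The underlying submodule of `subVanishingSubrep` is the `k`-restriction of `subVanishingIdeal`. [folklore] -/
@[simp]
private theorem subVanishingSubrep_toSubmodule :
    (subVanishingSubrep k ι m).toSubmodule = (subVanishingIdeal k ι m).restrictScalars k :=
  rfl

omit [LinearOrder σ] in
/-- **(G5a) Weights that do not vanish off `range ι` are equations of the subspace variety**:
for `ι` injective onto an upper set and `m ≠ 0` (characteristic zero), every highest-weight vector
of `k[Sym^m k^τ]` of a weight `ψ` with `ψ x ≠ 0` for some `x ∉ range ι` lies in `I_Sub`
(multiplicity zero in each `k[Δ_m(ι q)]`, BLMW Prop. 6.3.2, plus rank–nullity).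
[cite: BurgisserEtAl2011, Prop. 6.3.2] -/
theorem highestWeightSpace_le_subVanishingIdeal [CharZero k] (hι : Function.Injective ι)
    (hup : IsUpperSet (Set.range ι)) (hm : m ≠ 0) {ψ : Weight τ} {x : τ}
    (hx : x ∉ Set.range ι) (hψ : ψ x ≠ 0) :
    highestWeightSpace (coordRep τ k m) ψ ≤ (subVanishingIdeal k ι m).restrictScalars k := by
  haveI : Infinite k := CharZero.infinite k
  haveI : FiniteDimensional k (highestWeightSpace (coordRep τ k m) ψ) :=
    finiteDimensional_highestWeightSpace_coordRep_holds hm ψ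
  intro G hG
  rw [Submodule.restrictScalars_mem]
  simp only [subVanishingIdeal, Ideal.mem_iInf]
  intro q
  have h0 := orbitMultiplicity_rename_eq_zero_of_apply_ne_zero (k := k) hι hup q hm hx hψ
  have hrn := orbitMultiplicity_add_finrank_inf_eq_plethysmCoeff (rename ι q) hm ψ
  rw [h0, zero_add] at hrn
  have heq : highestWeightSpace (coordRep τ k m) ψ ⊓
      (orbitVanishingIdeal (rename ι q) m).restrictScalars k =
        highestWeightSpace (coordRep τ k m) ψ :=
    Submodule.eq_of_le_of_finrank_eq inf_le_left hrn
  have hG' : G ∈ highestWeightSpace (coordRep τ k m) ψ ⊓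
      (orbitVanishingIdeal (rename ι q) m).restrictScalars k := by
    rw [heq]; exact hG
  exact hG'.2

end SubIdeal

end Literature.Computability.AlgebraicComplexity

/-!
## (I) The polarisation family of a coordinate polynomial on `Sym^{m+e}`

For `F ∈ k[Sym^{m+e} k^τ]` the family `c ↦ G_c := F(ℓ_c^e · –)` (`ℓ_c = ∑ c_x x_x`) is a polynomial
in `c` with coefficients in `k[Sym^m k^τ]`; here it is constructed as ONE element
`padPolarize m e F ∈ (k[Sym^m k^τ])[c] = MvPolynomial τ (MvPolynomial (DegIdx τ m) k)` together with
* `aeval_formCoeff_evalC_padPolarize` — specialisation: `(padPolarize F)(c)(q) = F(ℓ_c^e · q)`;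
* `isHomogeneous_padPolarize` — it is homogeneous of degree `e·d` in `c` for `F` homogeneous of degree `d`;
* `evalC_map` / `eq_zero_of_forall_evalC_eq_zero` — evaluation in `c` commutes with maps of the
  coefficients, and (over an infinite field) a polynomial all of whose `c`-specialisations vanish is `0`.
-/

open MvPolynomial

namespace Literature.Computability.AlgebraicComplexity

open _root_.Literature.NumberTheory.DiophantineGeometry

variable {k : Type*} [Field k] {τ : Type*} [Fintype τ] [LinearOrder τ]

/-! ### Words and the coefficients of `ℓ_c^e · x^E` -/

section Words

variable {e : ℕ}

/-- The exponent vector `x_{w 0} ⋯ x_{w (e-1)}` of a word `w`. [folklore] -/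
private def wordMon (w : Fin e → τ) : τ →₀ ℕ := ∑ i, Finsupp.single (w i) 1

omit [Fintype τ] [LinearOrder τ] in
/-- The monomial of a word of length `e` has degree `e`. [folklore] -/
private theorem degree_wordMon (w : Fin e → τ) : (wordMon w).degree = e := by
  rw [wordMon, map_sum]
  simp [Finsupp.degree_single]

omit [Fintype τ] [LinearOrder τ] in
/-- A product of monomials with coefficient `1` is the monomial of the sum. [folklore] -/
private theorem prod_monomial_one {R : Type*} [CommSemiring R] {ι' : Type*} (s : Finset ι') (f : ι' → τ →₀ ℕ) :
    ∏ i ∈ s, (monomial (f i) (1 : R) : MvPolynomial τ R) = monomial (∑ i ∈ s, f i) 1 := by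
  classical
  induction s using Finset.induction_on with
  | empty => simp
  | insert a s ha ih => rw [Finset.prod_insert ha, Finset.sum_insert ha, ih, monomial_mul, one_mul]

omit [Fintype τ] [LinearOrder τ] in
/-- `∏_i x_{w i} = x^{wordMon w}`. [folklore] -/
private theorem prod_X_eq_monomial_wordMon {R : Type*} [CommSemiring R] (w : Fin e → τ) :
    (∏ i, X (w i) : MvPolynomial τ R) = monomial (wordMon w) 1 := by
  rw [wordMon, ← prod_monomial_one]
  rfl

omit [LinearOrder τ] in
/-- **Expansion of a power of a linear form over words**:
`ℓ_c^e = ∑_{w : Fin e → τ} (∏_i c_{w i}) x^{wordMon w}`. [folklore] -/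
private theorem padLinForm_pow_eq_sum (c : τ → k) (e : ℕ) :
    padLinForm c ^ e = ∑ w : Fin e → τ, C (∏ i, c (w i)) * monomial (wordMon w) (1 : k) := by
  have h1 : padLinForm c ^ e = ∏ _i : Fin e, ∑ x, C (c x) * (X x : MvPolynomial τ k) := by
    rw [Finset.prod_const, Finset.card_univ, Fintype.card_fin, padLinForm]
    refine congrArg (· ^ e) (Finset.sum_congr rfl fun x _ => ?_)
    rw [smul_eq_C_mul]
  rw [h1, Finset.prod_univ_sum]
  simp only [Fintype.piFinset_univ]
  refine Finset.sum_congr rfl fun w _ => ?_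
  rw [Finset.prod_mul_distrib, map_prod, prod_X_eq_monomial_wordMon]

variable {m : ℕ}

/-- The coefficient of `x^D` in `ℓ_c^e · x^E`, as a polynomial in `c`:
`∑_{w : wordMon w + E = D} ∏_i c_{w i}`. [folklore] -/
def padCoeffPoly (e : ℕ) (D : DegIdx τ (m + e)) (E : DegIdx τ m) : MvPolynomial τ k :=
  ∑ w ∈ (Finset.univ.filter fun w : Fin e → τ => wordMon w + E.1 = D.1), ∏ i, X (w i)

/-- `padCoeffPoly` computes the coefficient: `coeff_D (ℓ_c^e · x^E) = (padCoeffPoly e D E)(c)`.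
[folklore] -/
private theorem coeff_padLinForm_pow_mul_monomial (c : τ → k) (e : ℕ) (D : DegIdx τ (m + e)) (E : DegIdx τ m) :
    coeff D.1 (padLinForm c ^ e * monomial E.1 1) = eval c (padCoeffPoly (k := k) e D E) := by
  classical
  rw [padLinForm_pow_eq_sum, Finset.sum_mul, coeff_sum, padCoeffPoly, map_sum, Finset.sum_filter]
  refine Finset.sum_congr rfl fun w _ => ?_
  rw [mul_assoc, monomial_mul, one_mul, coeff_C_mul, coeff_monomial]
  split_ifs with h
  · rw [mul_one, map_prod]
    simp only [eval_X]
  · rw [mul_zero]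

/-- `padCoeffPoly e D E` is homogeneous of degree `e` in `c`. [folklore] -/
private theorem isHomogeneous_padCoeffPoly (e : ℕ) (D : DegIdx τ (m + e)) (E : DegIdx τ m) :
    (padCoeffPoly (k := k) e D E).IsHomogeneous e := by
  classical
  refine IsHomogeneous.sum _ _ _ fun w _ => ?_
  have h := IsHomogeneous.prod (Finset.univ : Finset (Fin e)) (fun i => (X (w i) : MvPolynomial τ k))
    (fun _ => 1) fun i _ => isHomogeneous_X k (w i)
  simpa using h

end Words

/-! ### The polarisation `F ↦ (c ↦ F(ℓ_c^e · –))` as a polynomial in `c` -/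

section Polarize

variable {m e : ℕ}

variable (k) in
/-- Evaluation of the `c`-variables at a point `c : τ → k`, for polynomials in `c` with coefficients in
a `k`-algebra `R`. [folklore] -/
def evalC (R : Type*) [CommSemiring R] [Algebra k R] (c : τ → k) : MvPolynomial τ R →ₐ[k] R :=
  (aeval (R := R) fun x => algebraMap k R (c x)).restrictScalars k

omit [Fintype τ] [LinearOrder τ] in
/-- Evaluating the coefficient variables at `c` fixes constants. [folklore] -/
@[simp]
private theorem evalC_C {R : Type*} [CommSemiring R] [Algebra k R] (c : τ → k) (r : R) :
    evalC k R c (C r) = r := by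
  simp [evalC]

omit [Fintype τ] [LinearOrder τ] in
/-- Evaluating the coefficient variables at `c` on a variable. [folklore] -/
@[simp]
private theorem evalC_X {R : Type*} [CommSemiring R] [Algebra k R] (c : τ → k) (x : τ) :
    evalC k R c (X x : MvPolynomial τ R) = algebraMap k R (c x) := by
  simp [evalC]

omit [Fintype τ] [LinearOrder τ] in
/-- Over `k` itself, `evalC` is evaluation. [folklore] -/
private theorem evalC_self_eq_eval (c : τ → k) (p : MvPolynomial τ k) : evalC k k c p = eval c p :=
  rfl

omit [Fintype τ] [LinearOrder τ] in
/-- `evalC` of base-changed polynomials: `evalC c (map (algebraMap k R) p) = algebraMap k R (p c)`.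
[folklore] -/
private theorem evalC_map_algebraMap {R : Type*} [CommSemiring R] [Algebra k R] (c : τ → k)
    (p : MvPolynomial τ k) :
    evalC k R c (map (algebraMap k R) p) = algebraMap k R (eval c p) := by
  change aeval (fun x => algebraMap k R (c x)) (map (algebraMap k R) p) = _
  rw [aeval_map_algebraMap]
  change aeval (algebraMap k R ∘ c) p = _
  rw [aeval_algebraMap_apply]
  rfl

omit [Fintype τ] [LinearOrder τ] in
/-- **Evaluation in `c` commutes with maps of the coefficients**: for a `k`-algebra map
`φ : R → R'`, `φ ((G)(c)) = (map φ G)(c)`. [folklore] -/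
private theorem evalC_map {R R' : Type*} [CommSemiring R] [Algebra k R] [CommSemiring R'] [Algebra k R']
    (φ : R →ₐ[k] R') (c : τ → k) (G : MvPolynomial τ R) :
    φ (evalC k R c G) = evalC k R' c (map (φ : R →+* R') G) := by
  revert G
  suffices h : (φ : R →+* R').comp (evalC k R c : MvPolynomial τ R →+* R) =
      (evalC k R' c : MvPolynomial τ R' →+* R').comp (map (φ : R →+* R')) from
    fun G => congrArg (fun ψ => ψ G) (congrArg DFunLike.coe h)
  refine ringHom_ext (fun r => ?_) (fun x => ?_)
  · simp
  · simp [AlgHom.commutes]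

/-- **A polynomial in `c` all of whose specialisations vanish is zero** (infinite field; coefficients
in a coordinate ring `k[Sym^m k^τ]`, tested at all points). [folklore] -/
private theorem eq_zero_of_forall_evalC_eq_zero [Infinite k] {G : MvPolynomial τ (MvPolynomial (DegIdx τ m) k)}
    (hG : ∀ c : τ → k, evalC k (MvPolynomial (DegIdx τ m) k) c G = 0) : G = 0 := by
  refine MvPolynomial.ext _ _ fun α => ?_
  rw [coeff_zero]
  refine MvPolynomial.funext fun p => ?_
  rw [map_zero]
  -- test the coefficients at the point `p`
  have h1 : map ((aeval p : MvPolynomial (DegIdx τ m) k →ₐ[k] k) : _ →+* k) G = 0 := by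
    refine MvPolynomial.funext fun c => ?_
    rw [map_zero, ← evalC_self_eq_eval, ← evalC_map, hG c, map_zero]
  have h2 := congrArg (coeff α) h1
  rw [coeff_map, coeff_zero] at h2
  rw [← coe_aeval_eq_eval]
  exact h2

variable (k) in
/-- **The polarisation.** The `k`-algebra map `k[Sym^{m+e} k^τ] → (k[Sym^m k^τ])[c]` substituting for
the coordinate `X_D` the polynomial `∑_E coeff_D(ℓ_c^e · x^E) X_E` (`coeff_D(ℓ_c^e x^E) = padCoeffPoly e D E`
as a polynomial in `c`): `padPolarize m e F` is the family `c ↦ F(ℓ_c^e · –)` of Kadish–Landsberg 2014 §2 as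
ONE polynomial in `c`. [cite: KadishLandsberg2014, §2] -/
def padPolarize (m e : ℕ) :
    MvPolynomial (DegIdx τ (m + e)) k →ₐ[k] MvPolynomial τ (MvPolynomial (DegIdx τ m) k) :=
  aeval fun D => ∑ E : DegIdx τ m,
    C (X E) * map (algebraMap k (MvPolynomial (DegIdx τ m) k)) (padCoeffPoly e D E)

/-- **Specialisation**: `(padPolarize F)(c)` evaluated at a form `q` of degree `m` is `F(ℓ_c^e · q)`.
[cite: KadishLandsberg2014, §2] -/
theorem aeval_formCoeff_evalC_padPolarize (c : τ → k) {q : MvPolynomial τ k} (hq : q.IsHomogeneous m)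
    (F : MvPolynomial (DegIdx τ (m + e)) k) :
    aeval (formCoeff m q) (evalC k (MvPolynomial (DegIdx τ m) k) c (padPolarize k m e F)) =
      aeval (formCoeff (m + e) (padLinForm c ^ e * q)) F := by
  suffices hcomp : ((aeval (formCoeff m q)).comp (evalC k (MvPolynomial (DegIdx τ m) k) c)).comp (padPolarize k m e) =
      aeval (formCoeff (m + e) (padLinForm c ^ e * q)) from congrArg (fun φ => φ F) hcomp
  apply MvPolynomial.algHom_ext
  intro D
  have hL : ((aeval (formCoeff m q)).comp (evalC k (MvPolynomial (DegIdx τ m) k) c)).comp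
        (padPolarize k m e) (X D) =
      ∑ E : DegIdx τ m, coeff E.1 q * eval c (padCoeffPoly (k := k) e D E) := by
    rw [AlgHom.comp_apply, AlgHom.comp_apply, padPolarize, aeval_X, map_sum, map_sum]
    refine Finset.sum_congr rfl fun E _ => ?_
    rw [map_mul, map_mul, evalC_C, evalC_map_algebraMap c (padCoeffPoly e D E), aeval_X,
      formCoeff_apply, AlgHom.commutes, Algebra.algebraMap_self, RingHom.id_apply]
  have hRHS : aeval (formCoeff (m + e) (padLinForm c ^ e * q)) (X D : MvPolynomial (DegIdx τ (m + e)) k) =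
      ∑ E : DegIdx τ m, coeff E.1 q * eval c (padCoeffPoly (k := k) e D E) := by
    rw [aeval_X, formCoeff_apply]
    conv_lhs => rw [← sum_coeff_smul_monomial_eq hq, Finset.mul_sum, coeff_sum]
    refine Finset.sum_congr rfl fun E _ => ?_
    rw [mul_smul_comm, coeff_smul, smul_eq_mul, coeff_padLinForm_pow_mul_monomial c e D E]
  rw [hL, hRHS]

/-- `padPolarize F` is homogeneous of degree `e·d` in `c` for `F` homogeneous of degree `d`. [folklore] -/
private theorem isHomogeneous_padPolarize {F : MvPolynomial (DegIdx τ (m + e)) k} {d : ℕ} (hF : F.IsHomogeneous d) :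
    (padPolarize k m e F).IsHomogeneous (e * d) := by
  have hg : ∀ D : DegIdx τ (m + e), (∑ E : DegIdx τ m,
      C (X E) * map (algebraMap k (MvPolynomial (DegIdx τ m) k)) (padCoeffPoly e D E)).IsHomogeneous e :=
    fun D => IsHomogeneous.sum _ _ e fun E _ => by
      have hp : (padCoeffPoly (k := k) e D E).IsHomogeneous e := isHomogeneous_padCoeffPoly e D E
      have h := (isHomogeneous_C _ (X E : MvPolynomial (DegIdx τ m) k)).mul
        (hp.map (algebraMap k (MvPolynomial (DegIdx τ m) k)))
      rwa [zero_add] at h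
  exact hF.aeval _ hg

/-- Hence the `c`-coefficients of `padPolarize F` vanish off degree `e·d`. [folklore] -/
private theorem coeff_padPolarize_eq_zero {F : MvPolynomial (DegIdx τ (m + e)) k} {d : ℕ} (hF : F.IsHomogeneous d)
    {α : τ →₀ ℕ} (hα : α.degree ≠ e * d) : coeff α (padPolarize k m e F) = 0 :=
  (isHomogeneous_padPolarize hF).coeff_eq_zero hα

end Polarize

/-! ### Coefficientwise vanishing -/

section Coefficientwise

variable {m e : ℕ}

/-- For a `k`-algebra map `φ : k[Sym^m k^τ] → k` (e.g. evaluation at a point), `map φ G = 0` iff every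
specialisation `φ (G(c))` vanishes (infinite field). [folklore] -/
private theorem map_eq_zero_iff_forall_evalC [Infinite k] (φ : MvPolynomial (DegIdx τ m) k →ₐ[k] k)
    (G : MvPolynomial τ (MvPolynomial (DegIdx τ m) k)) :
    map (φ : MvPolynomial (DegIdx τ m) k →+* k) G = 0 ↔
      ∀ c : τ → k, φ (evalC k (MvPolynomial (DegIdx τ m) k) c G) = 0 := by
  constructor
  · intro h c
    rw [evalC_map, h, map_zero]
  · intro h
    refine MvPolynomial.funext fun c => ?_
    rw [map_zero, ← evalC_self_eq_eval, ← evalC_map, h c]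

/-- **Coefficientwise vanishing on an orbit.** For a form `p` of degree `m`:
`F(ℓ_c^e · g p) = 0` for all `c` and all `g ∈ GL_τ` iff every `c`-coefficient of `padPolarize F` lies in
the vanishing ideal `I(GL_τ · p)`. With `p = ι h` and `mem_orbitVanishingIdeal_pad_iff`
(`PaddingBlindness`): `F ∈ I(GL_τ · x_t^e ι h)` iff all `coeff α (padPolarize F) ∈ I(GL_τ · ι h)`.
[cite: KadishLandsberg2014, §2] -/
theorem forall_aeval_pad_eq_zero_iff_forall_coeff_padPolarize_mem [Infinite k] {p : MvPolynomial τ k}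
    (hp : p.IsHomogeneous m) (F : MvPolynomial (DegIdx τ (m + e)) k) :
    (∀ (c : τ → k) (g : GL τ k),
        aeval (formCoeff (m + e) (padLinForm c ^ e * linSubstRep τ k g p)) F = 0) ↔
      ∀ α : τ →₀ ℕ, coeff α (padPolarize k m e F) ∈ orbitVanishingIdeal p m := by
  have key : ∀ g : GL τ k,
      (∀ c : τ → k, aeval (formCoeff (m + e) (padLinForm c ^ e * linSubstRep τ k g p)) F = 0) ↔
        map ((aeval (formCoeff m (linSubstRep τ k g p)) : MvPolynomial (DegIdx τ m) k →ₐ[k] k) :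
            MvPolynomial (DegIdx τ m) k →+* k) (padPolarize k m e F) = 0 := by
    intro g
    have hq : (linSubstRep τ k g p).IsHomogeneous m := linSubst_isHomogeneous _ hp
    rw [map_eq_zero_iff_forall_evalC]
    refine forall_congr' fun c => ?_
    rw [aeval_formCoeff_evalC_padPolarize c hq F]
  constructor
  · intro h α
    rw [mem_orbitVanishingIdeal_iff]
    intro g
    have h1 := (key g).mp fun c => h c g
    have h2 := congrArg (coeff α) h1
    rwa [coeff_map, coeff_zero] at h2
  · intro h c g
    refine ((key g).mpr ?_) c
    refine MvPolynomial.ext _ _ fun α => ?_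
    rw [coeff_map, coeff_zero]
    exact mem_orbitVanishingIdeal_iff.mp (h α) g

end Coefficientwise

/-! ### Covariance under the Borel subgroup -/

section Covariance

variable {m e : ℕ}

omit [LinearOrder τ] in
/-- Linear substitution of a linear form: `A · ℓ_c = ℓ_{A c}` (tree: private in `PaddingBlindness`).
[folklore] -/
private theorem linSubst_padLinForm (A : Matrix τ τ k) (c : τ → k) :
    linSubst τ k A (padLinForm c) = padLinForm (A.mulVec c) := by
  simp only [padLinForm, map_sum, map_smul, linSubst_X, Finset.smul_sum, smul_smul]
  rw [Finset.sum_comm]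
  refine Finset.sum_congr rfl fun j _ => ?_
  rw [← Finset.sum_smul, Matrix.mulVec, dotProduct]
  refine congrArg (fun a : k => a • (X j : MvPolynomial τ k)) (Finset.sum_congr rfl fun x _ => ?_)
  exact mul_comm _ _

/-- `ℓ_c^e · (b⁻¹ q) = b⁻¹ · (ℓ_{b c}^e · q)`. [folklore] -/
private theorem padLinForm_pow_mul_linSubstRep_inv (b : GL τ k) (c : τ → k) (e : ℕ) (q : MvPolynomial τ k) :
    padLinForm c ^ e * linSubstRep τ k b⁻¹ q =
      linSubstRep τ k b⁻¹ (padLinForm ((b : Matrix τ τ k).mulVec c) ^ e * q) := by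
  rw [linSubstRep_apply, linSubstRep_apply, map_mul, map_pow, linSubst_padLinForm,
    Matrix.mulVec_mulVec, Matrix.coe_units_inv, Matrix.nonsing_inv_mul _
      ((Matrix.isUnit_iff_isUnit_det _).mp b.isUnit), Matrix.one_mulVec]

/-- **Covariance of the polarisation family (pointwise).** For a highest-weight vector `F` of weight
`χ` and an upper triangular `b`: `b · (padPolarize F)(c) = χ(b) (padPolarize F)(b c)` in `k[Sym^m k^τ]`.
[cite: KadishLandsberg2014, §2] -/
theorem coordSubst_evalC_padPolarize [Infinite k] {χ : Weight τ} {F : MvPolynomial (DegIdx τ (m + e)) k}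
    (hF : F ∈ highestWeightSpace (coordRep τ k (m + e)) χ) {b : GL τ k} (hb : IsUpperTriangular b)
    (c : τ → k) :
    coordSubst m b (evalC k (MvPolynomial (DegIdx τ m) k) c (padPolarize k m e F)) =
      weightChar χ b •
        evalC k (MvPolynomial (DegIdx τ m) k) ((b : Matrix τ τ k).mulVec c) (padPolarize k m e F) := by
  refine MvPolynomial.funext fun P => ?_
  obtain ⟨q, hq, rfl⟩ := exists_isHomogeneous_formCoeff_eq (k := k) (σ := τ) (m := m) P
  change aeval (formCoeff m q) _ = aeval (formCoeff m q) _
  have hq' : (linSubstRep τ k b⁻¹ q).IsHomogeneous m := linSubst_isHomogeneous _ hq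
  rw [aeval_formCoeff_coordSubst, aeval_formCoeff_evalC_padPolarize c hq' F,
    padLinForm_pow_mul_linSubstRep_inv, ← aeval_formCoeff_coordSubst, ← coordRep_apply, hF b hb,
    map_smul, map_smul, aeval_formCoeff_evalC_padPolarize _ hq F]

variable (k) in
/-- Linear substitution `c ↦ A c` of the `c`-variables (coefficients in a `k`-algebra `R` untouched):
`X_x ↦ ∑_y A_{x y} X_y`. [folklore] -/
def substC (R : Type*) [CommSemiring R] [Algebra k R] (A : Matrix τ τ k) :
    MvPolynomial τ R →ₐ[k] MvPolynomial τ R :=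
  (aeval (R := R) fun x => ∑ y, A x y • (X y : MvPolynomial τ R)).restrictScalars k

omit [LinearOrder τ] in
/-- The substitution `c ↦ A c` fixes constants. [folklore] -/
@[simp]
private theorem substC_C {R : Type*} [CommSemiring R] [Algebra k R] (A : Matrix τ τ k) (r : R) :
    substC k R A (C r) = C r := by
  simp [substC]

omit [LinearOrder τ] in
/-- The substitution `c ↦ A c` on a variable: row `x` of `A` applied to the variables. [folklore] -/
@[simp]
private theorem substC_X {R : Type*} [CommSemiring R] [Algebra k R] (A : Matrix τ τ k) (x : τ) :
    substC k R A (X x) = ∑ y, A x y • (X y : MvPolynomial τ R) := by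
  simp [substC]

omit [LinearOrder τ] in
/-- `(substC A G)(c) = G(A c)`. [folklore] -/
private theorem evalC_substC {R : Type*} [CommSemiring R] [Algebra k R] (A : Matrix τ τ k) (c : τ → k)
    (G : MvPolynomial τ R) : evalC k R c (substC k R A G) = evalC k R (A.mulVec c) G := by
  revert G
  suffices h : (evalC k R c : MvPolynomial τ R →+* R).comp (substC k R A : MvPolynomial τ R →+* _) =
      (evalC k R (A.mulVec c) : MvPolynomial τ R →+* R) from
    fun G => congrArg (fun ψ => ψ G) (congrArg DFunLike.coe h)
  refine ringHom_ext (fun r => ?_) (fun x => ?_)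
  · simp
  · simp [Matrix.mulVec, dotProduct, Algebra.smul_def]

/-- **Covariance of the polarisation family (as polynomials in `c`).** For a highest-weight vector `F`
of weight `χ` and an upper triangular `b`, applying `b` to the coefficients of `padPolarize F` is the same
as substituting `c ↦ b c` and multiplying by `χ(b)`. [cite: KadishLandsberg2014, §2] -/
theorem map_coordSubst_padPolarize [Infinite k] {χ : Weight τ} {F : MvPolynomial (DegIdx τ (m + e)) k}
    (hF : F ∈ highestWeightSpace (coordRep τ k (m + e)) χ) {b : GL τ k} (hb : IsUpperTriangular b) :
    map (coordSubst m b : MvPolynomial (DegIdx τ m) k →+* MvPolynomial (DegIdx τ m) k)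
        (padPolarize k m e F) =
      weightChar χ b • substC k (MvPolynomial (DegIdx τ m) k) (b : Matrix τ τ k) (padPolarize k m e F) := by
  refine sub_eq_zero.mp (eq_zero_of_forall_evalC_eq_zero fun c => ?_)
  have h1 := (evalC_map (coordSubst m b) c (padPolarize k m e F)).symm
  rw [map_sub, map_smul, evalC_substC, h1, coordSubst_evalC_padPolarize hF hb c, sub_self]

end Covariance

/-! ### The `c`-coefficients of a substituted family, and height triangularity -/

section Triangular

/-- `(A c)^α = ∏_x (∑_y A_{x y} c_y)^{α_x}` as a polynomial in `c`. [folklore] -/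
private def matMonomial (A : Matrix τ τ k) (α : τ →₀ ℕ) : MvPolynomial τ k :=
  ∏ x, (∑ y, A x y • (X y : MvPolynomial τ k)) ^ (α x)

omit [LinearOrder τ] in
/-- `substC A (x^α · r) = r · (A c)^α`. [folklore] -/
private theorem substC_monomial {R : Type*} [CommSemiring R] [Algebra k R] (A : Matrix τ τ k) (α : τ →₀ ℕ)
    (r : R) : substC k R A (monomial α r) = C r * map (algebraMap k R) (matMonomial A α) := by
  change aeval (fun x => ∑ y, A x y • (X y : MvPolynomial τ R)) (monomial α r) = _
  rw [aeval_monomial, Finsupp.prod_fintype _ _ fun _ => pow_zero _, matMonomial, map_prod]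
  refine congrArg₂ (· * ·) rfl (Finset.prod_congr rfl fun x _ => ?_)
  rw [map_pow, map_sum]
  refine congrArg (· ^ α x) (Finset.sum_congr rfl fun y _ => ?_)
  rw [smul_eq_C_mul, map_mul, map_C, map_X, Algebra.smul_def, MvPolynomial.algebraMap_apply]

omit [LinearOrder τ] in
/-- **The `c`-coefficients after substitution**:
`coeff_β (substC A G) = ∑_{α ∈ supp G} coeff_β((A c)^α) · coeff_α G`. [folklore] -/
private theorem coeff_substC {R : Type*} [CommSemiring R] [Algebra k R] (A : Matrix τ τ k)
    (G : MvPolynomial τ R) (β : τ →₀ ℕ) :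
    coeff β (substC k R A G) = ∑ α ∈ G.support, coeff β (matMonomial A α) • coeff α G := by
  conv_lhs => rw [G.as_sum, map_sum, coeff_sum]
  refine Finset.sum_congr rfl fun α _ => ?_
  rw [substC_monomial, coeff_C_mul, coeff_map, Algebra.smul_def, mul_comm]

/-- The number of letters above `x`: a strictly decreasing function of `x`. [folklore] -/
def lettersAbove (x : τ) : ℕ := (Finset.univ.filter fun y => x < y).card

/-- `lettersAbove` is strictly decreasing. [folklore] -/
private theorem lettersAbove_lt_of_lt {x y : τ} (hxy : x < y) : lettersAbove y < lettersAbove x := by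
  unfold lettersAbove
  refine Finset.card_lt_card ⟨fun z hz => ?_, fun h => ?_⟩
  · simp only [Finset.mem_filter, Finset.mem_univ, true_and] at hz ⊢
    exact lt_trans hxy hz
  · have hy : y ∈ Finset.univ.filter fun z => x < z := by simp [hxy]
    have := h hy
    simp at this

/-- The HEIGHT of an exponent vector: `∑_x α_x · #{y > x}`.  Moving a unit of mass from a letter to a
larger letter strictly lowers the height; this replaces the lexicographic order in the leading-term
argument. [folklore] -/
def height (α : τ →₀ ℕ) : ℕ := ∑ x, α x * lettersAbove x

omit [LinearOrder τ] in
/-- A weighted sum over the exponent `α + β` splits. [folklore] -/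
private theorem sum_finsupp_add_mul (α β : τ →₀ ℕ) (f : τ → ℕ) :
    ∑ x, (α + β) x * f x = ∑ x, α x * f x + ∑ x, β x * f x := by
  rw [← Finset.sum_add_distrib]
  exact Finset.sum_congr rfl fun x _ => by rw [Finsupp.add_apply, add_mul]

/-- `height` is additive. [folklore] -/
private theorem height_add (α β : τ →₀ ℕ) : height (α + β) = height α + height β :=
  sum_finsupp_add_mul α β lettersAbove

/-- The height of `n e_x` is `n · lettersAbove x`. [folklore] -/
private theorem height_single (x : τ) (n : ℕ) : height (Finsupp.single x n) = n * lettersAbove x := by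
  classical
  rw [height, Finset.sum_eq_single x]
  · rw [Finsupp.single_eq_same]
  · intro y _ hy
    rw [Finsupp.single_eq_of_ne hy, zero_mul]
  · intro h
    exact absurd (Finset.mem_univ x) h

/-- `HtLead P α a`: every monomial of `P` other than `x^α` has height `< height α`, and the coefficient
of `x^α` is `a`. [folklore] -/
private def HtLead (P : MvPolynomial τ k) (α : τ →₀ ℕ) (a : k) : Prop :=
  (∀ β ∈ P.support, β = α ∨ height β < height α) ∧ coeff α P = a

/-- `1` has height-leading term `x^0` with coefficient `1`. [folklore] -/
private theorem HtLead.one : HtLead (1 : MvPolynomial τ k) 0 1 := by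
  classical
  refine ⟨fun β hβ => Or.inl ?_, coeff_zero_one⟩
  rw [mem_support_iff, coeff_one] at hβ
  by_contra h
  exact hβ (if_neg (Ne.symm h))

open Pointwise in
/-- Height-leading terms multiply. [folklore] -/
private theorem HtLead.mul {P₁ P₂ : MvPolynomial τ k} {α₁ α₂ : τ →₀ ℕ} {a₁ a₂ : k} (h₁ : HtLead P₁ α₁ a₁)
    (h₂ : HtLead P₂ α₂ a₂) : HtLead (P₁ * P₂) (α₁ + α₂) (a₁ * a₂) := by
  classical
  refine ⟨fun β hβ => ?_, ?_⟩
  · obtain ⟨β₁, hβ₁, β₂, hβ₂, rfl⟩ := Finset.mem_add.mp (support_mul P₁ P₂ hβ)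
    rcases h₁.1 β₁ hβ₁ with rfl | hlt₁ <;> rcases h₂.1 β₂ hβ₂ with rfl | hlt₂
    · exact Or.inl rfl
    · right; rw [height_add, height_add]; omega
    · right; rw [height_add, height_add]; omega
    · right; rw [height_add, height_add]; omega
  · rw [coeff_mul, Finset.sum_eq_single (α₁, α₂)]
    · rw [h₁.2, h₂.2]
    · rintro ⟨β₁, β₂⟩ hβ hne
      rw [Finset.mem_antidiagonal] at hβ
      by_contra hprod
      have hc₁ : coeff β₁ P₁ ≠ 0 := fun h => hprod (by rw [h, zero_mul])
      have hc₂ : coeff β₂ P₂ ≠ 0 := fun h => hprod (by rw [h, mul_zero])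
      have hh : height β₁ + height β₂ = height α₁ + height α₂ := by
        rw [← height_add, ← height_add, hβ]
      rcases h₁.1 β₁ (mem_support_iff.mpr hc₁) with rfl | hlt₁ <;>
        rcases h₂.1 β₂ (mem_support_iff.mpr hc₂) with rfl | hlt₂
      · exact hne rfl
      · omega
      · omega
      · omega
    · intro h
      exact (h (Finset.mem_antidiagonal.mpr rfl)).elim

/-- Height-leading terms of powers. [folklore] -/
private theorem HtLead.pow {P : MvPolynomial τ k} {α : τ →₀ ℕ} {a : k} (h : HtLead P α a) (n : ℕ) :
    HtLead (P ^ n) (n • α) (a ^ n) := by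
  induction n with
  | zero => rw [pow_zero, zero_nsmul, pow_zero]; exact HtLead.one
  | succ n ih => rw [pow_succ, succ_nsmul, pow_succ]; exact ih.mul h

/-- Height-leading terms of finite products. [folklore] -/
private theorem HtLead.prod {ι' : Type*} (s : Finset ι') {P : ι' → MvPolynomial τ k} {α : ι' → τ →₀ ℕ}
    {a : ι' → k} (h : ∀ i ∈ s, HtLead (P i) (α i) (a i)) :
    HtLead (∏ i ∈ s, P i) (∑ i ∈ s, α i) (∏ i ∈ s, a i) := by
  classical
  induction s using Finset.induction_on with
  | empty => simpa using (HtLead.one (k := k) (τ := τ))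
  | insert i s hi ih =>
    rw [Finset.prod_insert hi, Finset.sum_insert hi, Finset.prod_insert hi]
    exact (h i (Finset.mem_insert_self i s)).mul (ih fun j hj => h j (Finset.mem_insert_of_mem hj))

/-- The rows of an upper triangular matrix as linear forms in `c`: `∑_y A_{x y} c_y` has leading term
`A_{x x} c_x`, all other terms of smaller height. [folklore] -/
private theorem htLead_row {A : Matrix τ τ k} (hA : A.BlockTriangular id) (x : τ) :
    HtLead (∑ y, A x y • (X y : MvPolynomial τ k)) (Finsupp.single x 1) (A x x) := by
  classical
  refine ⟨fun β hβ => ?_, ?_⟩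
  · obtain ⟨y, -, hy⟩ := Finset.mem_biUnion.mp (support_sum hβ)
    rw [smul_eq_C_mul, mem_support_iff, coeff_C_mul, coeff_X] at hy
    split_ifs at hy with hxy
    · subst hxy
      rcases lt_trichotomy x y with hlt | rfl | hgt
      · exact Or.inr (by rw [height_single, height_single, one_mul, one_mul]; exact lettersAbove_lt_of_lt hlt)
      · exact Or.inl rfl
      · exact absurd (hA hgt) (by rw [mul_one] at hy; exact hy)
    · exact absurd (mul_zero _) hy
  · rw [coeff_sum, Finset.sum_eq_single x]
    · rw [smul_eq_C_mul, coeff_C_mul, coeff_X, if_pos rfl, mul_one]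
    · intro y _ hyx
      rw [smul_eq_C_mul, coeff_C_mul, coeff_X, if_neg, mul_zero]
      exact fun h => hyx ((Finsupp.single_left_inj one_ne_zero).mp h)
    · intro h
      exact absurd (Finset.mem_univ x) h

/-- **Height triangularity of `(A c)^α` for upper triangular `A`**: all monomials other than `c^α` have
smaller height, and the coefficient of `c^α` is `∏_x A_{x x}^{α_x}`. [folklore] -/
private theorem htLead_matMonomial {A : Matrix τ τ k} (hA : A.BlockTriangular id) (α : τ →₀ ℕ) :
    HtLead (matMonomial A α) α (∏ x, A x x ^ α x) := by
  have h := HtLead.prod (Finset.univ : Finset τ)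
    (P := fun x => (∑ y, A x y • (X y : MvPolynomial τ k)) ^ α x)
    (α := fun x => α x • Finsupp.single x 1) (a := fun x => A x x ^ α x)
    fun x _ => (htLead_row hA x).pow (α x)
  have hα : ∑ x, α x • Finsupp.single x 1 = α := by
    simp only [Finsupp.smul_single_one]
    exact Finsupp.univ_sum_single α
  rwa [hα] at h

end Triangular


/-! ### The leading coefficients of the polarisation family are highest-weight vectors modulo `W` -/

section Lead

variable {m e : ℕ}

/-- The integer weight of an exponent vector `α : τ →₀ ℕ`. [folklore] -/
def natWeight (α : τ →₀ ℕ) : Weight τ := fun x => (α x : ℤ)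

omit [Fintype τ] [LinearOrder τ] in
/-- Unfolding `natWeight`. [folklore] -/
@[simp]
private theorem natWeight_apply (α : τ →₀ ℕ) (x : τ) : natWeight α x = (α x : ℤ) := rfl

/-- The character `natWeight α` at `g` is `∏_x g_xx^{α_x}`. [folklore] -/
private theorem weightChar_natWeight (α : τ →₀ ℕ) (g : GL τ k) :
    weightChar (natWeight α) g = ∏ x, (g : Matrix τ τ k) x x ^ α x := by
  simp only [weightChar, natWeight_apply, zpow_natCast]

/-- On upper triangular elements the weight character is additive in the weight. [folklore] -/
private theorem weightChar_add_upper (χ ψ : Weight τ) {g : GL τ k} (hg : IsUpperTriangular g) :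
    weightChar (χ + ψ) g = weightChar χ g * weightChar ψ g := by
  simp only [weightChar, Pi.add_apply, ← Finset.prod_mul_distrib]
  refine Finset.prod_congr rfl fun i _ => ?_
  rw [zpow_add₀ (diag_ne_zero_of_isUpperTriangular hg i)]

/-- **Leading coefficients are highest-weight vectors modulo `W`.** Let `F` be a highest-weight vector
of weight `χ` in `k[Sym^{m+e} k^τ]`, `W` any subspace of `k[Sym^m k^τ]`, and `α` an exponent vector
such that every `c`-coefficient of `padPolarize F` of LARGER height lies in `W`. Then the coefficient
`G_α = coeff α (padPolarize F)` satisfies `b · G_α ≡ (χ + α)(b) G_α (mod W)` for every upper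
triangular `b` (compare the `c^α`-coefficients in the covariance identity; the other contributions come
from exponents of larger height by `htLead_matMonomial`). [cite: KadishLandsberg2014, §2] -/
theorem coordSubst_coeff_padPolarize_sub_smul_mem [Infinite k] {χ : Weight τ}
    {F : MvPolynomial (DegIdx τ (m + e)) k} (hF : F ∈ highestWeightSpace (coordRep τ k (m + e)) χ)
    (W : Submodule k (MvPolynomial (DegIdx τ m) k)) {α : τ →₀ ℕ}
    (hlead : ∀ α', height α < height α' → coeff α' (padPolarize k m e F) ∈ W)
    {b : GL τ k} (hb : IsUpperTriangular b) :
    coordSubst m b (coeff α (padPolarize k m e F)) -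
      weightChar (χ + natWeight α) b • coeff α (padPolarize k m e F) ∈ W := by
  classical
  have hcov := congrArg (coeff α) (map_coordSubst_padPolarize hF hb)
  rw [coeff_map, RingHom.coe_coe, coeff_smul, coeff_substC] at hcov
  -- the contributions of exponents other than `α` lie in `W`
  have hoff : ∀ α' ∈ (padPolarize k m e F).support, α' ≠ α →
      coeff α (matMonomial (b : Matrix τ τ k) α') • coeff α' (padPolarize k m e F) ∈ W := by
    intro α' _ hne
    by_cases hc : coeff α (matMonomial (b : Matrix τ τ k) α') = 0
    · rw [hc, zero_smul]; exact W.zero_mem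
    · rcases (htLead_matMonomial hb α').1 α (mem_support_iff.mpr hc) with h | h
      · exact absurd h.symm hne
      · exact W.smul_mem _ (hlead α' h)
  have hdiag : coeff α (matMonomial (b : Matrix τ τ k) α) = ∏ x, (b : Matrix τ τ k) x x ^ α x :=
    (htLead_matMonomial hb α).2
  have hsum : ∑ α' ∈ (padPolarize k m e F).support,
        coeff α (matMonomial (b : Matrix τ τ k) α') • coeff α' (padPolarize k m e F) -
      (∏ x, (b : Matrix τ τ k) x x ^ α x) • coeff α (padPolarize k m e F) ∈ W := by
    by_cases hα : α ∈ (padPolarize k m e F).support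
    · rw [← Finset.add_sum_erase _ _ hα, hdiag, add_sub_cancel_left]
      exact W.sum_mem fun α' hα' =>
        hoff α' (Finset.mem_of_mem_erase hα') (Finset.ne_of_mem_erase hα')
    · have h0 : coeff α (padPolarize k m e F) = 0 := notMem_support_iff.mp hα
      rw [h0, smul_zero, sub_zero]
      exact W.sum_mem fun α' hα' => hoff α' hα' fun h => hα (h ▸ hα')
  have key : coordSubst m b (coeff α (padPolarize k m e F)) -
      weightChar (χ + natWeight α) b • coeff α (padPolarize k m e F) =
      weightChar χ b • (∑ α' ∈ (padPolarize k m e F).support,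
        coeff α (matMonomial (b : Matrix τ τ k) α') • coeff α' (padPolarize k m e F) -
      (∏ x, (b : Matrix τ τ k) x x ^ α x) • coeff α (padPolarize k m e F)) := by
    rw [hcov, weightChar_add_upper _ _ hb, weightChar_natWeight, smul_sub, smul_smul]
  rw [key]
  exact W.smul_mem _ hsum

end Lead

end Literature.Computability.AlgebraicComplexity


/-! ## (IV) Assembly: the containment capability bound (C1′), for a pair of ideals characterised by
the vanishing at all `ℓ_c^e · g ι h` resp. `ℓ_c^e · g ι h'` -/

namespace Literature.Computability.AlgebraicComplexity

open _root_.Literature.NumberTheory.DiophantineGeometry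
open _root_.Literature.Barriers.ValiantsHypothesis (degIdxMap degIdxMap_val degIdxMap_injective)

section Assembly

variable {k : Type*} [Field k] {σ τ : Type*} [Fintype σ] [LinearOrder σ] [Fintype τ]
  [LinearOrder τ] {ι : σ → τ}

omit [Fintype σ] [LinearOrder σ] in
/-- A highest-weight vector of `k[Sym^n k^τ]` of weight `χ` with `|χ| = -n d` (`n ≠ 0`) is homogeneous of
degree `d` (universe-polymorphic restatement of the tree's `isHomogeneous_of_mem_weightSpace_of_size_eq`;
`PaddingBlindness` has the same private lemma). [folklore] -/
private theorem isHomogeneous_of_mem_highestWeightSpace_of_size_eq' [Infinite k] {n d : ℕ} (hn : n ≠ 0)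
    {χ : Weight τ} (hχ : χ.size = -((n * d : ℕ) : ℤ)) {F : MvPolynomial (DegIdx τ n) k}
    (hF : F ∈ highestWeightSpace (coordRep τ k n) χ) : F.IsHomogeneous d := by
  classical
  have hF' := highestWeightSpace_le_weightSpace _ _ hF
  intro s hs
  have hs' : s ∈ F.support := MvPolynomial.mem_support_iff.mpr hs
  have hw := monWeight_eq_of_mem_weightSpace hF' hs'
  have hsize := size_monWeight s
  rw [hw, hχ] at hsize
  have hdeg : s.degree = d := by
    have h1 : ((n * d : ℕ) : ℤ) = ((n * s.degree : ℕ) : ℤ) := neg_injective hsize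
    have h2 : n * d = n * s.degree := by exact_mod_cast h1
    exact (Nat.eq_of_mul_eq_mul_left (Nat.pos_of_ne_zero hn) h2).symm
  rw [← hdeg, Finsupp.degree_eq_weight_one]
  rfl

/-- **(C1′), hypothesis form.**  `ι : σ → τ` strictly monotone onto an upper set, `h, h'` forms of degree
`m ≠ 0`, characteristic zero, `χ` a weight of degree `d` of `GL_τ` on `Sym^{m+e}`.  Let `Ih, Ih'` be ideals of
`k[Sym^{m+e} k^τ]` such that members of `Ih` vanish at every `ℓ_c^e · g ι h` and every polynomial vanishing at
all `ℓ_c^e · g ι h'` lies in `Ih'` (for `Ih = I(GL_τ · x_t^e ι h)`, `Ih' = I(GL_τ · x_t^e ι h')` this is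
`PaddingBlindness.mem_orbitVanishingIdeal_pad_iff`).  Then
`dim(HWV_χ ∩ Ih) ≤ dim(HWV_χ ∩ Ih') + Σ_{π ∈ padPredWeights ι χ (d e)} dim(HWV_π(k[Sym^m k^σ]) ∩ I(GL_σ · h))`.
Proof: polarisation family (`padPolarize`), height filtration of the coefficient classes modulo `I_Sub`
(`HeightFiltration.finrank_le_sum`, lead lemma `coordSubst_coeff_padPolarize_sub_smul_mem`, lifting
`exists_mem_highestWeightSpace_sub_mem`), few-row transfer (`highestWeightSpace_inf_orbitVanishingIdeal_extend_eq_map`)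
and `highestWeightSpace_le_subVanishingIdeal`. [cite: KadishLandsberg2014, §2] [cite: BurgisserEtAl2011, Prop. 6.3.2] -/
theorem finrank_hwv_inf_le_add_sum_of_pad [CharZero k] (hι : StrictMono ι)
    (hup : IsUpperSet (Set.range ι)) {m e : ℕ} (hm : m ≠ 0)
    {h h' : MvPolynomial σ k} (hh : h.IsHomogeneous m) (hh' : h'.IsHomogeneous m)
    {Ih Ih' : Ideal (MvPolynomial (DegIdx τ (m + e)) k)}
    (hIh : ∀ F ∈ Ih, ∀ (c : τ → k) (g : GL τ k),
      aeval (formCoeff (m + e) (padLinForm c ^ e * linSubstRep τ k g (rename ι h))) F = 0)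
    (hIh' : ∀ F : MvPolynomial (DegIdx τ (m + e)) k, (∀ (c : τ → k) (g : GL τ k),
      aeval (formCoeff (m + e) (padLinForm c ^ e * linSubstRep τ k g (rename ι h'))) F = 0) → F ∈ Ih')
    {d : ℕ} {χ : Weight τ} (hχ : χ.size = -(((m + e) * d : ℕ) : ℤ)) :
    Module.finrank k ↥(highestWeightSpace (coordRep τ k (m + e)) χ ⊓ Ih.restrictScalars k) ≤
      Module.finrank k ↥(highestWeightSpace (coordRep τ k (m + e)) χ ⊓ Ih'.restrictScalars k) +
      ∑ π ∈ padPredWeights ι χ (d * e),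
        Module.finrank k ↥(highestWeightSpace (coordRep σ k m) π ⊓
          (orbitVanishingIdeal h m).restrictScalars k) := by
  classical
  haveI : Infinite k := CharZero.infinite k
  have hme : m + e ≠ 0 := by omega
  -- the spaces
  set V := highestWeightSpace (coordRep τ k (m + e)) χ with hV
  set W : Submodule k (MvPolynomial (DegIdx τ m) k) := (subVanishingIdeal k ι m).restrictScalars k
    with hW
  set N : Submodule k (MvPolynomial (DegIdx τ m) k) :=
    (orbitVanishingIdeal (rename ι h) m).restrictScalars k with hN
  have hWN : W ≤ N := fun G hG => subVanishingIdeal_le h hG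
  haveI hVfin : FiniteDimensional k V := finiteDimensional_highestWeightSpace_coordRep_holds hme χ
  haveI : Module.Finite k ↥(V ⊓ Ih.restrictScalars k) :=
    Module.Finite.of_injective (Submodule.inclusion (inf_le_left : V ⊓ Ih.restrictScalars k ≤ V))
      (Submodule.inclusion_injective _)
  haveI : Module.Finite k ↥(V ⊓ Ih'.restrictScalars k) :=
    Module.Finite.of_injective (Submodule.inclusion (inf_le_left : V ⊓ Ih'.restrictScalars k ≤ V))
      (Submodule.inclusion_injective _)
  -- the coefficient-class map `F ↦ (α ↦ class of coeff_α (padPolarize F) mod W)` on exponents of degree `e d`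
  let Λ : MvPolynomial (DegIdx τ (m + e)) k →ₗ[k] (DegIdx τ (e * d) → MvPolynomial (DegIdx τ m) k ⧸ W) :=
    { toFun := fun F α => W.mkQ (coeff α.1 (padPolarize k m e F))
      map_add' := fun F F' => funext fun α => by
        simp only [map_add, coeff_add, Pi.add_apply]
      map_smul' := fun a F => funext fun α => by
        simp only [map_smul, coeff_smul, Pi.smul_apply, RingHom.id_apply] }
  -- members of `V ⊓ Ih`: homogeneous of degree `d`, all coefficients in `N`
  have hhom : ∀ F ∈ V ⊓ Ih.restrictScalars k, F.IsHomogeneous d := fun F hF =>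
    isHomogeneous_of_mem_highestWeightSpace_of_size_eq' hme hχ hF.1
  have hcoefN : ∀ F ∈ V ⊓ Ih.restrictScalars k, ∀ α : τ →₀ ℕ, coeff α (padPolarize k m e F) ∈ N :=
    fun F hF => (forall_aeval_pad_eq_zero_iff_forall_coeff_padPolarize_mem
      hh.rename_isHomogeneous F).mp (hIh F hF.2)
  have hmkQ : ∀ v : MvPolynomial (DegIdx τ m) k, W.mkQ v = 0 ↔ v ∈ W := fun v => by
    rw [← LinearMap.mem_ker, Submodule.ker_mkQ]
  -- Step 1: the kernel of `Λ` on `V ⊓ Ih` lies in `V ⊓ Ih'`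
  have hker : ∀ F ∈ V ⊓ Ih.restrictScalars k, Λ F = 0 → F ∈ V ⊓ Ih'.restrictScalars k := by
    intro F hF h0
    refine ⟨hF.1, ?_⟩
    change F ∈ Ih'
    refine hIh' F ((forall_aeval_pad_eq_zero_iff_forall_coeff_padPolarize_mem
      hh'.rename_isHomogeneous F).mpr fun α => ?_)
    by_cases hα : α.degree = e * d
    · have h1 : W.mkQ (coeff α (padPolarize k m e F)) = 0 :=
        congrFun h0 ⟨α, mem_degMonomials_iff.mpr hα⟩
      exact subVanishingIdeal_le h' ((hmkQ _).mp h1)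
    · rw [coeff_padPolarize_eq_zero (hhom F hF) hα]
      exact Ideal.zero_mem _
  -- Step 2: the lead property of the image
  let Hs : (τ →₀ ℕ) → Submodule k (MvPolynomial (DegIdx τ m) k ⧸ W) := fun a =>
    (highestWeightSpace (coordRep τ k m) (χ + natWeight a) ⊓ N).map W.mkQ
  have hfinHWV : ∀ a : τ →₀ ℕ,
      Module.Finite k ↥(highestWeightSpace (coordRep τ k m) (χ + natWeight a) ⊓ N) := by
    intro a
    haveI : FiniteDimensional k (highestWeightSpace (coordRep τ k m) (χ + natWeight a)) :=
      finiteDimensional_highestWeightSpace_coordRep_holds hm _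
    exact Module.Finite.of_injective (Submodule.inclusion inf_le_left) (Submodule.inclusion_injective _)
  haveI hfinH : ∀ α : DegIdx τ (e * d), Module.Finite k (Hs α.1) := fun α => by
    haveI := hfinHWV α.1
    exact Module.Finite.map _ _
  have hlead : ∀ s ∈ (V ⊓ Ih.restrictScalars k).map Λ, ∀ α : DegIdx τ (e * d),
      (∀ α' : DegIdx τ (e * d), height α.1 < height α'.1 → s α' = 0) → s α ∈ Hs α.1 := by
    rintro _ ⟨F, hF, rfl⟩ α hα
    have hWlead : ∀ α' : τ →₀ ℕ, height α.1 < height α' → coeff α' (padPolarize k m e F) ∈ W := by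
      intro α' hlt
      by_cases hα' : α'.degree = e * d
      · exact (hmkQ _).mp (hα ⟨α', mem_degMonomials_iff.mpr hα'⟩ hlt)
      · rw [coeff_padPolarize_eq_zero (hhom F hF) hα']
        exact W.zero_mem
    obtain ⟨z, hz, hzW⟩ := exists_mem_highestWeightSpace_sub_mem
      (isSemisimpleRepresentation_coordRep (σ := τ) (k := k) m) (subVanishingSubrep k ι m)
      (ψ := χ + natWeight α.1) (v := coeff α.1 (padPolarize k m e F)) fun b hb => by
        rw [coordRep_apply, subVanishingSubrep_toSubmodule]
        exact coordSubst_coeff_padPolarize_sub_smul_mem hF.1 _ hWlead hb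
    refine ⟨z, ⟨hz, ?_⟩, ?_⟩
    · have hmem : coeff α.1 (padPolarize k m e F) - (coeff α.1 (padPolarize k m e F) - z) ∈ N :=
        N.sub_mem (hcoefN F hF α.1) (hWN hzW)
      rwa [sub_sub_cancel] at hmem
    · change W.mkQ z = W.mkQ (coeff α.1 (padPolarize k m e F))
      rw [← sub_eq_zero, ← map_sub, hmkQ]
      have := W.neg_mem hzW
      rwa [neg_sub] at this
  -- Step 3: count
  have hS := HeightFiltration.finrank_le_sum (S := (V ⊓ Ih.restrictScalars k).map Λ)
    (φ := fun α : DegIdx τ (e * d) => height α.1) (fun α => Hs α.1) hlead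
  have hrn := LinearMap.finrank_range_add_finrank_ker (Λ.domRestrict (V ⊓ Ih.restrictScalars k))
  rw [LinearMap.range_domRestrict] at hrn
  have hkerle : Module.finrank k ↥(LinearMap.ker (Λ.domRestrict (V ⊓ Ih.restrictScalars k))) ≤
      Module.finrank k ↥(V ⊓ Ih'.restrictScalars k) := by
    rw [← Submodule.finrank_map_subtype_eq]
    refine Submodule.finrank_mono ?_
    rintro _ ⟨F, hF0, rfl⟩
    exact hker F F.2 (LinearMap.mem_ker.mp hF0)
  -- Step 4: the sum over exponents of degree `e d` versus the sum over few-row predecessors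
  have hsum : ∑ α : DegIdx τ (e * d), Module.finrank k (Hs α.1) ≤
      ∑ π ∈ padPredWeights ι χ (d * e), Module.finrank k
        ↥(highestWeightSpace (coordRep σ k m) π ⊓ (orbitVanishingIdeal h m).restrictScalars k) := by
    have hL : ∑ α : DegIdx τ (e * d), Module.finrank k (Hs α.1) =
        ∑ a ∈ (Finset.univ : Finset τ).finsuppAntidiag (d * e), Module.finrank k (Hs a) := by
      rw [Finset.sum_coe_sort (degMonomials τ (e * d)) (fun a => Module.finrank k (Hs a)), degMonomials,
        Nat.mul_comm e d]
    rw [hL, padPredWeights, Finset.sum_image, Finset.sum_filter]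
    · refine Finset.sum_le_sum fun a _ => ?_
      split_ifs with hP
      · -- few-row: transfer to `σ`
        have hψ : χ + natWeight a = Function.extend ι (fun j => χ (ι j) + (a (ι j) : ℤ)) 0 := by
          funext x
          by_cases hx : ∃ j, ι j = x
          · obtain ⟨j, rfl⟩ := hx
            rw [hι.injective.extend_apply]
            rfl
          · rw [Function.extend_apply' _ _ _ hx, Pi.zero_apply]
            exact hP x fun hx' => hx hx'
        haveI := hfinHWV a
        haveI : FiniteDimensional k (highestWeightSpace (coordRep σ k m)
            (fun j => χ (ι j) + (a (ι j) : ℤ))) :=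
          finiteDimensional_highestWeightSpace_coordRep_holds hm _
        haveI : Module.Finite k ↥(highestWeightSpace (coordRep σ k m) (fun j => χ (ι j) + (a (ι j) : ℤ)) ⊓
            (orbitVanishingIdeal h m).restrictScalars k) :=
          Module.Finite.of_injective (Submodule.inclusion inf_le_left) (Submodule.inclusion_injective _)
        calc Module.finrank k (Hs a)
            ≤ Module.finrank k ↥(highestWeightSpace (coordRep τ k m) (χ + natWeight a) ⊓ N) :=
              Submodule.finrank_map_le _ _
          _ = Module.finrank k ↥((highestWeightSpace (coordRep σ k m) (fun j => χ (ι j) + (a (ι j) : ℤ)) ⊓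
                (orbitVanishingIdeal h m).restrictScalars k).map
                (rename (degIdxMap hι.injective) :
                  MvPolynomial (DegIdx σ m) k →ₐ[k] MvPolynomial (DegIdx τ m) k).toLinearMap) := by
              rw [hψ, hN, highestWeightSpace_inf_orbitVanishingIdeal_extend_eq_map hι hup h]
          _ ≤ _ := Submodule.finrank_map_le _ _
      · -- not few-row: the whole highest-weight space lies in `W`
        push Not at hP
        obtain ⟨x, hx, hne⟩ := hP
        have hle : highestWeightSpace (coordRep τ k m) (χ + natWeight a) ≤ W :=
          highestWeightSpace_le_subVanishingIdeal hι.injective hup hm hx (by simpa using hne)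
        have h0 : Hs a = ⊥ := by
          rw [eq_bot_iff]
          rintro _ ⟨v, hv, rfl⟩
          rw [Submodule.mem_bot, hmkQ]
          exact hle hv.1
        rw [h0, finrank_bot]
    · -- injectivity of `α ↦ π` on few-row exponents
      intro a ha b hb hab
      rw [Finset.mem_coe, Finset.mem_filter] at ha hb
      ext x
      by_cases hx : x ∈ Set.range ι
      · obtain ⟨j, rfl⟩ := hx
        have := congrFun hab j
        simp only [add_right_inj, Nat.cast_inj] at this
        exact this
      · have h1 := ha.2 x hx
        have h2 := hb.2 x hx
        omega
  -- assemble
  calc Module.finrank k ↥(V ⊓ Ih.restrictScalars k)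
      = Module.finrank k ↥((V ⊓ Ih.restrictScalars k).map Λ) +
          Module.finrank k ↥(LinearMap.ker (Λ.domRestrict (V ⊓ Ih.restrictScalars k))) := hrn.symm
    _ ≤ (∑ α : DegIdx τ (e * d), Module.finrank k (Hs α.1)) +
          Module.finrank k ↥(V ⊓ Ih'.restrictScalars k) := add_le_add hS hkerle
    _ ≤ _ := by rw [add_comm]; exact add_le_add le_rfl hsum

end Assembly

end Literature.Computability.AlgebraicComplexity

/-! ## §1 (C1′)/(C1)/(C2): the containment capability bound, weight form -/

namespace Literature.Computability.AlgebraicComplexity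

open _root_.Literature.NumberTheory.DiophantineGeometry

section Final1

variable {k : Type*} [Field k] {σ τ : Type*} [Fintype σ] [LinearOrder σ] [Fintype τ]
  [LinearOrder τ] {ι : σ → τ}

/-- **(C1') Capability bound for highest-weight equations.**  `ι : σ → τ` strictly monotone onto an
upper set, `t ∉ range ι`, `h, h'` forms of degree `m ≠ 0` (for `m = 0` the few-letter coordinate ring
`k[Sym^0 k^σ] = k[X_0]` carries the trivial action and the `finrank` junk value of its infinite-dimensional
weight-`0` space falsifies the count), characteristic zero, `χ` a weight of degree `d`.
The number of independent highest-weight equations of weight `χ` of `Δ(x_t^e · ι h)` exceeds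
that of `Δ(x_t^e · ι h')` by at most the total deficit of `h` at the few-row predecessors of `χ` at
distance `d e`.  (Route: an equation `F` gives the family `G_c = F(ℓ_c^e · –)` of degree-`d` equations of
`Δ_m(ι h)`; modulo the equations of the cone variety `Sub_{|σ|}` — which are equations of every
`Δ(x_t^e · ι h')` — the height-leading coefficient `G_α` of the family is a highest-weight vector of weight
`χ + α` modulo them, a few-row weight, and such classes are counted by the deficits of `h`, BLMW Prop. 6.3.2 /
Landsberg Prop. 8.4.1.1.) [cite: Landsberg2017, Prop. 8.4.1.1 and Prop. 8.4.2.2] [cite: BurgisserEtAl2011, Prop. 6.3.2] -/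
theorem finrank_hwv_inf_pad_le_add_sum_hwDeficit [CharZero k] (hι : StrictMono ι)
    (hup : IsUpperSet (Set.range ι)) {t : τ} (ht : t ∉ Set.range ι) {m e : ℕ} (hm : m ≠ 0)
    {h h' : MvPolynomial σ k} (hh : h.IsHomogeneous m) (hh' : h'.IsHomogeneous m) {d : ℕ}
    {χ : Weight τ} (hχ : χ.size = -(((m + e) * d : ℕ) : ℤ)) :
    Module.finrank k ↥(highestWeightSpace (coordRep τ k (m + e)) χ ⊓
        (orbitVanishingIdeal (X t ^ e * rename ι h) (m + e)).restrictScalars k) ≤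
      Module.finrank k ↥(highestWeightSpace (coordRep τ k (m + e)) χ ⊓
        (orbitVanishingIdeal (X t ^ e * rename ι h') (m + e)).restrictScalars k) +
      ∑ π ∈ padPredWeights ι χ (d * e),
        Module.finrank k ↥(highestWeightSpace (coordRep σ k m) π ⊓
          (orbitVanishingIdeal h m).restrictScalars k) := by
  haveI : Infinite k := CharZero.infinite k
  exact finrank_hwv_inf_le_add_sum_of_pad hι hup hm hh hh'
    (fun F hF => (mem_orbitVanishingIdeal_pad_iff ht h m e F).mp hF)
    (fun F hF => (mem_orbitVanishingIdeal_pad_iff ht h' m e F).mpr hF) hχ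

/-- **(C1) Capability bound for multiplicities** (rank–nullity on both sides of (C1')):
`mult_χ k[Δ(x_t^e ι h')] ≤ mult_χ k[Δ(x_t^e ι h)] + Σ_{π ∈ preds(χ)} (a_π - mult_π k[Δ_m(h)])`.
Cell reading (V23-bis, containment form): `K_{Z_h'}(λ; d) - K_{Z_det₃}(λ; d) ≤ ε_cont(λ; d)`.
[cite: Landsberg2017, Prop. 8.4.1.1 and Prop. 8.4.2.2] [cite: BurgisserEtAl2011, Prop. 6.3.2] -/
theorem orbitMultiplicity_pad_le_add_sum_hwDeficit [CharZero k] (hι : StrictMono ι)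
    (hup : IsUpperSet (Set.range ι)) {t : τ} (ht : t ∉ Set.range ι) {m e : ℕ} (hm : m ≠ 0)
    {h h' : MvPolynomial σ k} (hh : h.IsHomogeneous m) (hh' : h'.IsHomogeneous m) {d : ℕ}
    {χ : Weight τ} (hχ : χ.size = -(((m + e) * d : ℕ) : ℤ)) :
    orbitMultiplicity k (X t ^ e * rename ι h') (m + e) χ ≤
      orbitMultiplicity k (X t ^ e * rename ι h) (m + e) χ +
        ∑ π ∈ padPredWeights ι χ (d * e), hwDeficit k h m π := by
  have hme : m + e ≠ 0 := by omega
  have h1 := orbitMultiplicity_add_finrank_inf_eq_plethysmCoeff (X t ^ e * rename ι h) hme χ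
  have h2 := orbitMultiplicity_add_finrank_inf_eq_plethysmCoeff (X t ^ e * rename ι h') hme χ
  have h3 := finrank_hwv_inf_pad_le_add_sum_hwDeficit hι hup ht hm hh hh' hχ
  have h4 : ∑ π ∈ padPredWeights ι χ (d * e), Module.finrank k ↥(highestWeightSpace (coordRep σ k m) π ⊓
      (orbitVanishingIdeal h m).restrictScalars k) = ∑ π ∈ padPredWeights ι χ (d * e), hwDeficit k h m π :=
    Finset.sum_congr rfl fun π _ => (hwDeficit_eq_finrank h hm π).symm
  omega

/-- **(C2) The INCAPABLE criterion, weight form.**  If `h` is FULL at every few-row predecessor of `χ` at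
distance `d e` (`mult_π k[Δ_m(h)] = a_π`), then `mult_χ k[Δ(x_t^e ι h')] ≤ mult_χ k[Δ(x_t^e ι h)]` for
every form `h'` of degree `m` — a refinement of `orbitMultiplicity_pad_le_of_isEquationFreeUpTo` (there:
fullness at ALL types of degree `≤ d₀`). [cite: Landsberg2017, Prop. 8.4.1.1 and Prop. 8.4.2.2] -/
theorem orbitMultiplicity_pad_le_of_forall_padPred [CharZero k] (hι : StrictMono ι)
    (hup : IsUpperSet (Set.range ι)) {t : τ} (ht : t ∉ Set.range ι) {m e : ℕ} (hm : m ≠ 0)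
    {h h' : MvPolynomial σ k} (hh : h.IsHomogeneous m) (hh' : h'.IsHomogeneous m) {d : ℕ}
    {χ : Weight τ} (hχ : χ.size = -(((m + e) * d : ℕ) : ℤ))
    (H : ∀ π ∈ padPredWeights ι χ (d * e), orbitMultiplicity k h m π = plethysmCoeff k σ m π) :
    orbitMultiplicity k (X t ^ e * rename ι h') (m + e) χ ≤
      orbitMultiplicity k (X t ^ e * rename ι h) (m + e) χ := by
  have hsum : ∑ π ∈ padPredWeights ι χ (d * e), hwDeficit k h m π = 0 :=
    Finset.sum_eq_zero fun π hπ => by unfold hwDeficit; rw [H π hπ]; exact Nat.sub_self _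
  have := orbitMultiplicity_pad_le_add_sum_hwDeficit hι hup ht hm hh hh' hχ
  rw [hsum, add_zero] at this
  exact this

/-- **(C2, obstruction form).**  If moreover `x_t^e ι h ∈ Δ_{m+e}(P)`, then under the same fullness of `h`
at the few-row predecessors of `χ`: `mult_χ k[Δ(x_t^e ι h')] ≤ mult_χ k[Δ_{m+e}(P)]` — `χ` is NOT a
multiplicity obstruction against `x_t^e ι h' ∈ Δ(P)`, for any `h'`.
[cite: Landsberg2017, Prop. 8.4.1.1 and Prop. 8.4.2.2] [cite: BurgisserEtAl2011, Prop. 6.3.2] -/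
theorem orbitMultiplicity_pad_le_of_forall_padPred_of_mem_orbitClosure [CharZero k] (hι : StrictMono ι)
    (hup : IsUpperSet (Set.range ι)) {t : τ} (ht : t ∉ Set.range ι) {m e : ℕ} (hm : m ≠ 0)
    {h : MvPolynomial σ k} (hh : h.IsHomogeneous m) {P : MvPolynomial τ k}
    (hP : X t ^ e * rename ι h ∈ orbitClosure P) {h' : MvPolynomial σ k} (hh' : h'.IsHomogeneous m)
    {d : ℕ} {χ : Weight τ} (hχ : χ.size = -(((m + e) * d : ℕ) : ℤ))
    (H : ∀ π ∈ padPredWeights ι χ (d * e), orbitMultiplicity k h m π = plethysmCoeff k σ m π) :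
    orbitMultiplicity k (X t ^ e * rename ι h') (m + e) χ ≤ orbitMultiplicity k P (m + e) χ := by
  have hme : m + e ≠ 0 := by omega
  refine (orbitMultiplicity_pad_le_of_forall_padPred hι hup ht hm hh hh' hχ H).trans ?_
  exact orbitMultiplicity_le_of_hwv_inf_le hme fun F hF =>
    ⟨hF.1, orbitVanishingIdeal_le_of_mem_orbitClosure hP hF.2⟩

/-- **`ψ` over `χ` is a horizontal strip, weight form** (D1′): `χ ≤ ψ` pointwise (containment of the
dual diagrams) and `ψ x ≤ χ y` whenever `y < x` (interlacing; for dual partition weights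
`χ = λ*`, `ψ = μ*` on `Fin N` this is `λ_{j+1} ≤ μ_j ≤ λ_j`, i.e. `λ/μ` is a horizontal strip — the
index set of the Pieri rule). [cite: Landsberg2017, Thm. 8.1.3.1] -/
def IsHorizStripOver (χ ψ : Weight τ) : Prop :=
  (∀ x, χ x ≤ ψ x) ∧ ∀ x y, y < x → ψ x ≤ χ y

open Classical in
/-- The PIERI predecessors of `χ` at distance `s` (D1″): the few-row predecessors `π` whose extension by
zero `π̂` satisfies `IsHorizStripOver χ π̂`. [cite: Landsberg2017, Thm. 8.1.3.1] -/
def padPieriWeights (ι : σ → τ) (χ : Weight τ) (s : ℕ) : Finset (Weight σ) :=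
  (padPredWeights ι χ s).filter (fun π => IsHorizStripOver χ (Function.extend ι π 0))

/- The Pieri-sharp forms (C1′-Pieri)/(C1-Pieri)/(C2-Pieri) are proved in §7 below (after the root strings
of §6). -/

end Final1

end Literature.Computability.AlgebraicComplexity

/-! ## §2 (C3): the cell instance on the matrix letters, partition form -/

namespace Literature.Computability.AlgebraicComplexity

open _root_.Literature.NumberTheory.DiophantineGeometry

section Placement

variable {k : Type*} [Field k] {σ τ : Type*} [Fintype σ] [Fintype τ] [LinearOrder τ]

/-- **Padded forms do not depend on the placement of the letters** (multiplicities): for injections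
`κ, ι : σ → τ` missing the padding letter `t`, `x_t^e · κ(q)` and `x_t^e · ι(q)` are renamings of one
polynomial in the letters `σ ⊕ {t}`, hence `GL_τ`-conjugate (`orbitMultiplicity_rename_eq_rename`).
[cite: BurgisserEtAl2011, §6.3 (after Prop. 6.3.2)] -/
theorem orbitMultiplicity_pad_rename_eq_rename [CharZero k] (κ ι : σ → τ) (hκ : Function.Injective κ)
    (hι : Function.Injective ι) {t : τ} (htκ : t ∉ Set.range κ) (htι : t ∉ Set.range ι)
    (q : MvPolynomial σ k) (e : ℕ) {n : ℕ} (hn : n ≠ 0) (ψ : Weight τ) :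
    orbitMultiplicity k (X t ^ e * rename κ q) n ψ = orbitMultiplicity k (X t ^ e * rename ι q) n ψ := by
  classical
  -- the padded form on the abstract letters `Option σ`
  let P : MvPolynomial (Option σ) k := X none ^ e * rename some q
  have hP : ∀ (j : σ → τ), t ∉ Set.range j →
      rename (fun o : Option σ => o.elim t j) P = X t ^ e * rename j q := by
    intro j _
    simp only [P, map_mul, map_pow, rename_X, rename_rename]
    rfl
  have hinj : ∀ (j : σ → τ), Function.Injective j → t ∉ Set.range j →
      Function.Injective (fun o : Option σ => o.elim t j) := by
    intro j hj htj a b hab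
    cases a with
    | none =>
      cases b with
      | none => rfl
      | some b => exact absurd ⟨b, (hab : t = j b).symm⟩ htj
    | some a =>
      cases b with
      | none => exact absurd ⟨a, (hab : j a = t)⟩ htj
      | some b => exact congrArg some (hj (hab : j a = j b))
  rw [← hP κ htκ, ← hP ι htι]
  exact orbitMultiplicity_rename_eq_rename _ _ (hinj κ hκ htκ) (hinj ι hι htι) P hn ψ

end Placement

section MatIdx

variable {k : Type} [Field k]

/-- **Containment of Young diagrams** read in `N` rows (D3): `μ ⊂ λ` iff `μ_i ≤ λ_i` for all `i < N`
(faithful when `ℓ(μ), ℓ(λ) ≤ N`; the tree's `Weight.ofPartition N` pads/truncates to `N` rows).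
[cite: FultonHarrisGTM129, §4.1 (Young diagrams)] -/
def partContained (N : ℕ) {a b : ℕ} (mu : Nat.Partition a) (lam : Nat.Partition b) : Prop :=
  ∀ i : Fin N, Weight.ofPartition N mu i ≤ Weight.ofPartition N lam i

/-- **`λ/μ` is a horizontal strip** read in `N` rows (D4): `μ ⊂ λ` and the interlacing
`λ_{i+1} ≤ μ_i` for all `i < N` (faithful when `ℓ(λ) ≤ N`). This is the index set of the Pieri rule
`S^p V ⊗ S_μ V = ⊕_{λ/μ horizontal p-strip} S_λ V`. [cite: FultonHarrisGTM129, (6.8)] -/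
def partHorizStrip (N : ℕ) {a b : ℕ} (mu : Nat.Partition a) (lam : Nat.Partition b) : Prop :=
  partContained N mu lam ∧ ∀ i : Fin N, ((lam.sortedParts.getD (i + 1) 0 : ℕ) : ℤ) ≤ Weight.ofPartition N mu i

/-- `partContained` is decidable (finitely many integer inequalities). [folklore] -/
instance (N : ℕ) {a b : ℕ} (mu : Nat.Partition a) (lam : Nat.Partition b) :
    Decidable (partContained N mu lam) := by
  unfold partContained; infer_instance

/-- `partHorizStrip` is decidable (finitely many integer inequalities). [folklore] -/
instance (N : ℕ) {a b : ℕ} (mu : Nat.Partition a) (lam : Nat.Partition b) :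
    Decidable (partHorizStrip N mu lam) := by
  unfold partHorizStrip; infer_instance

/-- **The containment capability sum** (D5) of a form `h` of degree `n` on the `n × n` letters at
`(λ, d)`: `ε_cont(λ; d) = Σ_{μ ⊢ n d, ℓ(μ) ≤ n², μ ⊂ λ} (a_{μ*} - mult_{μ*} k[Δ_n(h)])` (the cell's
`ε(λ; d)` with `Pieri_d(λ)` enlarged to all contained `μ`). [cite: BurgisserEtAl2011, §6.3] -/
def capDeficitSumContained {n : ℕ} (h : MvPolynomial (MatIdx n) k) (m d : ℕ) (lam : Nat.Partition (m * d)) : ℕ :=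
  ∑ mu ∈ (Finset.univ : Finset (Nat.Partition (n * d))).filter
      (fun mu => mu.parts.card ≤ n * n ∧ partContained (m * m) mu lam),
    hwDeficit k h n (Weight.dualOfPartition (n * n) mu).toMatIdx

/-- **The Pieri capability sum** (D6): the same over the horizontal strips `λ/μ` only — the cell's
`ε(λ; d) := Σ_{π ∈ Pieri_d(λ), ℓ(π) ≤ n²} (a_π - K_h(π; d))` (V23.md §7). [cite: FultonHarrisGTM129, (6.8)] -/
def capDeficitSumPieri {n : ℕ} (h : MvPolynomial (MatIdx n) k) (m d : ℕ) (lam : Nat.Partition (m * d)) : ℕ :=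
  ∑ mu ∈ (Finset.univ : Finset (Nat.Partition (n * d))).filter
      (fun mu => mu.parts.card ≤ n * n ∧ partHorizStrip (m * m) mu lam),
    hwDeficit k h n (Weight.dualOfPartition (n * n) mu).toMatIdx

/-- **The Borel-compatible placement** of the `n × n` letters among the `m × m` letters: the LAST `n²`
letters in the lexicographic order (strictly monotone onto an upper set — the hypothesis of the few-row
transfer `highestWeightSpace_inf_orbitVanishingIdeal_extend_eq_map`). [cite: BurgisserEtAl2011, §6.3 (after Prop. 6.3.2)] -/
def borelPlace {n m : ℕ} (hnm : n ≤ m) (x : MatIdx n) : MatIdx m :=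
  matIdxEquiv m (topEmb (Nat.mul_le_mul hnm hnm) ((matIdxEquiv n).symm x))

/-- The Borel-compatible placement is strictly monotone. [folklore] -/
private theorem borelPlace_strictMono {n m : ℕ} (hnm : n ≤ m) : StrictMono (borelPlace hnm) :=
  fun _ _ hxy => (matIdxEquiv m).strictMono
    (topEmb_strictMono _ ((matIdxEquiv n).symm.strictMono hxy))

/-- The range of the Borel-compatible placement is the image of the top embedding of `Fin (n²)` into `Fin (m²)`, i.e. the last `n²` matrix letters. [folklore] -/
private theorem range_borelPlace {n m : ℕ} (hnm : n ≤ m) :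
    Set.range (borelPlace hnm) =
      Set.range (fun i => matIdxEquiv m (topEmb (Nat.mul_le_mul hnm hnm) i)) := by
  ext y
  constructor
  · rintro ⟨x, rfl⟩
    exact ⟨(matIdxEquiv n).symm x, rfl⟩
  · rintro ⟨i, rfl⟩
    exact ⟨matIdxEquiv n i, by unfold borelPlace; rw [OrderIso.symm_apply_apply]⟩

/-- The range of the Borel-compatible placement is an upper set. [folklore] -/
private theorem isUpperSet_range_borelPlace {n m : ℕ} (hnm : n ≤ m) : IsUpperSet (Set.range (borelPlace hnm)) := by
  rw [range_borelPlace]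
  exact (strictMono_comp_topEmb (matIdxEquiv m) (Nat.mul_le_mul hnm hnm)).2

/-- `x₀₀` is the least matrix letter. [folklore] -/
private theorem toLex_zero_le (m : ℕ) [NeZero m] (y : MatIdx m) : toLex ((0 : Fin m), (0 : Fin m)) ≤ y := by
  rw [← toLex_ofLex y, Prod.Lex.le_iff]
  rcases (Fin.zero_le (ofLex y).1).lt_or_eq with h | h
  · exact Or.inl h
  · exact Or.inr ⟨h, Fin.zero_le _⟩

/-- `x₀₀` is not among the last `n²` matrix letters when `n < m`. [folklore] -/
private theorem toLex_zero_not_mem_range_borelPlace {n m : ℕ} [NeZero m] (hnm : n < m) :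
    toLex ((0 : Fin m), (0 : Fin m)) ∉ Set.range (borelPlace hnm.le) := by
  intro ht
  have hsurj : Function.Surjective (borelPlace hnm.le) := fun y =>
    isUpperSet_range_borelPlace hnm.le (toLex_zero_le m y) ht
  have hcard := Fintype.card_le_of_surjective _ hsurj
  simp only [MatIdx, Fintype.card_lex, Fintype.card_prod, Fintype.card_fin] at hcard
  have := Nat.mul_self_lt_mul_self hnm
  omega

/-- **Step D: the weight-indexed deficit sum is dominated by the partition-indexed containment sum.**  A
few-row predecessor `π` of `λ*` (along the Borel placement) with a nonzero deficit is a highest weight of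
`k[Sym^n k^{n²}]`, hence `π = μ*` for a partition `μ ⊢ n d` with `ℓ(μ) ≤ n²` (BLMW (5.2.2)), and `μ ⊂ λ`
because `π̂ = λ* + α` with `α ≥ 0`. [cite: BurgisserEtAl2011, (5.2.2) and Prop. 6.3.2] -/
theorem sum_padPredWeights_hwDeficit_le_capDeficitSumContained [CharZero k] {n m : ℕ} [NeZero n]
    [NeZero m] (hnm : n < m) (h : MvPolynomial (MatIdx n) k) {d : ℕ} (lam : Nat.Partition (m * d))
    (hlam : lam.parts.card ≤ m * m) :
    ∑ π ∈ padPredWeights (borelPlace hnm.le) ((Weight.dualOfPartition (m * m) lam).toMatIdx) (d * (m - n)),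
        hwDeficit k h n π ≤ capDeficitSumContained h m d lam := by
  classical
  haveI : Infinite k := CharZero.infinite k
  set K := n * n with hK
  set N := m * m with hN
  have hKN : K ≤ N := Nat.mul_le_mul hnm.le hnm.le
  set ι₀ := borelPlace hnm.le with hι₀
  set Λ : Weight (MatIdx m) := (Weight.dualOfPartition N lam).toMatIdx with hΛ
  set M := (Finset.univ : Finset (Nat.Partition (n * d))).filter
      (fun mu => mu.parts.card ≤ K ∧ partContained N mu lam) with hM
  let dmap : Nat.Partition (n * d) → Weight (MatIdx n) := fun mu => (Weight.dualOfPartition K mu).toMatIdx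
  -- injectivity of `μ ↦ μ*` on partitions with at most `K` parts
  have hinj : Set.InjOn dmap ↑M := by
    intro mu₁ h₁ mu₂ h₂ h12
    rw [Finset.mem_coe, Finset.mem_filter] at h₁ h₂
    have hd : Weight.dualOfPartition K mu₁ = Weight.dualOfPartition K mu₂ := by
      funext i
      have := congrFun h12 (matIdxEquiv n i)
      simp only [dmap, Weight.toMatIdx, OrderIso.symm_apply_apply] at this
      exact this
    have ho : Weight.ofPartition K mu₁ = Weight.ofPartition K mu₂ := by
      have := congrArg Weight.dual hd
      simpa [Weight.dualOfPartition] using this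
    exact Weight.ofPartition_injOn_holds K (n * d) h₁.2.1 h₂.2.1 ho
  change _ ≤ ∑ mu ∈ M, hwDeficit k h n (dmap mu)
  rw [← Finset.sum_image hinj]
  refine Finset.sum_le_sum_of_ne_zero fun π hπ hδ => ?_
  -- unpack `π ∈ padPredWeights`
  simp only [padPredWeights, Finset.mem_image, Finset.mem_filter] at hπ
  obtain ⟨α, ⟨hαdeg, hfew⟩, rfl⟩ := hπ
  have hαdeg' : α.degree = d * (m - n) := mem_degMonomials_iff.mp hαdeg
  -- a nonzero deficit forces a highest weight of `k[Sym^n]`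
  have hp : plethysmCoeff k (MatIdx n) n (fun j => Λ (ι₀ j) + (α (ι₀ j) : ℤ)) ≠ 0 := fun h0 =>
    hδ (by unfold hwDeficit; rw [h0]; exact Nat.zero_sub _)
  have hHW : HasHighestWeight (coordRep (MatIdx n) k n) (fun j => Λ (ι₀ j) + (α (ι₀ j) : ℤ)) := by
    intro hbot
    apply hp
    unfold plethysmCoeff hwMultiplicity
    rw [hbot, finrank_bot]
  obtain ⟨f', -, hf'⟩ := exists_hasHighestWeight_orbitCoordRep_of_hasHighestWeight_coordRep hHW
  -- the size of `π`
  have hsizeΛ : Λ.size = -((m * d : ℕ) : ℤ) := size_toMatIdx_dualOfPartition (m := m) lam hlam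
  have hmd : m * d = n * d + d * (m - n) := by
    obtain ⟨e, rfl⟩ : ∃ e, m = n + e := ⟨m - n, by omega⟩
    rw [Nat.add_sub_cancel_left]; ring
  have hsize : Weight.size (fun j => Λ (ι₀ j) + (α (ι₀ j) : ℤ)) = -((n * d : ℕ) : ℤ) := by
    have h1 : Weight.size (fun j => Λ (ι₀ j) + (α (ι₀ j) : ℤ)) =
        ∑ x ∈ (Finset.univ : Finset (MatIdx n)).image ι₀, (Λ x + (α x : ℤ)) := by
      rw [Weight.size, Finset.sum_image fun a _ b _ hab => (borelPlace_strictMono hnm.le).injective hab]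
    have h2 : ∑ x ∈ (Finset.univ : Finset (MatIdx n)).image ι₀, (Λ x + (α x : ℤ)) =
        ∑ x, (Λ x + (α x : ℤ)) :=
      Finset.sum_subset (Finset.subset_univ _) fun x _ hx => hfew x fun ⟨j, hj⟩ =>
        hx (Finset.mem_image.mpr ⟨j, Finset.mem_univ _, hj⟩)
    have h3 : ∑ x, (Λ x + (α x : ℤ)) = Λ.size + (α.degree : ℤ) := by
      rw [Finset.sum_add_distrib, Weight.size, Finsupp.degree_eq_sum, Nat.cast_sum]
    rw [h1, h2, h3, hsizeΛ, hαdeg', hmd]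
    push_cast
    ring
  obtain ⟨mu', hmuK, hmu⟩ :=
    exists_eq_dualOfPartition_of_hasHighestWeight_orbitCoordRep_of_size_eq (matIdxEquiv n) f' hf' hsize
  let mu : Nat.Partition (n * d) := ⟨mu'.parts, mu'.parts_pos, by rw [mu'.parts_sum, mul_comm]⟩
  have hmu_eq : dmap mu = fun j => Λ (ι₀ j) + (α (ι₀ j) : ℤ) := by rw [hmu]; rfl
  refine Finset.mem_image.mpr ⟨mu, Finset.mem_filter.mpr ⟨Finset.mem_univ _, hmuK, fun i => ?_⟩, hmu_eq⟩
  -- containment `μ ⊂ λ`: compare the dual weights entrywise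
  have hdual : ∀ j : Fin N, Weight.dualOfPartition N lam j ≤ Weight.dualOfPartition N mu j := by
    intro j
    rw [dualOfPartition_eq_extend_topEmb hKN mu hmuK]
    by_cases hj : ∃ i₁, topEmb hKN i₁ = j
    · obtain ⟨i₁, rfl⟩ := hj
      rw [(topEmb_strictMono hKN).injective.extend_apply]
      have h1 := congrFun hmu_eq (matIdxEquiv n i₁)
      simp only [dmap, Weight.toMatIdx, OrderIso.symm_apply_apply] at h1
      have h2 : Λ (ι₀ (matIdxEquiv n i₁)) = Weight.dualOfPartition N lam (topEmb hKN i₁) := by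
        simp only [hΛ, hι₀, borelPlace, Weight.toMatIdx, OrderIso.symm_apply_apply]
      rw [← h2, h1]
      simp
    · rw [Function.extend_apply' _ _ _ hj, Pi.zero_apply]
      have hx : matIdxEquiv m j ∉ Set.range ι₀ := by
        rintro ⟨y, hy⟩
        refine hj ⟨(matIdxEquiv n).symm y, (matIdxEquiv m).injective ?_⟩
        simp only [hι₀, borelPlace] at hy
        exact hy
      have h1 := hfew _ hx
      have h2 : Λ (matIdxEquiv m j) = Weight.dualOfPartition N lam j := by
        simp only [hΛ, Weight.toMatIdx, OrderIso.symm_apply_apply]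
      rw [← h2]
      have : (0 : ℤ) ≤ (α (matIdxEquiv m j) : ℤ) := Nat.cast_nonneg _
      omega
  have := hdual (Fin.rev i)
  simp only [Weight.dualOfPartition, Weight.dual, Fin.rev_rev, neg_le_neg_iff] at this
  exact this

/-- **(C3) The cell's capability bound, containment form — UNCONDITIONAL.**  `0 < n < m`, characteristic
zero, `h'` any form of degree `n` on the `n × n` matrix letters, `λ ⊢ m d` with at most `m²` parts:
`mult_{λ*} k[Δ(x₀₀^{m-n} · h')] ≤ mult_{λ*} k[Δ(det_m)] + ε_cont^{det_n}(λ; d)`.  No record enters: the cell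
EVALUATES `ε_cont` from its `⟨n,n,d⟩` determinant records (certified lower bounds of `K_det_n(μ; d)` give an
upper bound of the sum).  Cell reading: V23-bis with `Pieri_d(λ)` replaced by `{μ ⊂ λ}` (a weaker but
kernel-provable bound). [cite: BurgisserEtAl2011, Prop. 6.3.2 and §6.3] [cite: Landsberg2017, Prop. 8.4.1.1 and Prop. 8.4.2.2] -/
theorem orbitMultiplicity_pad_le_detFormLex_add_capDeficitSumContained [CharZero k] {n m : ℕ} [NeZero n]
    [NeZero m] (hnm : n < m) {h' : MvPolynomial (MatIdx n) k} (hh' : h'.IsHomogeneous n) {d : ℕ}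
    (lam : Nat.Partition (m * d)) (hlam : lam.parts.card ≤ m * m) :
    orbitMultiplicity k (X (toLex ((0 : Fin m), (0 : Fin m))) ^ (m - n) * rename (blockPlace hnm.le) h') m
        (Weight.dualOfPartition (m * m) lam).toMatIdx ≤
      orbitMultiplicity k (detFormLex k m) m (Weight.dualOfPartition (m * m) lam).toMatIdx +
        capDeficitSumContained (detFormLex k n) m d lam := by
  haveI : Infinite k := CharZero.infinite k
  have hm : m ≠ 0 := NeZero.ne m
  set t : MatIdx m := toLex ((0 : Fin m), (0 : Fin m)) with ht
  set Λ : Weight (MatIdx m) := (Weight.dualOfPartition (m * m) lam).toMatIdx with hΛ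
  have htb := toLex_zero_not_mem_range_blockPlace (n := n) (m := m) hnm
  have hti := toLex_zero_not_mem_range_borelPlace (n := n) (m := m) hnm
  -- (C1) along the Borel placement, reference form `det_n`
  have hχ : Λ.size = -(((n + (m - n)) * d : ℕ) : ℤ) := by
    rw [Nat.add_sub_cancel' hnm.le]
    exact size_toMatIdx_dualOfPartition (m := m) lam hlam
  have hPadDet := pad_detFormLex_mem_orbitClosure_detFormLex (k := k) hnm.le
  have key := orbitMultiplicity_pad_le_add_sum_hwDeficit (borelPlace_strictMono hnm.le)
    (isUpperSet_range_borelPlace hnm.le) hti (NeZero.ne n) (detFormLex_isHomogeneous k n) hh' hχ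
  rw [Nat.add_sub_cancel' hnm.le] at key
  -- placements
  rw [orbitMultiplicity_pad_rename_eq_rename (blockPlace hnm.le) (borelPlace hnm.le)
    (blockPlace_injective hnm.le) (borelPlace_strictMono hnm.le).injective htb hti h' (m - n) hm Λ]
  have hdet : orbitMultiplicity k (X t ^ (m - n) * rename (borelPlace hnm.le) (detFormLex k n)) m Λ ≤
      orbitMultiplicity k (detFormLex k m) m Λ := by
    rw [← orbitMultiplicity_pad_rename_eq_rename (blockPlace hnm.le) (borelPlace hnm.le)
      (blockPlace_injective hnm.le) (borelPlace_strictMono hnm.le).injective htb hti (detFormLex k n)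
      (m - n) hm Λ]
    exact orbitMultiplicity_le_of_hwv_inf_le hm fun F hF =>
      ⟨hF.1, orbitVanishingIdeal_le_of_mem_orbitClosure hPadDet hF.2⟩
  have hsum := sum_padPredWeights_hwDeficit_le_capDeficitSumContained (k := k) hnm (detFormLex k n) lam hlam
  calc _ ≤ _ := key
    _ ≤ _ := add_le_add hdet hsum

end MatIdx

end Literature.Computability.AlgebraicComplexity

namespace Literature.Computability.AlgebraicComplexity

open _root_.Literature.NumberTheory.DiophantineGeometry

section MatIdxCorollaries

variable {k : Type} [Field k]

/-- **(C3, V1 object).**  The same for the tree's padded permanent: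
`mult_{λ*} k[Δ(x₀₀^{m-n} per_n)] ≤ mult_{λ*} k[Δ(det_m)] + ε_cont^{det_n}(λ; d)`.
[cite: BurgisserEtAl2011, Prop. 6.3.2 and §6.3] -/
theorem orbitMultiplicity_paddedPerFormLex_le_detFormLex_add_capDeficitSumContained [CharZero k]
    {n m : ℕ} [NeZero n] [NeZero m] (hnm : n < m) {d : ℕ} (lam : Nat.Partition (m * d))
    (hlam : lam.parts.card ≤ m * m) :
    orbitMultiplicity k (paddedPerFormLex k n m) m (Weight.dualOfPartition (m * m) lam).toMatIdx ≤
      orbitMultiplicity k (detFormLex k m) m (Weight.dualOfPartition (m * m) lam).toMatIdx +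
        capDeficitSumContained (detFormLex k n) m d lam := by
  have hper : (rename toLex (perPoly (Fin n) k) : MvPolynomial (MatIdx n) k).IsHomogeneous n := by
    have h := (perPoly_isHomogeneous (n := Fin n) (k := k)).rename_isHomogeneous (f := toLex)
    rwa [Fintype.card_fin] at h
  rw [paddedPerFormLex_eq_pad hnm.le]
  exact orbitMultiplicity_pad_le_detFormLex_add_capDeficitSumContained hnm hper lam hlam

/-- **(C3 with CERTIFIED LOWER BOUNDS — the cell's `ε_cert`, containment form).**  If `lo μ ≤
mult_{μ*} k[Δ(det_n)]` for every `μ ⊢ n d` with `ℓ(μ) ≤ n²`, then for every form `h'` of degree `n` on the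
`n × n` letters and every `λ ⊢ m d`, `ℓ(λ) ≤ m²`: `mult_{λ*} k[Δ(x₀₀^{m-n} h')] ≤ mult_{λ*} k[Δ(det_m)]
+ Σ_{μ ⊂ λ, ℓ(μ) ≤ n²} (a_{μ*} - lo μ)`.  THE LO-INPUTS (Part B
requirement, LEAD D1757 / THEORY-1 N1): `lo μ` is a certified LOWER bound of `mult_{μ*} k[Δ(det_n)]` for
`μ ⊢ n d`, `ℓ(μ) ≤ n²` — in the cell: the measured `⟨n,n,d⟩` determinant ranks (two-prime exact ranks
or certified lower bounds), `lo μ := a_{μ*}` on the keys with `ℓ(μ) ≤ n + 1` covered by a theorem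
(e.g. cubic forms in `≤ 4` letters lie in `Δ(det₃)`; the 75 ternary `ℓ ≤ 3` keys at `d = 10` per N1),
and `lo μ := 0` on every unmeasured key. [cite: BurgisserEtAl2011, Prop. 6.3.2 and §6.3] -/
theorem orbitMultiplicity_pad_le_detFormLex_add_sum_of_lowerBounds [CharZero k] {n m : ℕ} [NeZero n]
    [NeZero m] (hnm : n < m) {h' : MvPolynomial (MatIdx n) k} (hh' : h'.IsHomogeneous n) {d : ℕ}
    (lam : Nat.Partition (m * d)) (hlam : lam.parts.card ≤ m * m) (lo : Nat.Partition (n * d) → ℕ)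
    (Hlo : ∀ mu : Nat.Partition (n * d), mu.parts.card ≤ n * n →
      lo mu ≤ orbitMultiplicity k (detFormLex k n) n (Weight.dualOfPartition (n * n) mu).toMatIdx) :
    orbitMultiplicity k (X (toLex ((0 : Fin m), (0 : Fin m))) ^ (m - n) * rename (blockPlace hnm.le) h') m
        (Weight.dualOfPartition (m * m) lam).toMatIdx ≤
      orbitMultiplicity k (detFormLex k m) m (Weight.dualOfPartition (m * m) lam).toMatIdx +
        ∑ mu ∈ (Finset.univ : Finset (Nat.Partition (n * d))).filter
            (fun mu => mu.parts.card ≤ n * n ∧ partContained (m * m) mu lam),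
          (plethysmCoeff k (MatIdx n) n (Weight.dualOfPartition (n * n) mu).toMatIdx - lo mu) := by
  refine (orbitMultiplicity_pad_le_detFormLex_add_capDeficitSumContained hnm hh' lam hlam).trans
    (Nat.add_le_add_left ?_ _)
  unfold capDeficitSumContained
  refine Finset.sum_le_sum fun mu hmu => ?_
  rw [Finset.mem_filter] at hmu
  unfold hwDeficit
  exact Nat.sub_le_sub_left (Hlo mu hmu.2.1) _

/-- **(C3, INCAPABLE criterion).**  If `det_n` is FULL at every `μ ⊢ n d` with `ℓ(μ) ≤ n²` and `μ ⊂ λ`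
(`a_{μ*} ≤ mult_{μ*} k[Δ(det_n)]`), then `λ*` is not a multiplicity obstruction against
`x₀₀^{m-n} h' ∈ Δ(det_m)` for ANY form `h'` of degree `n` on the `n × n` letters: `mult_{λ*} k[Δ(x₀₀^{m-n} h')]
≤ mult_{λ*} k[Δ(det_m)]`. Cell reading: «INCAPABLE rows (containment form) carry no obstruction, for every
padded nine-letter cubic, given the det₃ records at the contained keys only».
[cite: BurgisserEtAl2011, Prop. 6.3.2 and §6.3] [cite: Landsberg2017, Prop. 8.4.1.1 and Prop. 8.4.2.2] -/
theorem orbitMultiplicity_pad_le_detFormLex_of_forall_contained [CharZero k] {n m : ℕ} [NeZero n]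
    [NeZero m] (hnm : n < m) {h' : MvPolynomial (MatIdx n) k} (hh' : h'.IsHomogeneous n) {d : ℕ}
    (lam : Nat.Partition (m * d)) (hlam : lam.parts.card ≤ m * m)
    (H : ∀ mu : Nat.Partition (n * d), mu.parts.card ≤ n * n → partContained (m * m) mu lam →
      plethysmCoeff k (MatIdx n) n (Weight.dualOfPartition (n * n) mu).toMatIdx ≤
        orbitMultiplicity k (detFormLex k n) n (Weight.dualOfPartition (n * n) mu).toMatIdx) :
    orbitMultiplicity k (X (toLex ((0 : Fin m), (0 : Fin m))) ^ (m - n) * rename (blockPlace hnm.le) h') m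
        (Weight.dualOfPartition (m * m) lam).toMatIdx ≤
      orbitMultiplicity k (detFormLex k m) m (Weight.dualOfPartition (m * m) lam).toMatIdx := by
  refine (orbitMultiplicity_pad_le_detFormLex_add_capDeficitSumContained hnm hh' lam hlam).trans
    (le_of_eq ?_)
  have h0 : capDeficitSumContained (detFormLex k n) m d lam = 0 := by
    unfold capDeficitSumContained
    refine Finset.sum_eq_zero fun mu hmu => ?_
    rw [Finset.mem_filter] at hmu
    unfold hwDeficit
    exact Nat.sub_eq_zero_of_le (H mu hmu.2.1 hmu.2.2)
  rw [h0, add_zero]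


/-- **(C3, INCAPABLE criterion for the V1 object `x₀₀^{m-n} per_n`).**  If `det_n` is FULL at every
`μ ⊢ n d` with `ℓ(μ) ≤ n²` and `μ ⊂ λ`, then `mult_{λ*} k[Δ(x₀₀^{m-n} per_n)] ≤ mult_{λ*} k[Δ(det_m)]`: the type
`λ*` carries no multiplicity obstruction for the padded permanent (cell: the INCAPABLE rows of V1-LIST,
containment form, R2-free). [cite: BurgisserEtAl2011, Prop. 6.3.2 and §6.3] -/
theorem orbitMultiplicity_paddedPerFormLex_le_detFormLex_of_forall_contained [CharZero k] {n m : ℕ}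
    [NeZero n] [NeZero m] (hnm : n < m) {d : ℕ} (lam : Nat.Partition (m * d)) (hlam : lam.parts.card ≤ m * m)
    (H : ∀ mu : Nat.Partition (n * d), mu.parts.card ≤ n * n → partContained (m * m) mu lam →
      plethysmCoeff k (MatIdx n) n (Weight.dualOfPartition (n * n) mu).toMatIdx ≤
        orbitMultiplicity k (detFormLex k n) n (Weight.dualOfPartition (n * n) mu).toMatIdx) :
    orbitMultiplicity k (paddedPerFormLex k n m) m (Weight.dualOfPartition (m * m) lam).toMatIdx ≤
      orbitMultiplicity k (detFormLex k m) m (Weight.dualOfPartition (m * m) lam).toMatIdx := by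
  have hper : (rename toLex (perPoly (Fin n) k) : MvPolynomial (MatIdx n) k).IsHomogeneous n := by
    have h := (perPoly_isHomogeneous (n := Fin n) (k := k)).rename_isHomogeneous (f := toLex)
    rwa [Fintype.card_fin] at h
  rw [paddedPerFormLex_eq_pad hnm.le]
  exact orbitMultiplicity_pad_le_detFormLex_of_forall_contained hnm hper lam hlam H

/- The Pieri-sharp forms (C4) `orbitMultiplicity_pad_le_detFormLex_add_capDeficitSumPieri`,
`orbitMultiplicity_pad_le_detFormLex_add_sum_of_lowerBounds_pieri`, `orbitMultiplicity_pad_le_detFormLex_of_forall_horizStrip`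
are proved in §7 below. -/

end MatIdxCorollaries

/-! ## §6 Root strings through a highest weight of `GL_n` (group form, any infinite field)

For the rational representations of `GL σ k` with the upper triangular Borel subgroup (tree
`GLHighestWeight.lean`, `GLHighestWeightIsomorphismProofs.lean`) this section proves the elementary weight
geometry of a cyclic highest-weight module that Goodman–Wallach obtain from `V = U(𝔫⁻) v₀` (Lemma 3.2.2) and
from the Weyl group symmetry of the set of weights (Prop. 3.2.7): the torus weights of `span (U⁻ · v)` lie in
`ψ - Q₊` (no finite-dimensionality needed: independence of characters), partial sums of `-Q₊` are `≤ 0`, the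
transposition matrix of `(x y)` carries the `ω`-weight space to the `ω ∘ (x y)`-weight space, and therefore
ROOT STRINGS THROUGH A HIGHEST WEIGHT ARE SHORT: a nonzero weight vector of weight `ψ - J (ε_x - ε_y)`
(`x < y`) in the cyclic module of a highest-weight vector of weight `ψ` has `J ≤ ψ_x - ψ_y`
(`natCast_le_sub_of_mem_span_orbit`); `natCast_le_sub_of_family` is the form with a polynomial family
`g(t) · w = Σ_{j ≤ J} t^j w_j`, `w_J = v`, in a completely reducible representation (project onto
`span (G · v)` along a stable complement).  Mathlib: `Matrix.swap` / `GeneralLinearGroup.swap`,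
`Equiv.Perm.permMatrix`, `Submodule.projection`, `Polynomial.funext`, `Finset.insertNone`.  Two plumbing
definitions (`rootWeight`, `orbitSpan`); everything is stated for an arbitrary rational representation, so it
can be re-homed next to `GLHighestWeight.lean` unchanged. -/

section RootStrings

variable {σ : Type*} [Fintype σ] [LinearOrder σ] {k : Type*} [Field k]

/-! ### §6.1 Torus weights occurring in `span (U⁻ · v)` -/

section LowerSpanWeights

variable {V : Type*} [AddCommGroup V] [Module k V]

/-- **Weights of the span of the `U⁻`-orbit of a weight vector.** If `v` is a torus weight vector of
weight `ψ` in a rational representation over an infinite field and `w ≠ 0` is a weight vector of weight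
`ω` lying in `span (U⁻ · v)`, then `ω = ψ + ∑_{i>j} n_{ij} (ε_i - ε_j)` for some exponent vector `n`
on the strictly lower positions (`lowWeight`): pairing with a linear form, `a ↦ φ(u(a) · v)` is a
polynomial `∑_n r_n a^n` whose monomials are torus semi-invariants of weight `lowWeight n`, and the
independence of characters isolates the weight `ω`.  The group form of "`V = ℂ v₀ ⊕ ⨁_{μ ≺ λ} V(μ)`"
for the cyclic module `U(𝔫⁻) v₀` (Goodman–Wallach Lemma 3.2.2). [cite: GoodmanWallachGTM255, Lemma 3.2.2] -/
theorem exists_lowWeight_eq_of_mem_lowerSpan [Infinite k]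
    {ρ : Representation k (GL σ k) V} (hρ : IsRationalRep ρ) {ψ ω : Weight σ} {v w : V}
    (hv : v ∈ weightSpace ρ ψ) (hw : w ∈ lowerSpan ρ v) (hwt : w ∈ weightSpace ρ ω) (hw0 : w ≠ 0) :
    ∃ n : LowIdx σ →₀ ℕ, ω = ψ + lowWeight n := by
  classical
  by_contra hne
  push Not at hne
  apply hw0
  obtain ⟨c, rfl⟩ := Finsupp.mem_span_range_iff_exists_finsupp.mp hw
  -- (★) torus translates: `ψ(t) • ∑ c_a u(t • a) v = ω(t) • ∑ c_a u(a) v`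
  have hstar : ∀ t : GL σ k, IsDiagonalGL t →
      weightChar ψ t • ∑ a ∈ c.support, c a • ρ (lowerUnitri (torusScaleLow t a)) v =
        weightChar ω t • ∑ a ∈ c.support, c a • ρ (lowerUnitri a) v := by
    intro t ht
    have h1 := hwt t ht
    change ρ t (∑ a ∈ c.support, c a • ρ (lowerUnitri a) v) =
      weightChar ω t • ∑ a ∈ c.support, c a • ρ (lowerUnitri a) v at h1
    rw [map_sum] at h1
    have h2 : ∀ a ∈ c.support, ρ t (c a • ρ (lowerUnitri a) v) =
        weightChar ψ t • (c a • ρ (lowerUnitri (torusScaleLow t a)) v) := by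
      intro a _
      rw [map_smul, ← Module.End.mul_apply, ← map_mul,
        mul_lowerUnitri_eq_lowerUnitri_torusScaleLow_mul ht, map_mul, Module.End.mul_apply, hv t ht,
        map_smul, smul_comm]
    rw [Finset.sum_congr rfl h2, ← Finset.smul_sum] at h1
    exact h1
  -- test against linear forms
  refine (Module.forall_dual_apply_eq_zero_iff k _).mp fun φ => ?_
  obtain ⟨R, hR⟩ := exists_eval_eq_apply_lowerUnitri hρ v φ
  set s : (LowIdx σ →₀ ℕ) → k := fun n => ∑ a ∈ c.support, c a * ∏ p : LowIdx σ, a p ^ n p with hs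
  set K : k := ∑ a ∈ c.support, c a * φ (ρ (lowerUnitri a) v) with hK
  have hevalsum : ∀ (x : (LowIdx σ → k) → LowIdx σ → k),
      ∑ a ∈ c.support, c a * eval (x a) R =
        ∑ n ∈ R.support, coeff n R * ∑ a ∈ c.support, c a * ∏ p : LowIdx σ, x a p ^ n p := by
    intro x
    simp only [eval_eq', Finset.mul_sum]
    rw [Finset.sum_comm]
    refine Finset.sum_congr rfl fun n _ => Finset.sum_congr rfl fun a _ => ?_
    ring
  -- index the character sum by `Option (LowIdx σ →₀ ℕ)`: `none` carries the weight `ω`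
  set N : Finset (Option (LowIdx σ →₀ ℕ)) := Finset.insertNone R.support with hN
  set x : Option (LowIdx σ →₀ ℕ) → k := fun o => o.elim (-K) fun n => coeff n R * s n with hx
  set wt : Option (LowIdx σ →₀ ℕ) → Weight σ := fun o => o.elim ω fun n => ψ + lowWeight n with hwt'
  have hsum : ∀ t : GL σ k, IsDiagonalGL t → ∑ o ∈ N, x o * weightChar (wt o) t = 0 := by
    intro t ht
    have hφ := congrArg φ (hstar t ht)
    simp only [map_smul, map_sum, smul_eq_mul, ← hR] at hφ
    rw [hevalsum, hevalsum] at hφ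
    have hL : ∑ n ∈ R.support, coeff n R * ∑ a ∈ c.support, c a * ∏ p : LowIdx σ,
        torusScaleLow t a p ^ n p = ∑ n ∈ R.support, coeff n R * s n * weightChar (lowWeight n) t := by
      refine Finset.sum_congr rfl fun n _ => ?_
      simp only [prod_torusScaleLow_pow ht, hs, Finset.mul_sum, Finset.sum_mul]
      refine Finset.sum_congr rfl fun a _ => ?_
      ring
    rw [hL] at hφ
    have hK' : ∑ n ∈ R.support, coeff n R * ∑ a ∈ c.support, c a * ∏ p : LowIdx σ, a p ^ n p = K := by
      rw [← hevalsum (fun a => a)]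
      simp only [hK, hR]
    rw [hK'] at hφ
    rw [hN, Finset.sum_insertNone]
    simp only [hx, hwt', Option.elim]
    have hψ : ∀ n ∈ R.support, coeff n R * s n * weightChar (ψ + lowWeight n) t =
        weightChar ψ t * (coeff n R * s n * weightChar (lowWeight n) t) := by
      intro n _
      rw [weightChar_add_of_isDiagonalGL _ _ ht]
      ring
    rw [Finset.sum_congr rfl hψ, ← Finset.mul_sum, hφ]
    ring
  have hfib := sum_filter_eq_zero_of_sum_mul_weightChar_eq_zero N x wt hsum ω
  have hfilter : (N.filter fun o => wt o = ω) = {none} := by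
    ext o
    simp only [Finset.mem_filter, Finset.mem_singleton, hN]
    constructor
    · rintro ⟨ho, h⟩
      cases o with
      | none => rfl
      | some n =>
        exfalso
        exact hne n (by simpa [hwt'] using h.symm)
    · rintro rfl
      exact ⟨Finset.none_mem_insertNone, rfl⟩
  rw [hfilter, Finset.sum_singleton] at hfib
  simp only [hx, Option.elim, neg_eq_zero] at hfib
  -- `φ w = K`
  change φ (c.sum fun a r => r • ρ (lowerUnitri a) v) = 0
  rw [Finsupp.sum, map_sum]
  simp only [map_smul, smul_eq_mul]
  rw [← hK]
  exact hfib

end LowerSpanWeights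

/-! ### §6.2 Partial sums of the weights `lowWeight n` -/

section PartialSums

omit [Fintype σ] in
/-- The contribution of `c (ε_i - ε_j)`, `i > j`, to a partial sum `∑_{z ≤ x}` is `≤ 0`. [folklore] -/
private theorem ite_sub_ite_le_zero (p : LowIdx σ) (x : σ) (c : ℕ) :
    ((if p.1.1 ≤ x then (c : ℤ) else 0) - if p.1.2 ≤ x then (c : ℤ) else 0) ≤ 0 := by
  have hlt : p.1.2 < p.1.1 := p.2
  by_cases h1 : p.1.1 ≤ x
  · have h2 : p.1.2 ≤ x := hlt.le.trans h1
    simp [h1, h2]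
  · by_cases h2 : p.1.2 ≤ x
    · simp [h1, h2]
    · simp [h1, h2]

/-- **Partial sums of a weight of `U(𝔫⁻)` are nonpositive**: for every letter `x`,
`∑_{z ≤ x} (lowWeight n) z ≤ 0` — each `ε_i - ε_j` with `i > j` contributes `-1` exactly when
`j ≤ x < i` (the weights `-β`, `β ∈ Q₊`, lie below `0` in the dominance order; Goodman–Wallach §3.2.1,
the root order `μ ≺ λ`). [cite: GoodmanWallachGTM255, Lemma 3.2.2] -/
theorem sum_lowWeight_le_zero (n : LowIdx σ →₀ ℕ) (x : σ) :
    ∑ z ∈ Finset.univ.filter (fun z => z ≤ x), lowWeight n z ≤ 0 := by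
  classical
  set F := Finset.univ.filter (fun z : σ => z ≤ x) with hF
  have hmem : ∀ z, z ∈ F ↔ z ≤ x := fun z => by simp [hF]
  have key : ∀ p : LowIdx σ, ∑ z ∈ F, ((if p.1.1 = z then (n p : ℤ) else 0) -
      (if p.1.2 = z then (n p : ℤ) else 0)) ≤ 0 := by
    intro p
    rw [Finset.sum_sub_distrib, Finset.sum_ite_eq, Finset.sum_ite_eq]
    simp only [hmem]
    exact ite_sub_ite_le_zero p x (n p)
  calc ∑ z ∈ F, lowWeight n z
      = ∑ z ∈ F, ∑ p : LowIdx σ, ((if p.1.1 = z then (n p : ℤ) else 0) -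
          (if p.1.2 = z then (n p : ℤ) else 0)) := by
        refine Finset.sum_congr rfl fun z _ => ?_
        simp only [lowWeight, lowRowSum, lowColSum, Nat.cast_sum, Nat.cast_ite, Nat.cast_zero,
          Finset.sum_sub_distrib]
    _ = ∑ p : LowIdx σ, ∑ z ∈ F, ((if p.1.1 = z then (n p : ℤ) else 0) -
          (if p.1.2 = z then (n p : ℤ) else 0)) := Finset.sum_comm
    _ ≤ 0 := Finset.sum_nonpos fun p _ => key p

end PartialSums

/-! ### §6.3 The Weyl group: permutation matrices permute weight spaces -/

section Swap

variable {V : Type*} [AddCommGroup V] [Module k V]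

/-- Conjugating a diagonal matrix by the transposition matrix of `(x y)` permutes its entries. [folklore] -/
private theorem swap_mul_diagonal_mul_swap (d : σ → k) (x y : σ) :
    Matrix.swap k x y * Matrix.diagonal d * Matrix.swap k x y = Matrix.diagonal (d ∘ Equiv.swap x y) := by
  classical
  rw [Matrix.mul_assoc, Matrix.swap, Equiv.Perm.permMatrix, PEquiv.mul_toMatrix_toPEquiv,
    PEquiv.toMatrix_toPEquiv_mul, Matrix.submatrix_submatrix, Equiv.symm_swap, Function.id_comp,
    Function.comp_id]
  exact Matrix.submatrix_diagonal_equiv d (Equiv.swap x y)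

/-- **The transposition `(x y)` of the Weyl group `S_σ ⊂ GL_σ` carries the `ω`-weight space to the
`ω ∘ (x y)`-weight space** (`P t P⁻¹` is the diagonal matrix with permuted entries).  Goodman–Wallach
Prop. 3.2.7 (2) (`τ_α V(μ) = V(s_α μ)`). [cite: GoodmanWallachGTM255, Prop. 3.2.7 (2)] -/
theorem swap_apply_mem_weightSpace {ρ : Representation k (GL σ k) V} {ω : Weight σ} {w : V}
    (hw : w ∈ weightSpace ρ ω) (x y : σ) :
    ρ (Matrix.GeneralLinearGroup.swap k x y) w ∈ weightSpace ρ (ω ∘ Equiv.swap x y) := by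
  classical
  intro t ht
  set P : GL σ k := Matrix.GeneralLinearGroup.swap k x y with hP
  set d : σ → k := fun i => (t : Matrix σ σ k) i i with hd
  have htd : (t : Matrix σ σ k) = Matrix.diagonal d :=
    coe_eq_diagonal_of_isDiagonalGL ht
  -- the conjugate `T' = P t P` is diagonal with entries `d ∘ swap`
  set T' : GL σ k := P * t * P with hT'
  have hT'coe : (T' : Matrix σ σ k) = Matrix.diagonal (d ∘ Equiv.swap x y) := by
    rw [hT', Units.val_mul, Units.val_mul, hP, Matrix.GeneralLinearGroup.val_swap, htd]
    exact swap_mul_diagonal_mul_swap d x y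
  have hT'diag : IsDiagonalGL T' := by
    rw [isDiagonalGL_iff_isDiag, hT'coe]
    exact Matrix.isDiag_diagonal _
  have hPP : P * P = 1 := by
    refine Units.ext ?_
    rw [Units.val_mul, hP, Matrix.GeneralLinearGroup.val_swap, Units.val_one]
    exact Matrix.swap_mul_self x y
  have htP : t * P = P * T' := by
    rw [hT', ← mul_assoc, ← mul_assoc, hPP, one_mul]
  have hchar : weightChar ω T' = weightChar (ω ∘ Equiv.swap x y) t := by
    simp only [weightChar, hT'coe, htd, Matrix.diagonal_apply_eq, Function.comp_apply]
    exact Fintype.prod_equiv (Equiv.swap x y) _ _ fun i => by rw [Equiv.swap_apply_self]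
  calc ρ t (ρ P w) = ρ (t * P) w := by rw [map_mul, Module.End.mul_apply]
    _ = ρ P (ρ T' w) := by rw [htP, map_mul, Module.End.mul_apply]
    _ = weightChar (ω ∘ Equiv.swap x y) t • ρ P w := by rw [hw T' hT'diag, map_smul, hchar]

/-- The transposition matrix is an involution in `GL`, so it kills no vector. [folklore] -/
private theorem swap_apply_ne_zero (ρ : Representation k (GL σ k) V) {w : V} (hw : w ≠ 0) (x y : σ) :
    ρ (Matrix.GeneralLinearGroup.swap k x y) w ≠ 0 := by
  intro h
  apply hw
  have hPP : Matrix.GeneralLinearGroup.swap k x y * Matrix.GeneralLinearGroup.swap k x y = 1 := by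
    refine Units.ext ?_
    rw [Units.val_mul, Matrix.GeneralLinearGroup.val_swap, Units.val_one]
    exact Matrix.swap_mul_self x y
  have := congrArg (ρ (Matrix.GeneralLinearGroup.swap k x y)) h
  rwa [map_zero, ← Module.End.mul_apply, ← map_mul, hPP, map_one, Module.End.one_apply] at this

end Swap

/-! ### §6.4 Coefficients of a vector-valued polynomial identity -/

section PolyIdentity

variable {V : Type*} [AddCommGroup V] [Module k V]

/-- Over an infinite field, if `∑_{j ∈ s} t^j • a_j = 0` for every scalar `t`, then every `a_j = 0`
(pair with a linear form and use that a polynomial with infinitely many roots vanishes). [folklore] -/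
private theorem eq_zero_of_forall_sum_pow_smul_eq_zero [Infinite k] {s : Finset ℕ} {a : ℕ → V}
    (h : ∀ t : k, ∑ j ∈ s, t ^ j • a j = 0) {j : ℕ} (hj : j ∈ s) : a j = 0 := by
  classical
  refine (Module.forall_dual_apply_eq_zero_iff k _).mp fun φ => ?_
  set p : Polynomial k := ∑ i ∈ s, Polynomial.monomial i (φ (a i)) with hp
  have hp0 : p = 0 := by
    refine Polynomial.funext fun t => ?_
    have ht := congrArg φ (h t)
    rw [map_sum, map_zero] at ht
    rw [hp, Polynomial.eval_finsetSum, Polynomial.eval_zero, ← ht]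
    refine Finset.sum_congr rfl fun i _ => ?_
    rw [Polynomial.eval_monomial, map_smul, smul_eq_mul, mul_comm]
  have hc := congrArg (fun q : Polynomial k => q.coeff j) hp0
  simp only [hp, Polynomial.finsetSum_coeff, Polynomial.coeff_monomial, Polynomial.coeff_zero,
    Finset.sum_ite_eq', hj, if_true] at hc
  exact hc

end PolyIdentity

/-! ### §6.5 Root strings through a highest weight -/

section RootString

variable {V : Type*} [AddCommGroup V] [Module k V]

/-- The root `ε_x - ε_y` as an integral weight of the diagonal torus. [folklore] -/
def rootWeight (x y : σ) : Weight σ := fun z => (if z = x then 1 else 0) - (if z = y then 1 else 0)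

omit [Fintype σ] in
/-- Unfolding `rootWeight`. [folklore] -/
@[simp] private theorem rootWeight_apply (x y z : σ) :
    rootWeight x y z = (if z = x then 1 else 0) - (if z = y then 1 else 0) := rfl

/-- The span of the orbit `G · v` as a subrepresentation. [folklore] -/
def orbitSpan (ρ : Representation k (GL σ k) V) (v : V) : Subrepresentation ρ :=
  ⟨Submodule.span k (Set.range fun g : GL σ k => ρ g v), fun g _ hw => apply_mem_span_orbit ρ v g hw⟩

/-- Unfolding `orbitSpan`. [folklore] -/
@[simp] private theorem orbitSpan_toSubmodule (ρ : Representation k (GL σ k) V) (v : V) :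
    (orbitSpan ρ v).toSubmodule = Submodule.span k (Set.range fun g : GL σ k => ρ g v) := rfl

/-- **Root strings through a highest weight are short** (group form, any infinite field).  Let `v ≠ 0`
be a highest-weight vector of weight `ψ` of a rational representation and suppose the cyclic module
`span (G · v)` contains a nonzero torus weight vector of weight `ψ - J (ε_x - ε_y)` with `x < y`.  Then
`J ≤ ψ_x - ψ_y`.  Proof: the transposition `(x y)` of the Weyl group carries it to a weight vector of
weight `s_{xy}(ψ - J(ε_x - ε_y))` in the same cyclic module `span (G · v) = span (U⁻ · v)`
(`span_orbit_eq_lowerSpan`), whose weights are `ψ - β`, `β ∈ Q₊` (`exists_eq_add_lowWeight_of_mem_lowerSpan`);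
comparing the partial sums `∑_{z ≤ x}` gives `ψ_y + J ≤ ψ_x`.  (Goodman–Wallach Lemma 3.2.2 with
Prop. 3.2.7: the weights of `L^λ` lie in `λ - Q₊` and are permuted by `W`.)
[cite: GoodmanWallachGTM255, Lemma 3.2.2 with Prop. 3.2.7 (2)] -/
theorem natCast_le_sub_of_mem_span_orbit [Infinite k] {ρ : Representation k (GL σ k) V}
    (hρ : IsRationalRep ρ) {ψ : Weight σ} {v : V} (hv : v ∈ highestWeightSpace ρ ψ)
    {x y : σ} (hxy : x < y) {J : ℕ} {w : V}
    (hw : w ∈ Submodule.span k (Set.range fun g : GL σ k => ρ g v))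
    (hwt : w ∈ weightSpace ρ (ψ - (J : ℤ) • rootWeight x y)) (hw0 : w ≠ 0) :
    (J : ℤ) ≤ ψ x - ψ y := by
  classical
  -- move to the `U⁻`-span and apply the transposition `(x y)`
  rw [span_orbit_eq_lowerSpan hρ hv] at hw
  set P : GL σ k := Matrix.GeneralLinearGroup.swap k x y with hP
  have hw' : ρ P w ∈ lowerSpan ρ v := by
    rw [← span_orbit_eq_lowerSpan hρ hv] at hw ⊢
    exact apply_mem_span_orbit ρ v P hw
  have hwt' := swap_apply_mem_weightSpace hwt x y
  have hw0' : ρ P w ≠ 0 := swap_apply_ne_zero ρ hw0 x y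
  obtain ⟨n, hn⟩ := exists_lowWeight_eq_of_mem_lowerSpan hρ
    (highestWeightSpace_le_weightSpace ρ ψ hv) hw' hwt' hw0'
  -- compare partial sums over `{z | z ≤ x}`
  have hsum := sum_lowWeight_le_zero n x
  have hpt : ∀ z, lowWeight n z = (ψ - (J : ℤ) • rootWeight x y) (Equiv.swap x y z) - ψ z := by
    intro z
    have := congrFun hn z
    simp only [Function.comp_apply, Pi.add_apply] at this
    linarith
  simp only [hpt] at hsum
  -- evaluate: only `z = x` contributes, with value `ψ y + J - ψ x`
  have hterm : ∀ z ∈ Finset.univ.filter (fun z => z ≤ x),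
      (ψ - (J : ℤ) • rootWeight x y) (Equiv.swap x y z) - ψ z =
        if z = x then ψ y + J - ψ x else 0 := by
    intro z hz
    rw [Finset.mem_filter] at hz
    have hzy : z ≠ y := fun h => (not_lt.mpr hz.2) (h ▸ hxy)
    by_cases hzx : z = x
    · subst hzx
      have hyz : ¬ y = z := fun h => (lt_irrefl z) (h ▸ hxy)
      rw [if_pos rfl, Equiv.swap_apply_left]
      simp only [Pi.sub_apply, Pi.smul_apply, smul_eq_mul, rootWeight_apply, if_neg hyz, if_true]
      ring
    · rw [if_neg hzx, Equiv.swap_apply_of_ne_of_ne hzx hzy]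
      simp only [Pi.sub_apply, Pi.smul_apply, smul_eq_mul, rootWeight_apply, if_neg hzx, if_neg hzy]
      ring
  rw [Finset.sum_congr rfl hterm, Finset.sum_ite_eq' ] at hsum
  simp only [Finset.mem_filter, Finset.mem_univ, le_refl, and_self, if_true] at hsum
  linarith

/-- **Root strings, semisimple form with a polynomial family.**  In a completely reducible rational
representation over an infinite field, let `v ≠ 0` be a highest-weight vector of weight `ψ`, `w` a torus
weight vector of weight `ψ - J (ε_x - ε_y)` (`x < y`), and suppose that along some family `g(t)` of group
elements `g(t) · w = ∑_{j ≤ J} t^j w_j` with top coefficient `w_J = v`.  Then `J ≤ ψ_x - ψ_y`: the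
equivariant projection onto `span (G · v)` (along a stable complement) maps `w` to a NONZERO weight vector
of the cyclic module, and `natCast_le_sub_of_mem_span_orbit` applies.
[cite: GoodmanWallachGTM255, Lemma 3.2.2 with Prop. 3.2.7 (2)] -/
theorem natCast_le_sub_of_family [Infinite k] {ρ : Representation k (GL σ k) V}
    (hρ : IsRationalRep ρ) (hss : ρ.IsSemisimpleRepresentation) {ψ : Weight σ} {v : V}
    (hv : v ∈ highestWeightSpace ρ ψ) (hv0 : v ≠ 0) {x y : σ} (hxy : x < y) {J : ℕ} {w : V}
    (hwt : w ∈ weightSpace ρ (ψ - (J : ℤ) • rootWeight x y)) (g : k → GL σ k) (ws : ℕ → V)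
    (hstr : ∀ t : k, ρ (g t) w = ∑ j ∈ Finset.range (J + 1), t ^ j • ws j) (htop : ws J = v) :
    (J : ℤ) ≤ ψ x - ψ y := by
  classical
  set U : Subrepresentation ρ := orbitSpan ρ v with hU
  obtain ⟨C, hC⟩ := hss.exists_isCompl U
  have hC' : IsCompl U.toSubmodule C.toSubmodule :=
    ⟨by rw [disjoint_iff]; exact congrArg Subrepresentation.toSubmodule hC.1.eq_bot,
     by rw [codisjoint_iff]; exact congrArg Subrepresentation.toSubmodule hC.2.eq_top⟩
  -- the projection onto `U` along `C` (as an endomorphism of `V`) is equivariant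
  set pr : V →ₗ[k] V := U.toSubmodule.projection C.toSubmodule hC' with hpr
  have hpr_equiv : ∀ (h : GL σ k) (u : V), pr (ρ h u) = ρ h (pr u) := by
    intro h u
    obtain ⟨a, ha, c, hc, rfl⟩ :=
      Submodule.mem_sup.mp (hC'.sup_eq_top.symm ▸ Submodule.mem_top (x := u))
    rw [map_add, map_add, map_add, Submodule.projection_apply_of_mem_left hC' ha,
      Submodule.projection_apply_of_mem_right hC' hc,
      Submodule.projection_apply_of_mem_left hC' (U.apply_mem_toSubmodule h ha),
      Submodule.projection_apply_of_mem_right hC' (C.apply_mem_toSubmodule h hc), add_zero,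
      map_add]
    simp
  have hvU : v ∈ U.toSubmodule := Submodule.subset_span ⟨1, by simp⟩
  have hprv : pr v = v := Submodule.projection_apply_of_mem_left hC' hvU
  -- `pr w` is a weight vector in `U` with the same polynomial family and top coefficient `v`
  have hwU : pr w ∈ Submodule.span k (Set.range fun g : GL σ k => ρ g v) :=
    Submodule.projection_apply_mem hC' w
  have hwtU : pr w ∈ weightSpace ρ (ψ - (J : ℤ) • rootWeight x y) := by
    intro t ht
    rw [← hpr_equiv, hwt t ht, map_smul]
  have hw0U : pr w ≠ 0 := by
    intro h0
    apply hv0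
    have hfam : ∀ t : k, ∑ j ∈ Finset.range (J + 1), t ^ j • pr (ws j) = 0 := by
      intro t
      have := congrArg pr (hstr t)
      simp only [map_sum, map_smul] at this
      rw [← this, hpr_equiv, h0, map_zero]
    have htopz := eq_zero_of_forall_sum_pow_smul_eq_zero hfam (Finset.self_mem_range_succ J)
    rw [htop, hprv] at htopz
    exact htopz
  exact natCast_le_sub_of_mem_span_orbit hρ hv hxy hwU hwtU hw0U

end RootString

end RootStrings

/-! ## §7 The Pieri-sharp forms: Pieri vanishing for highest-weight vectors via root strings -/

open _root_.Literature.RepresentationTheory.GeneralLinear (transvectionGL coe_transvectionGL)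

section Transvection

variable {k : Type*} [Field k] {τ : Type*} [Fintype τ] [LinearOrder τ]

/-- `u_{xy}(t)` is upper triangular for `x < y`. [folklore] -/
private theorem isUpperTriangular_transvectionGL {x y : τ} (hxy : x < y) (t : k) :
    IsUpperTriangular (transvectionGL hxy.ne t) := by
  intro i j hij
  have hij' : j < i := hij
  rw [coe_transvectionGL, Matrix.transvection, Matrix.add_apply,
    Matrix.one_apply_ne (ne_of_gt hij'), Matrix.single_apply_of_ne, add_zero]
  rintro ⟨rfl, rfl⟩
  exact lt_asymm hxy hij'

/-- The weight character of a unipotent `u_{xy}(t)` is `1`. [folklore] -/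
private theorem weightChar_transvectionGL (χ : Weight τ) {x y : τ} (hxy : x ≠ y) (t : k) :
    weightChar χ (transvectionGL hxy t) = 1 := by
  unfold weightChar
  refine Finset.prod_eq_one fun i _ => ?_
  rw [coe_transvectionGL, Matrix.transvection, Matrix.add_apply, Matrix.one_apply_eq,
    Matrix.single_apply_of_ne, add_zero, one_zpow]
  rintro ⟨rfl, rfl⟩
  exact hxy rfl

end Transvection

section StringIdentity

variable {k : Type*} [Field k] {τ : Type*} [Fintype τ] [LinearOrder τ]

/-- Row `z` of `u_{xy}(t)` applied to the variables: `X_z`, plus `t X_y` when `z = x`. [folklore] -/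
private theorem sum_transvection_smul_X {R : Type*} [CommSemiring R] [Algebra k R] {x y : τ} (t : k)
    (z : τ) :
    ∑ w, (Matrix.transvection x y t) z w • (X w : MvPolynomial τ R) =
      X z + if z = x then t • X y else 0 := by
  classical
  simp only [Matrix.transvection, Matrix.add_apply, add_smul, Finset.sum_add_distrib]
  congr 1
  · rw [Finset.sum_eq_single z]
    · simp
    · intro w _ hw
      rw [Matrix.one_apply_ne (Ne.symm hw), zero_smul]
    · intro h; exact absurd (Finset.mem_univ z) h
  · by_cases hz : z = x
    · subst hz
      rw [if_pos rfl, Finset.sum_eq_single y]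
      · rw [Matrix.single_apply_same]
      · intro w _ hw
        rw [Matrix.single_apply_of_ne, zero_smul]
        rintro ⟨_, h⟩; exact hw h.symm
      · intro h; exact absurd (Finset.mem_univ y) h
    · rw [if_neg hz]
      refine Finset.sum_eq_zero fun w _ => ?_
      rw [Matrix.single_apply_of_ne, zero_smul]
      rintro ⟨h, _⟩; exact hz h.symm

omit [LinearOrder τ] in
/-- `monomial β 1 = ∏_z X_z^{β z}` over a finite index type. [folklore] -/
private theorem monomial_one_eq_prod (β : τ →₀ ℕ) :
    (monomial β (1 : k) : MvPolynomial τ k) = ∏ z, X z ^ β z := by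
  rw [monomial_eq, C_1, one_mul, Finsupp.prod_fintype]
  intro z; exact pow_zero _

/-- The exponent `γ` with `i` units moved from the letter `a` to the letter `b`. [folklore] -/
private def moveExp (a b : τ) (γ : τ →₀ ℕ) (i : ℕ) : τ →₀ ℕ :=
  γ - Finsupp.single a i + Finsupp.single b i

omit [Fintype τ] in
/-- Unfolding `moveExp` at a letter. [folklore] -/
private theorem moveExp_apply {a b : τ} (hab : a ≠ b) (γ : τ →₀ ℕ) (i : ℕ) (z : τ) :
    moveExp a b γ i z = if z = a then γ a - i else if z = b then γ b + i else γ z := by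
  simp only [moveExp, Finsupp.coe_add, Finsupp.coe_tsub, Pi.add_apply, Pi.sub_apply,
    Finsupp.single_apply]
  by_cases hza : z = a
  · subst hza
    simp [Ne.symm hab]
  · by_cases hzb : z = b
    · subst hzb
      simp [hza, Ne.symm hza]
    · simp [hza, hzb, Ne.symm hza, Ne.symm hzb]

omit [Fintype τ] in
/-- `moveExp a b γ i` at the letter `a`. [folklore] -/
private theorem moveExp_apply_left {a b : τ} (hab : a ≠ b) (γ : τ →₀ ℕ) (i : ℕ) :
    moveExp a b γ i a = γ a - i := by
  rw [moveExp_apply hab, if_pos rfl]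

omit [Fintype τ] in
/-- `moveExp a b γ i` at the letter `b`. [folklore] -/
private theorem moveExp_apply_right {a b : τ} (hab : a ≠ b) (γ : τ →₀ ℕ) (i : ℕ) :
    moveExp a b γ i b = γ b + i := by
  rw [moveExp_apply hab, if_neg (Ne.symm hab), if_pos rfl]

omit [Fintype τ] in
/-- `moveExp a b γ i` at the other letters. [folklore] -/
private theorem moveExp_apply_of_ne {a b : τ} (hab : a ≠ b) (γ : τ →₀ ℕ) (i : ℕ) {z : τ}
    (hza : z ≠ a) (hzb : z ≠ b) : moveExp a b γ i z = γ z := by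
  rw [moveExp_apply hab, if_neg hza, if_neg hzb]

omit [Fintype τ] in
/-- Moving `i ≤ γ_b` units from `b` to `a` and back gives `γ`. [folklore] -/
private theorem moveExp_moveExp {a b : τ} (hab : a ≠ b) {γ : τ →₀ ℕ} {i : ℕ} (hi : i ≤ γ b) :
    moveExp a b (moveExp b a γ i) i = γ := by
  ext z
  rw [moveExp_apply hab]
  by_cases hza : z = a
  · subst hza
    rw [if_pos rfl, moveExp_apply_right (Ne.symm hab)]
    simp
  · rw [if_neg hza]
    by_cases hzb : z = b
    · subst hzb
      rw [if_pos rfl, moveExp_apply_left (Ne.symm hab)]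
      omega
    · rw [if_neg hzb, moveExp_apply_of_ne (Ne.symm hab) _ _ hzb hza]

omit [Fintype τ] in
/-- If moving `m ≤ α_a` units from `a` to `b` in `α` gives `γ`, then `m ≤ γ_b` and `α` is `γ` with
`m` units moved back. [folklore] -/
private theorem eq_moveExp_of_moveExp_eq {a b : τ} (hab : a ≠ b) {α γ : τ →₀ ℕ} {m : ℕ}
    (hm : m ≤ α a) (h : moveExp a b α m = γ) : m ≤ γ b ∧ α = moveExp b a γ m := by
  have hb : γ b = α b + m := by rw [← h, moveExp_apply_right hab]
  refine ⟨by omega, ?_⟩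
  ext z
  rw [moveExp_apply (Ne.symm hab)]
  by_cases hzb : z = b
  · subst hzb; rw [if_pos rfl]; omega
  · rw [if_neg hzb]
    by_cases hza : z = a
    · subst hza
      rw [if_pos rfl, ← h, moveExp_apply_left hab]
      omega
    · rw [if_neg hza, ← h, moveExp_apply_of_ne hab _ _ hza hzb]

/-- **The `c`-monomials after the transvection `c ↦ u_{xy}(t) c`**:
`(u c)^α = ∑_m C(α_x, m) t^m c^{α - m e_x + m e_y}`. [folklore] -/
private theorem matMonomial_transvection {x y : τ} (hxy : x ≠ y) (t : k) (α : τ →₀ ℕ) :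
    matMonomial (Matrix.transvection x y t) α =
      ∑ m ∈ Finset.range (α x + 1), (((α x).choose m : k) * t ^ m) •
        (monomial (moveExp x y α m) (1 : k) : MvPolynomial τ k) := by
  classical
  have hrow : ∀ z, ∑ w, (Matrix.transvection x y t) z w • (X w : MvPolynomial τ k) =
      X z + if z = x then t • X y else 0 := fun z => sum_transvection_smul_X t z
  unfold matMonomial
  simp_rw [hrow]
  rw [← Finset.mul_prod_erase Finset.univ _ (Finset.mem_univ x), if_pos rfl]
  have hrest : ∏ z ∈ Finset.univ.erase x, (X z + if z = x then t • X y else (0 : MvPolynomial τ k)) ^ α z =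
      ∏ z ∈ Finset.univ.erase x, X z ^ α z := by
    refine Finset.prod_congr rfl fun z hz => ?_
    rw [if_neg (Finset.ne_of_mem_erase hz), add_zero]
  rw [hrest, add_comm, add_pow, Finset.sum_mul]
  refine Finset.sum_congr rfl fun m hm => ?_
  have hma : m ≤ α x := Nat.lt_succ_iff.mp (Finset.mem_range.mp hm)
  -- split off the letter `y` from the remaining product
  have hy : y ∈ Finset.univ.erase x := Finset.mem_erase.mpr ⟨Ne.symm hxy, Finset.mem_univ y⟩
  have hrest' : ∏ z ∈ (Finset.univ.erase x).erase y, (X z : MvPolynomial τ k) ^ moveExp x y α m z =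
      ∏ z ∈ (Finset.univ.erase x).erase y, X z ^ α z := by
    refine Finset.prod_congr rfl fun z hz => ?_
    rw [moveExp_apply_of_ne hxy _ _ (Finset.ne_of_mem_erase (Finset.mem_of_mem_erase hz))
      (Finset.ne_of_mem_erase hz)]
  have eβ : (monomial (moveExp x y α m) 1 : MvPolynomial τ k) =
      X x ^ (α x - m) * (X y ^ (α y + m) * ∏ z ∈ (Finset.univ.erase x).erase y, X z ^ α z) := by
    rw [monomial_one_eq_prod, ← Finset.mul_prod_erase Finset.univ _ (Finset.mem_univ x),
      ← Finset.mul_prod_erase _ _ hy, moveExp_apply_left hxy, moveExp_apply_right hxy, hrest']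
  have eα : ∏ z ∈ Finset.univ.erase x, (X z : MvPolynomial τ k) ^ α z =
      X y ^ α y * ∏ z ∈ (Finset.univ.erase x).erase y, X z ^ α z :=
    (Finset.mul_prod_erase _ _ hy).symm
  rw [eβ, eα]
  simp only [smul_eq_C_mul, map_mul, map_pow, map_natCast, mul_pow, pow_add]
  ring

/-- Coefficients of the transformed `c`-monomial. [folklore] -/
private theorem coeff_matMonomial_transvection {x y : τ} (hxy : x ≠ y) (t : k) (α γ : τ →₀ ℕ) :
    coeff γ (matMonomial (Matrix.transvection x y t) α) =
      ∑ m ∈ Finset.range (α x + 1), if moveExp x y α m = γ then ((α x).choose m : k) * t ^ m else 0 := by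
  classical
  rw [matMonomial_transvection hxy, coeff_sum]
  refine Finset.sum_congr rfl fun m _ => ?_
  rw [coeff_smul, coeff_monomial, smul_eq_mul]
  split_ifs <;> simp

/-- The coefficient at `γ` of `(u c)^α` for `α = γ` with `i ≤ γ_y` units moved from `y` to `x`. [folklore] -/
private theorem coeff_matMonomial_transvection_moveExp {x y : τ} (hxy : x ≠ y) (t : k) {γ : τ →₀ ℕ}
    {i : ℕ} (hi : i ≤ γ y) :
    coeff γ (matMonomial (Matrix.transvection x y t) (moveExp y x γ i)) = ((γ x + i).choose i : k) * t ^ i := by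
  classical
  rw [coeff_matMonomial_transvection hxy, moveExp_apply_right (Ne.symm hxy)]
  rw [Finset.sum_eq_single i]
  · rw [if_pos (moveExp_moveExp hxy hi)]
  · intro m hm hmi
    rw [if_neg]
    intro h
    have hm' : m ≤ moveExp y x γ i x := by
      rw [moveExp_apply_right (Ne.symm hxy)]; exact Nat.lt_succ_iff.mp (Finset.mem_range.mp hm)
    obtain ⟨_, h2⟩ := eq_moveExp_of_moveExp_eq hxy hm' h
    have := congrArg (fun β : τ →₀ ℕ => β x) h2
    simp only [moveExp_apply_right (Ne.symm hxy)] at this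
    exact hmi (by omega)
  · intro h
    exact absurd (Finset.mem_range.mpr (by omega)) h

/-- The coefficient at `γ` of `(u c)^α` vanishes unless `α` is `γ` with some `i ≤ γ_y` units moved
from `y` to `x`. [folklore] -/
private theorem coeff_matMonomial_transvection_eq_zero {x y : τ} (hxy : x ≠ y) (t : k) {α γ : τ →₀ ℕ}
    (hα : ∀ i ∈ Finset.range (γ y + 1), α ≠ moveExp y x γ i) :
    coeff γ (matMonomial (Matrix.transvection x y t) α) = 0 := by
  classical
  rw [coeff_matMonomial_transvection hxy]
  refine Finset.sum_eq_zero fun m hm => ?_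
  rw [if_neg]
  intro h
  have hm' : m ≤ α x := Nat.lt_succ_iff.mp (Finset.mem_range.mp hm)
  obtain ⟨h1, h2⟩ := eq_moveExp_of_moveExp_eq hxy hm' h
  exact hα m (Finset.mem_range.mpr (Nat.lt_succ_of_le h1)) h2

/-- **The string identity for the substituted family**: the coefficient at `c^γ` of `G(u_{xy}(t) c)` is
`∑_{i ≤ γ_y} C(γ_x + i, i) t^i G_{γ + i e_x - i e_y}` — the transvection acts on the index of the
coefficient family like the divided powers of `E_{xy}` on monomials. [folklore] -/
private theorem coeff_substC_transvection {R : Type*} [CommSemiring R] [Algebra k R] {x y : τ}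
    (hxy : x ≠ y) (t : k) (G : MvPolynomial τ R) (γ : τ →₀ ℕ) :
    coeff γ (substC k R (Matrix.transvection x y t) G) =
      ∑ i ∈ Finset.range (γ y + 1), (((γ x + i).choose i : k) * t ^ i) • coeff (moveExp y x γ i) G := by
  classical
  rw [coeff_substC]
  set g : ℕ → (τ →₀ ℕ) := fun i => moveExp y x γ i with hg
  set I := (Finset.range (γ y + 1)).image g with hI
  set f : (τ →₀ ℕ) → R := fun α => coeff γ (matMonomial (Matrix.transvection x y t) α) • coeff α G
    with hf
  have hginj : Set.InjOn g (Finset.range (γ y + 1)) := by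
    intro i _ j _ hij
    have := congrArg (fun β : τ →₀ ℕ => β x) hij
    simp only [hg, moveExp_apply_right (Ne.symm hxy)] at this
    omega
  -- both sides are the sum of `f` over `supp G ∪ I`
  have h1 : ∑ α ∈ G.support, f α = ∑ α ∈ G.support ∪ I, f α := by
    refine Finset.sum_subset Finset.subset_union_left fun α _ hα => ?_
    rw [hf]; simp only
    rw [notMem_support_iff.mp hα, smul_zero]
  have h2 : ∑ α ∈ I, f α = ∑ α ∈ G.support ∪ I, f α := by
    refine Finset.sum_subset Finset.subset_union_right fun α _ hα => ?_
    rw [hf]; simp only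
    rw [coeff_matMonomial_transvection_eq_zero hxy, zero_smul]
    intro i hi h
    exact hα (Finset.mem_image.mpr ⟨i, hi, h.symm⟩)
  change ∑ α ∈ G.support, f α = _
  rw [h1, ← h2, hI, Finset.sum_image hginj]
  refine Finset.sum_congr rfl fun i hi => ?_
  rw [hf, hg]
  simp only
  rw [coeff_matMonomial_transvection_moveExp hxy t (Nat.lt_succ_iff.mp (Finset.mem_range.mp hi))]

end StringIdentity

section TorusWeights

variable {k : Type*} [Field k] {τ : Type*} [Fintype τ] [LinearOrder τ] {m e : ℕ}

/-- For a diagonal matrix `t`, `(t c)^α = t^α c^α`: the coefficient at `γ` of the substituted family is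
rescaled by `t^γ`. [folklore] -/
private theorem coeff_substC_of_isDiagonalGL {R : Type*} [CommSemiring R] [Algebra k R] {t : GL τ k}
    (ht : IsDiagonalGL t) (G : MvPolynomial τ R) (γ : τ →₀ ℕ) :
    coeff γ (substC k R (t : Matrix τ τ k) G) = weightChar (natWeight γ) t • coeff γ G := by
  classical
  have hrow : ∀ z, ∑ w, (t : Matrix τ τ k) z w • (X w : MvPolynomial τ k) = (t : Matrix τ τ k) z z • X z := by
    intro z
    rw [Finset.sum_eq_single z]
    · intro w _ hw
      rw [(isDiagonalGL_iff_isDiag t).mp ht (Ne.symm hw), zero_smul]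
    · intro h; exact absurd (Finset.mem_univ z) h
  have hmat : ∀ α : τ →₀ ℕ, matMonomial (t : Matrix τ τ k) α =
      monomial α (∏ x, (t : Matrix τ τ k) x x ^ α x) := by
    intro α
    unfold matMonomial
    simp_rw [hrow, smul_eq_C_mul, mul_pow, Finset.prod_mul_distrib, ← C_pow]
    rw [← map_prod, ← monomial_one_eq_prod, C_mul_monomial, mul_one]
  rw [coeff_substC, weightChar_natWeight]
  simp_rw [hmat, coeff_monomial]
  rw [Finset.sum_eq_single γ]
  · rw [if_pos rfl]
  · intro α _ hα
    rw [if_neg hα, zero_smul]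
  · intro hγ
    rw [notMem_support_iff.mp hγ, smul_zero]

/-- **The coefficients of the polarisation family are torus weight vectors**: `G_γ` has weight
`χ + γ`. [cite: KadishLandsberg2014, §2] -/
theorem coeff_padPolarize_mem_weightSpace [Infinite k] {χ : Weight τ}
    {F : MvPolynomial (DegIdx τ (m + e)) k} (hF : F ∈ highestWeightSpace (coordRep τ k (m + e)) χ)
    (γ : τ →₀ ℕ) :
    coeff γ (padPolarize k m e F) ∈ weightSpace (coordRep τ k m) (χ + natWeight γ) := by
  intro t ht
  have hcov := congrArg (coeff γ) (map_coordSubst_padPolarize hF ht.isUpperTriangular)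
  rw [coeff_map, RingHom.coe_coe, coeff_smul, coeff_substC_of_isDiagonalGL ht, smul_smul,
    ← weightChar_add_upper _ _ ht.isUpperTriangular] at hcov
  rw [coordRep_apply]
  exact hcov

/-- **The string identity**: the root subgroup `u_{xy}(t)` acts on the coefficient family of a
highest-weight vector `F` by `u_{xy}(t) · G_γ = ∑_{i ≤ γ_y} C(γ_x + i, i) t^i G_{γ + i e_x - i e_y}`.
[cite: KadishLandsberg2014, §2] -/
theorem coordSubst_transvectionGL_coeff_padPolarize [Infinite k] {χ : Weight τ}
    {F : MvPolynomial (DegIdx τ (m + e)) k} (hF : F ∈ highestWeightSpace (coordRep τ k (m + e)) χ)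
    {x y : τ} (hxy : x < y) (t : k) (γ : τ →₀ ℕ) :
    coordSubst m (transvectionGL hxy.ne t) (coeff γ (padPolarize k m e F)) =
      ∑ i ∈ Finset.range (γ y + 1), (((γ x + i).choose i : k) * t ^ i) •
        coeff (moveExp y x γ i) (padPolarize k m e F) := by
  have hcov := congrArg (coeff γ) (map_coordSubst_padPolarize hF (isUpperTriangular_transvectionGL hxy t))
  rw [coeff_map, RingHom.coe_coe, weightChar_transvectionGL, one_smul, coe_transvectionGL,
    coeff_substC_transvection hxy.ne] at hcov
  exact hcov

/-- Height bookkeeping along a string: moving `i` units from `a` to `b` changes the height by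
`i (lettersAbove b - lettersAbove a)`. [folklore] -/
private theorem height_moveExp_add {a b : τ} (hab : a ≠ b) {γ : τ →₀ ℕ} {i : ℕ} (hi : i ≤ γ a) :
    height (moveExp a b γ i) + i * lettersAbove a = height γ + i * lettersAbove b := by
  have h : moveExp a b γ i + Finsupp.single a i = γ + Finsupp.single b i := by
    ext z
    simp only [Finsupp.coe_add, Pi.add_apply, Finsupp.single_apply]
    rcases eq_or_ne z a with rfl | hza
    · rw [moveExp_apply_left hab, if_pos rfl, if_neg (Ne.symm hab), add_zero, Nat.sub_add_cancel hi]
    · rcases eq_or_ne z b with rfl | hzb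
      · rw [moveExp_apply_right hab, if_neg (Ne.symm hza), if_pos rfl, add_zero]
      · rw [moveExp_apply_of_ne hab γ i hza hzb, if_neg (Ne.symm hza), if_neg (Ne.symm hzb)]
  have := congrArg height h
  rwa [height_add, height_add, height_single, height_single] at this

end TorusWeights

section PieriVanishing

variable {k : Type*} [Field k] {τ : Type*} [Fintype τ] [LinearOrder τ] {m e : ℕ}

/-- An equivariant projection (onto a stable complement, along a stable subspace) of `coordRep`:
packaged facts. [folklore] -/
private theorem projection_coordRep_equivariant {W C : Subrepresentation (coordRep τ k m)}
    (hWC : IsCompl C.toSubmodule W.toSubmodule) (g : GL τ k) (u : MvPolynomial (DegIdx τ m) k) :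
    C.toSubmodule.projection W.toSubmodule hWC (coordRep τ k m g u) =
      coordRep τ k m g (C.toSubmodule.projection W.toSubmodule hWC u) := by
  obtain ⟨c, hc, w, hw, rfl⟩ :=
    Submodule.mem_sup.mp (hWC.sup_eq_top.symm ▸ Submodule.mem_top (x := u))
  rw [map_add, map_add, map_add, Submodule.projection_apply_of_mem_left hWC hc,
    Submodule.projection_apply_of_mem_right hWC hw,
    Submodule.projection_apply_of_mem_left hWC (C.apply_mem_toSubmodule g hc),
    Submodule.projection_apply_of_mem_right hWC (W.apply_mem_toSubmodule g hw), add_zero, map_add]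
  simp

/-- **Pieri vanishing.** Let `F` be a highest-weight vector of weight `χ` in `k[Sym^{m+e} k^τ]`
(characteristic zero), `W` a stable subspace of `k[Sym^m k^τ]`, and `α` an exponent all of whose
higher-height colleagues `G_{α'}` lie in `W`.  If `χ + α` is NOT a horizontal strip over `χ`, then
`G_α ∈ W` too.  Proof: otherwise `G_α` is a highest-weight vector of weight `ψ = χ + α` modulo `W`;
a failure of interlacing is a pair `x < y` with `χ_x < ψ_y`, and the string identity exhibits
`G_{α - J e_x + J e_y}` (`J = α_x`), a weight vector of weight `ψ - J(ε_x - ε_y)`, moved by the root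
subgroup `u_{xy}(t)` with top coefficient `G_α`; the root-string bound `J ≤ ψ_x - ψ_y`
(`natCast_le_sub_of_family`, Goodman–Wallach Lemma 3.2.2 / Prop. 3.2.7) contradicts `χ_x < ψ_y`.
This is the highest-weight-vector form of the VANISHING half of Pieri's formula (Fulton–Harris (6.8):
`S_χ ⊗ Sym^s` contains `S_ψ` only for horizontal strips `ψ/χ`). [cite: FultonHarrisGTM129, (6.8)] -/
theorem coeff_padPolarize_mem_of_not_isHorizStripOver [CharZero k] {χ : Weight τ}
    {F : MvPolynomial (DegIdx τ (m + e)) k} (hF : F ∈ highestWeightSpace (coordRep τ k (m + e)) χ)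
    (W : Subrepresentation (coordRep τ k m)) {α : τ →₀ ℕ}
    (hlead : ∀ α', height α < height α' → coeff α' (padPolarize k m e F) ∈ W.toSubmodule)
    (hstrip : ¬ IsHorizStripOver χ (χ + natWeight α)) :
    coeff α (padPolarize k m e F) ∈ W.toSubmodule := by
  classical
  haveI : Infinite k := CharZero.infinite k
  set P := padPolarize k m e F with hP
  set ψ : Weight τ := χ + natWeight α with hψ
  -- a failure of interlacing: `x < y` with `χ x < ψ y`
  have hfail : ∃ x y : τ, x < y ∧ χ x < ψ y := by
    by_contra hno
    push Not at hno
    apply hstrip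
    refine ⟨fun z => ?_, fun a b hba => hno b a hba⟩
    simp [hψ, natWeight_apply]
  obtain ⟨x, y, hxy, hχ⟩ := hfail
  by_contra hαW
  -- the highest-weight vector `v = q(G_α)` modulo `W`, in a stable complement `C`
  obtain ⟨C, hC⟩ := (isSemisimpleRepresentation_coordRep (σ := τ) (k := k) m).exists_isCompl W
  have hWC : IsCompl C.toSubmodule W.toSubmodule :=
    ⟨by rw [disjoint_iff]; exact congrArg Subrepresentation.toSubmodule hC.symm.1.eq_bot,
     by rw [codisjoint_iff]; exact congrArg Subrepresentation.toSubmodule hC.symm.2.eq_top⟩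
  set q := C.toSubmodule.projection W.toSubmodule hWC with hq
  have hq_equiv : ∀ (g : GL τ k) (u : MvPolynomial (DegIdx τ m) k),
      q (coordRep τ k m g u) = coordRep τ k m g (q u) := fun g u => projection_coordRep_equivariant hWC g u
  have hqW : ∀ u, q u = 0 ↔ u ∈ W.toSubmodule := fun u => Submodule.projection_apply_eq_zero_iff hWC
  obtain ⟨z, hz, hzW⟩ := exists_mem_highestWeightSpace_sub_mem
    (isSemisimpleRepresentation_coordRep (σ := τ) (k := k) m) W (ψ := ψ) (v := coeff α P)
    fun b hb => by
      rw [coordRep_apply]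
      exact coordSubst_coeff_padPolarize_sub_smul_mem hF W.toSubmodule hlead hb
  set v := q (coeff α P) with hv
  have hvz : v = q z := by
    rw [hv, ← sub_eq_zero, ← map_sub, hqW]
    exact hzW
  have hvHW : v ∈ highestWeightSpace (coordRep τ k m) ψ := by
    intro b hb
    rw [hvz, ← hq_equiv, hz b hb, map_smul]
  have hv0 : v ≠ 0 := fun h => hαW ((hqW _).mp h)
  -- the string below `α`: `γ = α - J e_x + J e_y`, `J = α x`
  set J := α x with hJ
  set γ := moveExp x y α J with hγ
  have hγy : γ y = α y + J := moveExp_apply_right hxy.ne α J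
  have hγx : γ x = 0 := by rw [hγ, moveExp_apply_left hxy.ne]; omega
  have hwt : q (coeff γ P) ∈ weightSpace (coordRep τ k m) (ψ - (J : ℤ) • rootWeight x y) := by
    have hw := coeff_padPolarize_mem_weightSpace hF γ
    have heq : χ + natWeight γ = ψ - (J : ℤ) • rootWeight x y := by
      funext z
      simp only [hψ, Pi.add_apply, Pi.sub_apply, Pi.smul_apply, natWeight_apply, smul_eq_mul,
        hγ, moveExp_apply hxy.ne, rootWeight_apply]
      rcases eq_or_ne z x with rfl | hzx
      · simp [hxy.ne, hJ]
      · rcases eq_or_ne z y with rfl | hzy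
        · simp [hzx]; ring
        · simp [hzx, hzy]
    intro t ht
    rw [← hq_equiv, hw t ht, map_smul, heq]
  -- the family: `u_{xy}(t) · q(G_γ) = ∑_{i ≤ J} t^i q(G_{γ + i e_x - i e_y})`, top coefficient `v`
  set ws : ℕ → MvPolynomial (DegIdx τ m) k := fun i => q (coeff (moveExp y x γ i) P) with hws
  have htop : ws J = v := by
    simp only [hws, hγ]
    rw [moveExp_moveExp hxy.ne' hJ.le]
  have hvan : ∀ i, J < i → i ≤ γ y → ws i = 0 := by
    intro i hJi hiy
    simp only [hws]
    rw [hqW]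
    refine hlead _ ?_
    -- height comparison
    have h1 := height_moveExp_add hxy.ne' hiy
    have h2 := height_moveExp_add hxy.ne hJ.le
    rw [← hγ] at h2
    have hlt : lettersAbove y < lettersAbove x := lettersAbove_lt_of_lt hxy
    nlinarith
  have hstr : ∀ t : k, coordRep τ k m (transvectionGL hxy.ne t) (q (coeff γ P)) =
      ∑ j ∈ Finset.range (J + 1), t ^ j • ws j := by
    intro t
    rw [← hq_equiv, coordRep_apply, coordSubst_transvectionGL_coeff_padPolarize hF hxy, map_sum]
    simp only [map_smul, hγx, zero_add, Nat.choose_self, Nat.cast_one, one_mul]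
    symm
    refine Finset.sum_subset (Finset.range_subset_range.mpr (by omega)) fun i hi hi' => ?_
    have hiJ : J < i := by
      rw [Finset.mem_range, not_lt] at hi'; omega
    have hiy : i ≤ γ y := Nat.lt_succ_iff.mp (Finset.mem_range.mp hi)
    change t ^ i • ws i = 0
    rw [hvan i hiJ hiy, smul_zero]
  have hle := natCast_le_sub_of_family (isRationalRep_coordRep m)
    (isSemisimpleRepresentation_coordRep (σ := τ) (k := k) m) hvHW hv0 hxy hwt
    (fun t => transvectionGL hxy.ne t) ws hstr htop
  -- contradiction with the failed interlacing
  simp only [hψ, Pi.add_apply, natWeight_apply, hJ] at hle hχ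
  omega

end PieriVanishing

section PieriCount

variable {k : Type*} [Field k] {σ τ : Type*} [Fintype σ] [LinearOrder σ] [Fintype τ]
  [LinearOrder τ] {ι : σ → τ}

open _root_.Literature.Barriers.ValiantsHypothesis (degIdxMap degIdxMap_val degIdxMap_injective)

/-- **(C1′-Pieri), hypothesis form**: `finrank_hwv_inf_le_add_sum_of_pad` with the sum restricted to the
PIERI predecessors `padPieriWeights ι χ (d e)` (few-row AND a horizontal strip under `χ`).  Same proof,
with the lead lemma sharpened by Pieri vanishing (`coeff_padPolarize_mem_of_not_isHorizStripOver`):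
the leading coefficient class of weight `χ + α` vanishes modulo `I_Sub` unless `χ + α` is a horizontal
strip over `χ`. [cite: KadishLandsberg2014, §2] [cite: BurgisserEtAl2011, Prop. 6.3.2]
[cite: FultonHarrisGTM129, (6.8)] -/
theorem finrank_hwv_inf_le_add_sum_of_pad_pieri [CharZero k] (hι : StrictMono ι)
    (hup : IsUpperSet (Set.range ι)) {m e : ℕ} (hm : m ≠ 0)
    {h h' : MvPolynomial σ k} (hh : h.IsHomogeneous m) (hh' : h'.IsHomogeneous m)
    {Ih Ih' : Ideal (MvPolynomial (DegIdx τ (m + e)) k)}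
    (hIh : ∀ F ∈ Ih, ∀ (c : τ → k) (g : GL τ k),
      aeval (formCoeff (m + e) (padLinForm c ^ e * linSubstRep τ k g (rename ι h))) F = 0)
    (hIh' : ∀ F : MvPolynomial (DegIdx τ (m + e)) k, (∀ (c : τ → k) (g : GL τ k),
      aeval (formCoeff (m + e) (padLinForm c ^ e * linSubstRep τ k g (rename ι h'))) F = 0) → F ∈ Ih')
    {d : ℕ} {χ : Weight τ} (hχ : χ.size = -(((m + e) * d : ℕ) : ℤ)) :
    Module.finrank k ↥(highestWeightSpace (coordRep τ k (m + e)) χ ⊓ Ih.restrictScalars k) ≤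
      Module.finrank k ↥(highestWeightSpace (coordRep τ k (m + e)) χ ⊓ Ih'.restrictScalars k) +
      ∑ π ∈ padPieriWeights ι χ (d * e),
        Module.finrank k ↥(highestWeightSpace (coordRep σ k m) π ⊓
          (orbitVanishingIdeal h m).restrictScalars k) := by
  classical
  haveI : Infinite k := CharZero.infinite k
  have hme : m + e ≠ 0 := by omega
  -- the spaces
  set V := highestWeightSpace (coordRep τ k (m + e)) χ with hV
  set W : Submodule k (MvPolynomial (DegIdx τ m) k) := (subVanishingIdeal k ι m).restrictScalars k
    with hW
  set N : Submodule k (MvPolynomial (DegIdx τ m) k) :=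
    (orbitVanishingIdeal (rename ι h) m).restrictScalars k with hN
  have hWN : W ≤ N := fun G hG => subVanishingIdeal_le h hG
  haveI hVfin : FiniteDimensional k V := finiteDimensional_highestWeightSpace_coordRep_holds hme χ
  haveI : Module.Finite k ↥(V ⊓ Ih.restrictScalars k) :=
    Module.Finite.of_injective (Submodule.inclusion (inf_le_left : V ⊓ Ih.restrictScalars k ≤ V))
      (Submodule.inclusion_injective _)
  haveI : Module.Finite k ↥(V ⊓ Ih'.restrictScalars k) :=
    Module.Finite.of_injective (Submodule.inclusion (inf_le_left : V ⊓ Ih'.restrictScalars k ≤ V))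
      (Submodule.inclusion_injective _)
  -- the coefficient-class map `F ↦ (α ↦ class of coeff_α (padPolarize F) mod W)` on exponents of degree `e d`
  let Λ : MvPolynomial (DegIdx τ (m + e)) k →ₗ[k] (DegIdx τ (e * d) → MvPolynomial (DegIdx τ m) k ⧸ W) :=
    { toFun := fun F α => W.mkQ (coeff α.1 (padPolarize k m e F))
      map_add' := fun F F' => funext fun α => by
        simp only [map_add, coeff_add, Pi.add_apply]
      map_smul' := fun a F => funext fun α => by
        simp only [map_smul, coeff_smul, Pi.smul_apply, RingHom.id_apply] }
  -- members of `V ⊓ Ih`: homogeneous of degree `d`, all coefficients in `N`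
  have hhom : ∀ F ∈ V ⊓ Ih.restrictScalars k, F.IsHomogeneous d := fun F hF =>
    isHomogeneous_of_mem_highestWeightSpace_of_size_eq' hme hχ hF.1
  have hcoefN : ∀ F ∈ V ⊓ Ih.restrictScalars k, ∀ α : τ →₀ ℕ, coeff α (padPolarize k m e F) ∈ N :=
    fun F hF => (forall_aeval_pad_eq_zero_iff_forall_coeff_padPolarize_mem
      hh.rename_isHomogeneous F).mp (hIh F hF.2)
  have hmkQ : ∀ v : MvPolynomial (DegIdx τ m) k, W.mkQ v = 0 ↔ v ∈ W := fun v => by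
    rw [← LinearMap.mem_ker, Submodule.ker_mkQ]
  -- Step 1: the kernel of `Λ` on `V ⊓ Ih` lies in `V ⊓ Ih'`
  have hker : ∀ F ∈ V ⊓ Ih.restrictScalars k, Λ F = 0 → F ∈ V ⊓ Ih'.restrictScalars k := by
    intro F hF h0
    refine ⟨hF.1, ?_⟩
    change F ∈ Ih'
    refine hIh' F ((forall_aeval_pad_eq_zero_iff_forall_coeff_padPolarize_mem
      hh'.rename_isHomogeneous F).mpr fun α => ?_)
    by_cases hα : α.degree = e * d
    · have h1 : W.mkQ (coeff α (padPolarize k m e F)) = 0 :=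
        congrFun h0 ⟨α, mem_degMonomials_iff.mpr hα⟩
      exact subVanishingIdeal_le h' ((hmkQ _).mp h1)
    · rw [coeff_padPolarize_eq_zero (hhom F hF) hα]
      exact Ideal.zero_mem _
  -- Step 2: the lead property of the image, sharpened by Pieri vanishing
  let Hs₀ : (τ →₀ ℕ) → Submodule k (MvPolynomial (DegIdx τ m) k ⧸ W) := fun a =>
    (highestWeightSpace (coordRep τ k m) (χ + natWeight a) ⊓ N).map W.mkQ
  let Hs : (τ →₀ ℕ) → Submodule k (MvPolynomial (DegIdx τ m) k ⧸ W) := fun a =>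
    if IsHorizStripOver χ (χ + natWeight a) then Hs₀ a else ⊥
  have hHs_pos : ∀ a, IsHorizStripOver χ (χ + natWeight a) → Hs a = Hs₀ a := fun a ha => if_pos ha
  have hHs_neg : ∀ a, ¬ IsHorizStripOver χ (χ + natWeight a) → Hs a = ⊥ := fun a ha => if_neg ha
  have hfinHWV : ∀ a : τ →₀ ℕ,
      Module.Finite k ↥(highestWeightSpace (coordRep τ k m) (χ + natWeight a) ⊓ N) := by
    intro a
    haveI : FiniteDimensional k (highestWeightSpace (coordRep τ k m) (χ + natWeight a)) :=
      finiteDimensional_highestWeightSpace_coordRep_holds hm _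
    exact Module.Finite.of_injective (Submodule.inclusion inf_le_left) (Submodule.inclusion_injective _)
  haveI hfinH : ∀ α : DegIdx τ (e * d), Module.Finite k (Hs α.1) := fun α => by
    by_cases hst : IsHorizStripOver χ (χ + natWeight α.1)
    · rw [hHs_pos _ hst]
      haveI := hfinHWV α.1
      exact Module.Finite.map _ _
    · rw [hHs_neg _ hst]
      infer_instance
  have hlead : ∀ s ∈ (V ⊓ Ih.restrictScalars k).map Λ, ∀ α : DegIdx τ (e * d),
      (∀ α' : DegIdx τ (e * d), height α.1 < height α'.1 → s α' = 0) → s α ∈ Hs α.1 := by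
    rintro _ ⟨F, hF, rfl⟩ α hα
    have hWlead : ∀ α' : τ →₀ ℕ, height α.1 < height α' → coeff α' (padPolarize k m e F) ∈ W := by
      intro α' hlt
      by_cases hα' : α'.degree = e * d
      · exact (hmkQ _).mp (hα ⟨α', mem_degMonomials_iff.mpr hα'⟩ hlt)
      · rw [coeff_padPolarize_eq_zero (hhom F hF) hα']
        exact W.zero_mem
    -- Pieri vanishing: off the horizontal strips the leading coefficient already lies in `W`
    by_cases hst : IsHorizStripOver χ (χ + natWeight α.1)
    swap
    · rw [hHs_neg _ hst, Submodule.mem_bot]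
      change W.mkQ (coeff α.1 (padPolarize k m e F)) = 0
      rw [hmkQ, hW, ← subVanishingSubrep_toSubmodule]
      exact coeff_padPolarize_mem_of_not_isHorizStripOver hF.1 (subVanishingSubrep k ι m)
        (fun α' hlt => by rw [subVanishingSubrep_toSubmodule]; exact hWlead α' hlt) hst
    rw [hHs_pos _ hst]
    obtain ⟨z, hz, hzW⟩ := exists_mem_highestWeightSpace_sub_mem
      (isSemisimpleRepresentation_coordRep (σ := τ) (k := k) m) (subVanishingSubrep k ι m)
      (ψ := χ + natWeight α.1) (v := coeff α.1 (padPolarize k m e F)) fun b hb => by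
        rw [coordRep_apply, subVanishingSubrep_toSubmodule]
        exact coordSubst_coeff_padPolarize_sub_smul_mem hF.1 _ hWlead hb
    refine ⟨z, ⟨hz, ?_⟩, ?_⟩
    · have hmem : coeff α.1 (padPolarize k m e F) - (coeff α.1 (padPolarize k m e F) - z) ∈ N :=
        N.sub_mem (hcoefN F hF α.1) (hWN hzW)
      rwa [sub_sub_cancel] at hmem
    · change W.mkQ z = W.mkQ (coeff α.1 (padPolarize k m e F))
      rw [← sub_eq_zero, ← map_sub, hmkQ]
      have := W.neg_mem hzW
      rwa [neg_sub] at this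
  -- Step 3: count
  have hS := HeightFiltration.finrank_le_sum (S := (V ⊓ Ih.restrictScalars k).map Λ)
    (φ := fun α : DegIdx τ (e * d) => height α.1) (fun α => Hs α.1) hlead
  have hrn := LinearMap.finrank_range_add_finrank_ker (Λ.domRestrict (V ⊓ Ih.restrictScalars k))
  rw [LinearMap.range_domRestrict] at hrn
  have hkerle : Module.finrank k ↥(LinearMap.ker (Λ.domRestrict (V ⊓ Ih.restrictScalars k))) ≤
      Module.finrank k ↥(V ⊓ Ih'.restrictScalars k) := by
    rw [← Submodule.finrank_map_subtype_eq]
    refine Submodule.finrank_mono ?_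
    rintro _ ⟨F, hF0, rfl⟩
    exact hker F F.2 (LinearMap.mem_ker.mp hF0)
  -- Step 4: the sum over exponents of degree `e d` versus the sum over the Pieri predecessors
  have hsum : ∑ α : DegIdx τ (e * d), Module.finrank k (Hs α.1) ≤
      ∑ π ∈ padPieriWeights ι χ (d * e), Module.finrank k
        ↥(highestWeightSpace (coordRep σ k m) π ⊓ (orbitVanishingIdeal h m).restrictScalars k) := by
    have hL : ∑ α : DegIdx τ (e * d), Module.finrank k (Hs α.1) =
        ∑ a ∈ (Finset.univ : Finset τ).finsuppAntidiag (d * e), Module.finrank k (Hs a) := by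
      rw [Finset.sum_coe_sort (degMonomials τ (e * d)) (fun a => Module.finrank k (Hs a)), degMonomials,
        Nat.mul_comm e d]
    rw [hL, padPieriWeights, Finset.sum_filter, padPredWeights, Finset.sum_image, Finset.sum_filter]
    · refine Finset.sum_le_sum fun a _ => ?_
      by_cases hst : IsHorizStripOver χ (χ + natWeight a)
      swap
      · rw [hHs_neg _ hst, finrank_bot]
        exact Nat.zero_le _
      rw [hHs_pos _ hst]
      split_ifs with hP hP'
      · -- few-row and a horizontal strip: transfer to `σ`
        have hψ : χ + natWeight a = Function.extend ι (fun j => χ (ι j) + (a (ι j) : ℤ)) 0 := by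
          funext x
          by_cases hx : ∃ j, ι j = x
          · obtain ⟨j, rfl⟩ := hx
            rw [hι.injective.extend_apply]
            rfl
          · rw [Function.extend_apply' _ _ _ hx, Pi.zero_apply]
            exact hP x fun hx' => hx hx'
        haveI := hfinHWV a
        haveI : FiniteDimensional k (highestWeightSpace (coordRep σ k m)
            (fun j => χ (ι j) + (a (ι j) : ℤ))) :=
          finiteDimensional_highestWeightSpace_coordRep_holds hm _
        haveI : Module.Finite k ↥(highestWeightSpace (coordRep σ k m) (fun j => χ (ι j) + (a (ι j) : ℤ)) ⊓
            (orbitVanishingIdeal h m).restrictScalars k) :=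
          Module.Finite.of_injective (Submodule.inclusion inf_le_left) (Submodule.inclusion_injective _)
        calc Module.finrank k (Hs₀ a)
            ≤ Module.finrank k ↥(highestWeightSpace (coordRep τ k m) (χ + natWeight a) ⊓ N) :=
              Submodule.finrank_map_le _ _
          _ = Module.finrank k ↥((highestWeightSpace (coordRep σ k m) (fun j => χ (ι j) + (a (ι j) : ℤ)) ⊓
                (orbitVanishingIdeal h m).restrictScalars k).map
                (rename (degIdxMap hι.injective) :
                  MvPolynomial (DegIdx σ m) k →ₐ[k] MvPolynomial (DegIdx τ m) k).toLinearMap) := by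
              rw [hψ, hN, highestWeightSpace_inf_orbitVanishingIdeal_extend_eq_map hι hup h]
          _ ≤ _ := Submodule.finrank_map_le _ _
      · -- few-row, but the extended predecessor is not a horizontal strip: impossible
        exfalso
        apply hP'
        have hψ : Function.extend ι (fun j => χ (ι j) + (a (ι j) : ℤ)) 0 = χ + natWeight a := by
          funext x
          by_cases hx : ∃ j, ι j = x
          · obtain ⟨j, rfl⟩ := hx
            rw [hι.injective.extend_apply]
            rfl
          · rw [Function.extend_apply' _ _ _ hx, Pi.zero_apply]
            exact (hP x fun hx' => hx hx').symm
        rw [hψ]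
        exact hst
      · -- not few-row: the whole highest-weight space lies in `W`
        push Not at hP
        obtain ⟨x, hx, hne⟩ := hP
        have hle : highestWeightSpace (coordRep τ k m) (χ + natWeight a) ≤ W :=
          highestWeightSpace_le_subVanishingIdeal hι.injective hup hm hx (by simpa using hne)
        have h0 : Hs₀ a = ⊥ := by
          rw [eq_bot_iff]
          rintro _ ⟨v, hv, rfl⟩
          rw [Submodule.mem_bot, hmkQ]
          exact hle hv.1
        rw [h0, finrank_bot]
    · -- injectivity of `α ↦ π` on few-row exponents
      intro a ha b hb hab
      rw [Finset.mem_coe, Finset.mem_filter] at ha hb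
      ext x
      by_cases hx : x ∈ Set.range ι
      · obtain ⟨j, rfl⟩ := hx
        have := congrFun hab j
        simp only [add_right_inj, Nat.cast_inj] at this
        exact this
      · have h1 := ha.2 x hx
        have h2 := hb.2 x hx
        omega
  -- assemble
  calc Module.finrank k ↥(V ⊓ Ih.restrictScalars k)
      = Module.finrank k ↥((V ⊓ Ih.restrictScalars k).map Λ) +
          Module.finrank k ↥(LinearMap.ker (Λ.domRestrict (V ⊓ Ih.restrictScalars k))) := hrn.symm
    _ ≤ (∑ α : DegIdx τ (e * d), Module.finrank k (Hs α.1)) +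
          Module.finrank k ↥(V ⊓ Ih'.restrictScalars k) := add_le_add hS hkerle
    _ ≤ _ := by rw [add_comm]; exact add_le_add le_rfl hsum

end PieriCount

section MatIdxPieri

variable {k : Type} [Field k]

/-- **Step D, Pieri form: the weight-indexed deficit sum over the PIERI predecessors is dominated by the
partition-indexed Pieri sum.**  As `sum_padPredWeights_hwDeficit_le_capDeficitSumContained`, plus the
translation of the weight-form strip condition `IsHorizStripOver λ* π̂` into `partHorizStrip (m²) μ λ`
(`λ*_j = -λ_{N-1-j}`: containment is `μ_i ≤ λ_i`, interlacing at the rows `i < i+1` is `λ_{i+1} ≤ μ_i`,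
and `λ_N = 0` as `ℓ(λ) ≤ N`). [cite: BurgisserEtAl2011, (5.2.2) and Prop. 6.3.2] [cite: FultonHarrisGTM129, (6.8)] -/
theorem sum_padPieriWeights_hwDeficit_le_capDeficitSumPieri [CharZero k] {n m : ℕ} [NeZero n]
    [NeZero m] (hnm : n < m) (h : MvPolynomial (MatIdx n) k) {d : ℕ} (lam : Nat.Partition (m * d))
    (hlam : lam.parts.card ≤ m * m) :
    ∑ π ∈ padPieriWeights (borelPlace hnm.le) ((Weight.dualOfPartition (m * m) lam).toMatIdx) (d * (m - n)),
        hwDeficit k h n π ≤ capDeficitSumPieri h m d lam := by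
  classical
  haveI : Infinite k := CharZero.infinite k
  set K := n * n with hK
  set N := m * m with hN
  have hKN : K ≤ N := Nat.mul_le_mul hnm.le hnm.le
  set ι₀ := borelPlace hnm.le with hι₀
  set Λ : Weight (MatIdx m) := (Weight.dualOfPartition N lam).toMatIdx with hΛ
  set M := (Finset.univ : Finset (Nat.Partition (n * d))).filter
      (fun mu => mu.parts.card ≤ K ∧ partHorizStrip N mu lam) with hM
  let dmap : Nat.Partition (n * d) → Weight (MatIdx n) := fun mu => (Weight.dualOfPartition K mu).toMatIdx
  -- injectivity of `μ ↦ μ*` on partitions with at most `K` parts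
  have hinj : Set.InjOn dmap ↑M := by
    intro mu₁ h₁ mu₂ h₂ h12
    rw [Finset.mem_coe, Finset.mem_filter] at h₁ h₂
    have hd : Weight.dualOfPartition K mu₁ = Weight.dualOfPartition K mu₂ := by
      funext i
      have := congrFun h12 (matIdxEquiv n i)
      simp only [dmap, Weight.toMatIdx, OrderIso.symm_apply_apply] at this
      exact this
    have ho : Weight.ofPartition K mu₁ = Weight.ofPartition K mu₂ := by
      have := congrArg Weight.dual hd
      simpa [Weight.dualOfPartition] using this
    exact Weight.ofPartition_injOn_holds K (n * d) h₁.2.1 h₂.2.1 ho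
  change _ ≤ ∑ mu ∈ M, hwDeficit k h n (dmap mu)
  rw [← Finset.sum_image hinj]
  refine Finset.sum_le_sum_of_ne_zero fun π hπ hδ => ?_
  -- unpack `π ∈ padPieriWeights`
  simp only [padPieriWeights, padPredWeights, Finset.mem_image, Finset.mem_filter] at hπ
  obtain ⟨⟨α, ⟨hαdeg, hfew⟩, rfl⟩, hst⟩ := hπ
  have hαdeg' : α.degree = d * (m - n) := mem_degMonomials_iff.mp hαdeg
  -- a nonzero deficit forces a highest weight of `k[Sym^n]`
  have hp : plethysmCoeff k (MatIdx n) n (fun j => Λ (ι₀ j) + (α (ι₀ j) : ℤ)) ≠ 0 := fun h0 =>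
    hδ (by unfold hwDeficit; rw [h0]; exact Nat.zero_sub _)
  have hHW : HasHighestWeight (coordRep (MatIdx n) k n) (fun j => Λ (ι₀ j) + (α (ι₀ j) : ℤ)) := by
    intro hbot
    apply hp
    unfold plethysmCoeff hwMultiplicity
    rw [hbot, finrank_bot]
  obtain ⟨f', -, hf'⟩ := exists_hasHighestWeight_orbitCoordRep_of_hasHighestWeight_coordRep hHW
  -- the size of `π`
  have hsizeΛ : Λ.size = -((m * d : ℕ) : ℤ) := size_toMatIdx_dualOfPartition (m := m) lam hlam
  have hmd : m * d = n * d + d * (m - n) := by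
    obtain ⟨e, rfl⟩ : ∃ e, m = n + e := ⟨m - n, by omega⟩
    rw [Nat.add_sub_cancel_left]; ring
  have hsize : Weight.size (fun j => Λ (ι₀ j) + (α (ι₀ j) : ℤ)) = -((n * d : ℕ) : ℤ) := by
    have h1 : Weight.size (fun j => Λ (ι₀ j) + (α (ι₀ j) : ℤ)) =
        ∑ x ∈ (Finset.univ : Finset (MatIdx n)).image ι₀, (Λ x + (α x : ℤ)) := by
      rw [Weight.size, Finset.sum_image fun a _ b _ hab => (borelPlace_strictMono hnm.le).injective hab]
    have h2 : ∑ x ∈ (Finset.univ : Finset (MatIdx n)).image ι₀, (Λ x + (α x : ℤ)) =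
        ∑ x, (Λ x + (α x : ℤ)) :=
      Finset.sum_subset (Finset.subset_univ _) fun x _ hx => hfew x fun ⟨j, hj⟩ =>
        hx (Finset.mem_image.mpr ⟨j, Finset.mem_univ _, hj⟩)
    have h3 : ∑ x, (Λ x + (α x : ℤ)) = Λ.size + (α.degree : ℤ) := by
      rw [Finset.sum_add_distrib, Weight.size, Finsupp.degree_eq_sum, Nat.cast_sum]
    rw [h1, h2, h3, hsizeΛ, hαdeg', hmd]
    push_cast
    ring
  obtain ⟨mu', hmuK, hmu⟩ :=
    exists_eq_dualOfPartition_of_hasHighestWeight_orbitCoordRep_of_size_eq (matIdxEquiv n) f' hf' hsize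
  let mu : Nat.Partition (n * d) := ⟨mu'.parts, mu'.parts_pos, by rw [mu'.parts_sum, mul_comm]⟩
  have hmu_eq : dmap mu = fun j => Λ (ι₀ j) + (α (ι₀ j) : ℤ) := by rw [hmu]; rfl
  -- the dual weights entrywise on `Fin N`: `μ*_j = Λ_j + α_j`, `λ*_j = Λ_j`
  have hmuN : ∀ j : Fin N, Weight.dualOfPartition N mu j =
      Λ (matIdxEquiv m j) + (α (matIdxEquiv m j) : ℤ) := by
    intro j
    rw [dualOfPartition_eq_extend_topEmb hKN mu hmuK]
    by_cases hj : ∃ i₁, topEmb hKN i₁ = j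
    · obtain ⟨i₁, rfl⟩ := hj
      rw [(topEmb_strictMono hKN).injective.extend_apply]
      have h1 := congrFun hmu_eq (matIdxEquiv n i₁)
      simp only [dmap, Weight.toMatIdx, OrderIso.symm_apply_apply] at h1
      have h2 : ι₀ (matIdxEquiv n i₁) = matIdxEquiv m (topEmb hKN i₁) := by
        simp only [hι₀, borelPlace, OrderIso.symm_apply_apply]
      rw [h1, h2]
    · rw [Function.extend_apply' _ _ _ hj, Pi.zero_apply]
      have hx : matIdxEquiv m j ∉ Set.range ι₀ := by
        rintro ⟨y, hy⟩
        refine hj ⟨(matIdxEquiv n).symm y, (matIdxEquiv m).injective ?_⟩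
        simp only [hι₀, borelPlace] at hy
        exact hy
      exact (hfew _ hx).symm
  have hlamN : ∀ j : Fin N, Weight.dualOfPartition N lam j = Λ (matIdxEquiv m j) := fun j => by
    simp only [hΛ, Weight.toMatIdx, OrderIso.symm_apply_apply]
  -- the extended predecessor is `Λ + α`
  have hext : Function.extend ι₀ (fun j => Λ (ι₀ j) + (α (ι₀ j) : ℤ)) 0 = Λ + natWeight α := by
    funext x
    by_cases hx : ∃ j, ι₀ j = x
    · obtain ⟨j, rfl⟩ := hx
      rw [(show Function.Injective ι₀ from (borelPlace_strictMono hnm.le).injective).extend_apply]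
      rfl
    · rw [Function.extend_apply' _ _ _ hx, Pi.zero_apply, Pi.add_apply, natWeight_apply]
      exact (hfew x fun ⟨j, hj⟩ => hx ⟨j, hj⟩).symm
  rw [hext] at hst
  refine Finset.mem_image.mpr
    ⟨mu, Finset.mem_filter.mpr ⟨Finset.mem_univ _, hmuK, fun i => ?_, fun i => ?_⟩, hmu_eq⟩
  · -- containment `μ ⊂ λ`
    have h1 := hmuN (Fin.rev i)
    have h2 := hlamN (Fin.rev i)
    simp only [Weight.dualOfPartition, Weight.dual, Fin.rev_rev] at h1 h2
    have : (0 : ℤ) ≤ (α (matIdxEquiv m (Fin.rev i)) : ℤ) := Nat.cast_nonneg _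
    omega
  · -- interlacing `λ_{i+1} ≤ μ_i`
    by_cases hi : (i : ℕ) + 1 < N
    · set i' : Fin N := ⟨(i : ℕ) + 1, hi⟩ with hi'
      have hii' : i < i' := Fin.lt_def.mpr (by simp [hi'])
      have hineq := hst.2 (matIdxEquiv m (Fin.rev i)) (matIdxEquiv m (Fin.rev i'))
        ((matIdxEquiv m).strictMono (Fin.rev_lt_rev.mpr hii'))
      simp only [Pi.add_apply, natWeight_apply] at hineq
      rw [← hmuN, ← hlamN] at hineq
      simp only [Weight.dualOfPartition, Weight.dual, Fin.rev_rev, neg_le_neg_iff, Weight.ofPartition,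
        hi'] at hineq
      exact hineq
    · have hlen : lam.sortedParts.length ≤ (i : ℕ) + 1 := by
        rw [Nat.Partition.length_sortedParts]; omega
      rw [List.getD_eq_default _ _ hlen, Nat.cast_zero]
      exact Nat.cast_nonneg _

end MatIdxPieri

/-! ### (C1′-Pieri)/(C1-Pieri)/(C2-Pieri): the Pieri-sharp capability bound, weight form -/

section Final1Pieri

variable {k : Type*} [Field k] {σ τ : Type*} [Fintype σ] [LinearOrder σ] [Fintype τ]
  [LinearOrder τ] {ι : σ → τ}

/-- **(C1′-Pieri) Capability bound for highest-weight equations, Pieri-sharp.**  As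
`finrank_hwv_inf_pad_le_add_sum_hwDeficit`, with the deficit sum restricted to the PIERI predecessors of `χ`
at distance `d e` (few-row AND `χ + α` a horizontal strip over `χ`): the vanishing half of Pieri's formula
for highest-weight vectors (`coeff_padPolarize_mem_of_not_isHorizStripOver`) kills the other leading
coefficient classes. [cite: Landsberg2017, Thm. 8.1.3.1 and Prop. 8.4.2.2] [cite: BurgisserEtAl2011, Prop. 6.3.2]
[cite: FultonHarrisGTM129, (6.8)] -/
theorem finrank_hwv_inf_pad_le_add_sum_hwDeficit_pieri [CharZero k] (hι : StrictMono ι)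
    (hup : IsUpperSet (Set.range ι)) {t : τ} (ht : t ∉ Set.range ι) {m e : ℕ} (hm : m ≠ 0)
    {h h' : MvPolynomial σ k} (hh : h.IsHomogeneous m) (hh' : h'.IsHomogeneous m) {d : ℕ}
    {χ : Weight τ} (hχ : χ.size = -(((m + e) * d : ℕ) : ℤ)) :
    Module.finrank k ↥(highestWeightSpace (coordRep τ k (m + e)) χ ⊓
        (orbitVanishingIdeal (X t ^ e * rename ι h) (m + e)).restrictScalars k) ≤
      Module.finrank k ↥(highestWeightSpace (coordRep τ k (m + e)) χ ⊓
        (orbitVanishingIdeal (X t ^ e * rename ι h') (m + e)).restrictScalars k) +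
      ∑ π ∈ padPieriWeights ι χ (d * e),
        Module.finrank k ↥(highestWeightSpace (coordRep σ k m) π ⊓
          (orbitVanishingIdeal h m).restrictScalars k) := by
  haveI : Infinite k := CharZero.infinite k
  exact finrank_hwv_inf_le_add_sum_of_pad_pieri hι hup hm hh hh'
    (fun F hF => (mem_orbitVanishingIdeal_pad_iff ht h m e F).mp hF)
    (fun F hF => (mem_orbitVanishingIdeal_pad_iff ht h' m e F).mpr hF) hχ

/-- **(C1-Pieri) = (C1) ∩ Pieri — the Pieri-sharp capability bound for multiplicities** (THEOREM V23-bis,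
general weight form; THEORY-1's SPEC l.3149): `ι : σ → τ` strictly monotone onto an upper set,
`t ∉ range ι`, `h, h'` forms of degree `m ≠ 0`, characteristic zero, `χ` a weight of degree `d`:
`mult_χ k[Δ(x_t^e ι h')] ≤ mult_χ k[Δ(x_t^e ι h)] + Σ_{π ∈ Pieri preds(χ)} (a_π - mult_π k[Δ_m(h)])`.
Only the VANISHING half of the Pieri rule (no `S_ψ` in `S_χ ⊗ Sym^s` off the horizontal strips) is used,
in the highest-weight-vector form proved here from the root-string bound; the multiplicity-one half is not
needed for the inequality. [cite: Landsberg2017, Thm. 8.1.3.1 and Prop. 8.4.2.2] [cite: BurgisserEtAl2011, Prop. 6.3.2]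
[cite: FultonHarrisGTM129, (6.8)] -/
theorem orbitMultiplicity_pad_le_add_sum_hwDeficit_pieri [CharZero k] (hι : StrictMono ι)
    (hup : IsUpperSet (Set.range ι)) {t : τ} (ht : t ∉ Set.range ι) {m e : ℕ} (hm : m ≠ 0)
    {h h' : MvPolynomial σ k} (hh : h.IsHomogeneous m) (hh' : h'.IsHomogeneous m) {d : ℕ}
    {χ : Weight τ} (hχ : χ.size = -(((m + e) * d : ℕ) : ℤ)) :
    orbitMultiplicity k (X t ^ e * rename ι h') (m + e) χ ≤
      orbitMultiplicity k (X t ^ e * rename ι h) (m + e) χ +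
        ∑ π ∈ padPieriWeights ι χ (d * e), hwDeficit k h m π := by
  have hme : m + e ≠ 0 := by omega
  have h1 := orbitMultiplicity_add_finrank_inf_eq_plethysmCoeff (X t ^ e * rename ι h) hme χ
  have h2 := orbitMultiplicity_add_finrank_inf_eq_plethysmCoeff (X t ^ e * rename ι h') hme χ
  have h3 := finrank_hwv_inf_pad_le_add_sum_hwDeficit_pieri hι hup ht hm hh hh' hχ
  have h4 : ∑ π ∈ padPieriWeights ι χ (d * e), Module.finrank k ↥(highestWeightSpace (coordRep σ k m) π ⊓
      (orbitVanishingIdeal h m).restrictScalars k) = ∑ π ∈ padPieriWeights ι χ (d * e), hwDeficit k h m π :=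
    Finset.sum_congr rfl fun π _ => (hwDeficit_eq_finrank h hm π).symm
  omega

/-- **(C2-Pieri) The INCAPABLE criterion, Pieri form.**  Fullness of `h` at the PIERI predecessors of
`χ` at distance `d e` already gives `mult_χ k[Δ(x_t^e ι h')] ≤ mult_χ k[Δ(x_t^e ι h)]` for every form
`h'` of degree `m`. [cite: Landsberg2017, Thm. 8.1.3.1 and Prop. 8.4.2.2] [cite: FultonHarrisGTM129, (6.8)] -/
theorem orbitMultiplicity_pad_le_of_forall_padPieri [CharZero k] (hι : StrictMono ι)
    (hup : IsUpperSet (Set.range ι)) {t : τ} (ht : t ∉ Set.range ι) {m e : ℕ} (hm : m ≠ 0)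
    {h h' : MvPolynomial σ k} (hh : h.IsHomogeneous m) (hh' : h'.IsHomogeneous m) {d : ℕ}
    {χ : Weight τ} (hχ : χ.size = -(((m + e) * d : ℕ) : ℤ))
    (H : ∀ π ∈ padPieriWeights ι χ (d * e), orbitMultiplicity k h m π = plethysmCoeff k σ m π) :
    orbitMultiplicity k (X t ^ e * rename ι h') (m + e) χ ≤
      orbitMultiplicity k (X t ^ e * rename ι h) (m + e) χ := by
  have hsum : ∑ π ∈ padPieriWeights ι χ (d * e), hwDeficit k h m π = 0 :=
    Finset.sum_eq_zero fun π hπ => by unfold hwDeficit; rw [H π hπ]; exact Nat.sub_self _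
  have := orbitMultiplicity_pad_le_add_sum_hwDeficit_pieri hι hup ht hm hh hh' hχ
  rw [hsum, add_zero] at this
  exact this

/-- **(C2-Pieri, obstruction form).**  If moreover `x_t^e ι h ∈ Δ_{m+e}(P)`, fullness of `h` at the Pieri
predecessors of `χ` gives `mult_χ k[Δ(x_t^e ι h')] ≤ mult_χ k[Δ_{m+e}(P)]`: `χ` is not a multiplicity
obstruction against `x_t^e ι h' ∈ Δ(P)`. [cite: Landsberg2017, Thm. 8.1.3.1 and Prop. 8.4.2.2]
[cite: BurgisserEtAl2011, Prop. 6.3.2] -/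
theorem orbitMultiplicity_pad_le_of_forall_padPieri_of_mem_orbitClosure [CharZero k] (hι : StrictMono ι)
    (hup : IsUpperSet (Set.range ι)) {t : τ} (ht : t ∉ Set.range ι) {m e : ℕ} (hm : m ≠ 0)
    {h : MvPolynomial σ k} (hh : h.IsHomogeneous m) {P : MvPolynomial τ k}
    (hP : X t ^ e * rename ι h ∈ orbitClosure P) {h' : MvPolynomial σ k} (hh' : h'.IsHomogeneous m)
    {d : ℕ} {χ : Weight τ} (hχ : χ.size = -(((m + e) * d : ℕ) : ℤ))
    (H : ∀ π ∈ padPieriWeights ι χ (d * e), orbitMultiplicity k h m π = plethysmCoeff k σ m π) :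
    orbitMultiplicity k (X t ^ e * rename ι h') (m + e) χ ≤ orbitMultiplicity k P (m + e) χ := by
  have hme : m + e ≠ 0 := by omega
  refine (orbitMultiplicity_pad_le_of_forall_padPieri hι hup ht hm hh hh' hχ H).trans ?_
  exact orbitMultiplicity_le_of_hwv_inf_le hme fun F hF =>
    ⟨hF.1, orbitVanishingIdeal_le_of_mem_orbitClosure hP hF.2⟩

end Final1Pieri

/-! ### (C4): the cell's THEOREM V23-bis, Pieri form -/

section MatIdxPieriFinal

variable {k : Type} [Field k]

/-- **(C4) THEOREM V23-bis as printed in the cell (Pieri form) — PROVED.**  `0 < n < m`, characteristic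
zero, `h'` any form of degree `n` on the `n × n` matrix letters, `λ ⊢ m d` with at most `m²` parts:
`mult_{λ*} k[Δ(x₀₀^{m-n} · h')] ≤ mult_{λ*} k[Δ(det_m)] + ε^{det_n}(λ; d)` with
`ε(λ; d) = Σ_{λ/μ horizontal strip, ℓ(μ) ≤ n²} (a_{μ*} - mult_{μ*} k[Δ(det_n)])` (V23.md §7).  (C3) with the
containment sum replaced by the Pieri sum; (C1-Pieri) along the Borel placement plus Step D, Pieri form.
[cite: FultonHarrisGTM129, (6.8)] [cite: BurgisserEtAl2011, Prop. 6.3.2 and §6.3] [cite: Landsberg2017, Prop. 8.4.1.1 and Prop. 8.4.2.2] -/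
theorem orbitMultiplicity_pad_le_detFormLex_add_capDeficitSumPieri [CharZero k] {n m : ℕ} [NeZero n]
    [NeZero m] (hnm : n < m) {h' : MvPolynomial (MatIdx n) k} (hh' : h'.IsHomogeneous n) {d : ℕ}
    (lam : Nat.Partition (m * d)) (hlam : lam.parts.card ≤ m * m) :
    orbitMultiplicity k (X (toLex ((0 : Fin m), (0 : Fin m))) ^ (m - n) * rename (blockPlace hnm.le) h') m
        (Weight.dualOfPartition (m * m) lam).toMatIdx ≤
      orbitMultiplicity k (detFormLex k m) m (Weight.dualOfPartition (m * m) lam).toMatIdx +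
        capDeficitSumPieri (detFormLex k n) m d lam := by
  haveI : Infinite k := CharZero.infinite k
  have hm : m ≠ 0 := NeZero.ne m
  set t : MatIdx m := toLex ((0 : Fin m), (0 : Fin m)) with ht
  set Λ : Weight (MatIdx m) := (Weight.dualOfPartition (m * m) lam).toMatIdx with hΛ
  have htb := toLex_zero_not_mem_range_blockPlace (n := n) (m := m) hnm
  have hti := toLex_zero_not_mem_range_borelPlace (n := n) (m := m) hnm
  -- (C1) along the Borel placement, reference form `det_n`
  have hχ : Λ.size = -(((n + (m - n)) * d : ℕ) : ℤ) := by
    rw [Nat.add_sub_cancel' hnm.le]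
    exact size_toMatIdx_dualOfPartition (m := m) lam hlam
  have hPadDet := pad_detFormLex_mem_orbitClosure_detFormLex (k := k) hnm.le
  have key := orbitMultiplicity_pad_le_add_sum_hwDeficit_pieri (borelPlace_strictMono hnm.le)
    (isUpperSet_range_borelPlace hnm.le) hti (NeZero.ne n) (detFormLex_isHomogeneous k n) hh' hχ
  rw [Nat.add_sub_cancel' hnm.le] at key
  -- placements
  rw [orbitMultiplicity_pad_rename_eq_rename (blockPlace hnm.le) (borelPlace hnm.le)
    (blockPlace_injective hnm.le) (borelPlace_strictMono hnm.le).injective htb hti h' (m - n) hm Λ]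
  have hdet : orbitMultiplicity k (X t ^ (m - n) * rename (borelPlace hnm.le) (detFormLex k n)) m Λ ≤
      orbitMultiplicity k (detFormLex k m) m Λ := by
    rw [← orbitMultiplicity_pad_rename_eq_rename (blockPlace hnm.le) (borelPlace hnm.le)
      (blockPlace_injective hnm.le) (borelPlace_strictMono hnm.le).injective htb hti (detFormLex k n)
      (m - n) hm Λ]
    exact orbitMultiplicity_le_of_hwv_inf_le hm fun F hF =>
      ⟨hF.1, orbitVanishingIdeal_le_of_mem_orbitClosure hPadDet hF.2⟩
  have hsum := sum_padPieriWeights_hwDeficit_le_capDeficitSumPieri (k := k) hnm (detFormLex k n) lam hlam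
  calc _ ≤ _ := key
    _ ≤ _ := add_le_add hdet hsum

/-- **(C4, V1 object).**  The same for the tree's padded permanent:
`mult_{λ*} k[Δ(x₀₀^{m-n} per_n)] ≤ mult_{λ*} k[Δ(det_m)] + ε^{det_n}(λ; d)` (Pieri sum).
[cite: FultonHarrisGTM129, (6.8)] [cite: BurgisserEtAl2011, Prop. 6.3.2 and §6.3] -/
theorem orbitMultiplicity_paddedPerFormLex_le_detFormLex_add_capDeficitSumPieri [CharZero k]
    {n m : ℕ} [NeZero n] [NeZero m] (hnm : n < m) {d : ℕ} (lam : Nat.Partition (m * d))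
    (hlam : lam.parts.card ≤ m * m) :
    orbitMultiplicity k (paddedPerFormLex k n m) m (Weight.dualOfPartition (m * m) lam).toMatIdx ≤
      orbitMultiplicity k (detFormLex k m) m (Weight.dualOfPartition (m * m) lam).toMatIdx +
        capDeficitSumPieri (detFormLex k n) m d lam := by
  have hper : (rename toLex (perPoly (Fin n) k) : MvPolynomial (MatIdx n) k).IsHomogeneous n := by
    have h := (perPoly_isHomogeneous (n := Fin n) (k := k)).rename_isHomogeneous (f := toLex)
    rwa [Fintype.card_fin] at h
  rw [paddedPerFormLex_eq_pad hnm.le]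
  exact orbitMultiplicity_pad_le_detFormLex_add_capDeficitSumPieri hnm hper lam hlam

/-- **(C4 with CERTIFIED LOWER BOUNDS = the cell's `ε_cert` of v23bis.py, Pieri form).**  If
`lo μ ≤ mult_{μ*} k[Δ(det_n)]` for every `μ ⊢ n d` with `ℓ(μ) ≤ n²` (`lo := 0` on unmeasured keys), then for
every form `h'` of degree `n` on the `n × n` letters and every `λ ⊢ m d`, `ℓ(λ) ≤ m²`:
`mult_{λ*} k[Δ(x₀₀^{m-n} h')] ≤ mult_{λ*} k[Δ(det_m)] + Σ_{λ/μ horizontal strip, ℓ(μ) ≤ n²} (a_{μ*} - lo μ)`.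
[cite: Landsberg2017, Thm. 8.1.3.1] [cite: BurgisserEtAl2011, Prop. 6.3.2 and §6.3] -/
theorem orbitMultiplicity_pad_le_detFormLex_add_sum_of_lowerBounds_pieri [CharZero k] {n m : ℕ} [NeZero n]
    [NeZero m] (hnm : n < m) {h' : MvPolynomial (MatIdx n) k} (hh' : h'.IsHomogeneous n) {d : ℕ}
    (lam : Nat.Partition (m * d)) (hlam : lam.parts.card ≤ m * m) (lo : Nat.Partition (n * d) → ℕ)
    (Hlo : ∀ mu : Nat.Partition (n * d), mu.parts.card ≤ n * n →
      lo mu ≤ orbitMultiplicity k (detFormLex k n) n (Weight.dualOfPartition (n * n) mu).toMatIdx) :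
    orbitMultiplicity k (X (toLex ((0 : Fin m), (0 : Fin m))) ^ (m - n) * rename (blockPlace hnm.le) h') m
        (Weight.dualOfPartition (m * m) lam).toMatIdx ≤
      orbitMultiplicity k (detFormLex k m) m (Weight.dualOfPartition (m * m) lam).toMatIdx +
        ∑ mu ∈ (Finset.univ : Finset (Nat.Partition (n * d))).filter
            (fun mu => mu.parts.card ≤ n * n ∧ partHorizStrip (m * m) mu lam),
          (plethysmCoeff k (MatIdx n) n (Weight.dualOfPartition (n * n) mu).toMatIdx - lo mu) := by
  refine (orbitMultiplicity_pad_le_detFormLex_add_capDeficitSumPieri hnm hh' lam hlam).trans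
    (Nat.add_le_add_left ?_ _)
  unfold capDeficitSumPieri
  refine Finset.sum_le_sum fun mu hmu => ?_
  rw [Finset.mem_filter] at hmu
  unfold hwDeficit
  exact Nat.sub_le_sub_left (Hlo mu hmu.2.1) _

/-- **(C4, INCAPABLE criterion, Pieri form)** = the cell's «`ε_cert(λ; d) = 0` ⇒ no obstruction at
`(λ, d)`»: if `det_n` is FULL at every `μ ⊢ n d` with `ℓ(μ) ≤ n²` and `λ/μ` a horizontal strip, then
`mult_{λ*} k[Δ(x₀₀^{m-n} h')] ≤ mult_{λ*} k[Δ(det_m)]` for EVERY form `h'` of degree `n` on the `n × n` letters.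
[cite: FultonHarrisGTM129, (6.8)] [cite: BurgisserEtAl2011, Prop. 6.3.2 and §6.3] -/
theorem orbitMultiplicity_pad_le_detFormLex_of_forall_horizStrip [CharZero k] {n m : ℕ} [NeZero n]
    [NeZero m] (hnm : n < m) {h' : MvPolynomial (MatIdx n) k} (hh' : h'.IsHomogeneous n) {d : ℕ}
    (lam : Nat.Partition (m * d)) (hlam : lam.parts.card ≤ m * m)
    (H : ∀ mu : Nat.Partition (n * d), mu.parts.card ≤ n * n → partHorizStrip (m * m) mu lam →
      plethysmCoeff k (MatIdx n) n (Weight.dualOfPartition (n * n) mu).toMatIdx ≤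
        orbitMultiplicity k (detFormLex k n) n (Weight.dualOfPartition (n * n) mu).toMatIdx) :
    orbitMultiplicity k (X (toLex ((0 : Fin m), (0 : Fin m))) ^ (m - n) * rename (blockPlace hnm.le) h') m
        (Weight.dualOfPartition (m * m) lam).toMatIdx ≤
      orbitMultiplicity k (detFormLex k m) m (Weight.dualOfPartition (m * m) lam).toMatIdx := by
  refine (orbitMultiplicity_pad_le_detFormLex_add_capDeficitSumPieri hnm hh' lam hlam).trans
    (le_of_eq ?_)
  have h0 : capDeficitSumPieri (detFormLex k n) m d lam = 0 := by
    unfold capDeficitSumPieri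
    refine Finset.sum_eq_zero fun mu hmu => ?_
    rw [Finset.mem_filter] at hmu
    unfold hwDeficit
    exact Nat.sub_eq_zero_of_le (H mu hmu.2.1 hmu.2.2)
  rw [h0, add_zero]

/-- **(C4, INCAPABLE criterion for the V1 object `x₀₀^{m-n} per_n`, Pieri form).**  Fullness of `det_n`
at the horizontal strips `λ/μ` with `ℓ(μ) ≤ n²` gives `mult_{λ*} k[Δ(x₀₀^{m-n} per_n)] ≤ mult_{λ*} k[Δ(det_m)]`.
[cite: FultonHarrisGTM129, (6.8)] [cite: BurgisserEtAl2011, Prop. 6.3.2 and §6.3] -/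
theorem orbitMultiplicity_paddedPerFormLex_le_detFormLex_of_forall_horizStrip [CharZero k] {n m : ℕ}
    [NeZero n] [NeZero m] (hnm : n < m) {d : ℕ} (lam : Nat.Partition (m * d)) (hlam : lam.parts.card ≤ m * m)
    (H : ∀ mu : Nat.Partition (n * d), mu.parts.card ≤ n * n → partHorizStrip (m * m) mu lam →
      plethysmCoeff k (MatIdx n) n (Weight.dualOfPartition (n * n) mu).toMatIdx ≤
        orbitMultiplicity k (detFormLex k n) n (Weight.dualOfPartition (n * n) mu).toMatIdx) :
    orbitMultiplicity k (paddedPerFormLex k n m) m (Weight.dualOfPartition (m * m) lam).toMatIdx ≤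
      orbitMultiplicity k (detFormLex k m) m (Weight.dualOfPartition (m * m) lam).toMatIdx := by
  have hper : (rename toLex (perPoly (Fin n) k) : MvPolynomial (MatIdx n) k).IsHomogeneous n := by
    have h := (perPoly_isHomogeneous (n := Fin n) (k := k)).rename_isHomogeneous (f := toLex)
    rwa [Fintype.card_fin] at h
  rw [paddedPerFormLex_eq_pad hnm.le]
  exact orbitMultiplicity_pad_le_detFormLex_of_forall_horizStrip hnm hper lam hlam H

end MatIdxPieriFinal

end Literature.Computability.AlgebraicComplexity
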